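import Mathlib
import Literature.NumberTheory.EllipticCurves.Rubin1991.TwoVariableMainConjecture
import Literature.NumberTheory.EllipticCurves.TwoVariableAnticyclotomicControl
import Literature.NumberTheory.EllipticCurves.SubgroupSelmerCocycleCriteriaProofs
import Literature.NumberTheory.EllipticCurves.SupersingularInertiaNoFixedPointProofs
import Literature.NumberTheory.EllipticCurves.SerreInertiaImageBaseChangeProofs
import Literature.NumberTheory.EllipticCurves.H1UnramifiedFinite
import Literature.NumberTheory.GaloisRepresentations.LocalGaloisGroupProofs
import Literature.NumberTheory.EllipticCurves.TwoVariableSelmerTower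
import Literature.NumberTheory.EllipticCurves.TwoVariableSelmerDual
import Literature.NumberTheory.EllipticCurves.TwoVariableAnticyclotomicControl
import Summits.BirchSwinnertonDyer.BirchSwinnertonDyer.Theorems.EisensteinPrimesTwoVariableSelmerControl
import Summits.BirchSwinnertonDyer.BirchSwinnertonDyer.Theorems.SignedBaseChangeAnticyclotomicEisensteinDivisibilityControlCokerDescent
import Literature.NumberTheory.EllipticCurves.HeegnerPointsKolyvaginTorsionProofs
import Summits.BirchSwinnertonDyer.BirchSwinnertonDyer.Theorems.SignedBaseChangeAnticyclotomicEisensteinDivisibilityAwayDiscrepancy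
import Literature.NumberTheory.GaloisRepresentations.AbsGaloisGroupCompact
import Literature.NumberTheory.EllipticCurves.StrictSelmerRankOneDegreeOneProofs
import Literature.NumberTheory.EllipticCurves.SelmerGaloisAction
import Summits.BirchSwinnertonDyer.Rank1Residual.X11b.AnticyclotomicSelmerStructure
import Summits.BirchSwinnertonDyer.BirchSwinnertonDyer.Theorems.EisensteinPrimesTwistDeformationFullAtSelmerOfFacts
import Literature.NumberTheory.EllipticCurves.SelmerLocalConditionGoodReductionProofs
import Literature.NumberTheory.EllipticCurves.H1UnramifiedFiniteProofs
import Literature.NumberTheory.EllipticCurves.SelmerCorankAssembly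
import Summits.BirchSwinnertonDyer.BirchSwinnertonDyer.Theorems.CongruentShaFreeCutSelmerRelaxationUniform
import Summits.BirchSwinnertonDyer.Rank1Residual.GaloisImage.LocalH1TorsionBounded
import Literature.NumberTheory.IwasawaTheory.Greenberg2006.LocalEulerPoincareCorank
import Literature.Barriers.BirchSwinnertonDyer.DescentDefectUnboundedMatsunoCor33Proofs
import Literature.NumberTheory.EllipticCurves.MatarNekovar2019.IrreducibleOverQuadraticFieldProofs
import Literature.NumberTheory.EllipticCurves.ZywinaCMImageProofs
import Literature.NumberTheory.EllipticCurves.Serre1968OrdinaryLocalNonsplit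

/-!
# KatoLineSupply — the arithmetic supplier of door 4's `hfix`, TYPED (bsd-idea-14 g18–g20, 2026-08-29; v1.14)

Fourth crux workfile on `TwoVariableEulerSystemDivisibility` (stmt-BirchSwinnertonDyer-20728); a WORKFILE, not a skeleton (nothing
registered, W-79; line of record `Lines/ratlift.lean` v4). Companion of `QtameDoor3.lean` v1.2 §E13b, whose `engine_door4_XGr₂` consumes
`hfix : ∀ s : unrSelmer₂ κ₁ κ₂ (W.geomPrimaryTorsion p) vbar, conjSel₂ … γ₁ s = s → conjSel₂ … γ₂ s = s → p ^ k • s = 0`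
(«`p^k` kills `Sel_{∅,0}(K̃_∞, E[p^∞])^{Γ_K}`»). `Cruxes/` files are not importable on the farm, so this file restates that shape by
name (`HfixBound … k`) and types/proves its two arithmetic suppliers (A′) `BottomControlExponent` (bottom-layer control for the
`ℤ_p²`-tower, exponent form) and (B′) finiteness of the bottom group `Sel_Gr(K, E[p^∞])` (`bottomSelmer`: strict at `v̄`, relaxed at
`v`, trivial at `w ∤ p`). The full narrative of every version, with sources and page references, is the dossier `KatoLine.md` §1b–§1k
(and this file's git history); the section headers below carry the mathematics of each step.

VERSION LOG (one line each; details in KatoLine.md): v1.0–v1.1 (g18) typed (A′), (B′), `HfixBound`; (A′) decomposed into (A1′)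
`GlobalBottomSurjective`, (A2′) `AwayExponent`, (A3′) `StrictAtVbarExponent` with the composition proved · v1.2 (g19) (A3′) at a
SUPERSINGULAR `v̄` PROVED with `m₃ = 0` · v1.3 (A1′), (A2′) PROVED — (A′) a theorem at a split supersingular `p`
(`bottomControlExponent_supersingular`) · v1.4 (A3′) in exponent form on all of 20728's range from the typed local (A3″)
`InertiaTowerFixedPointExponent` (`hfixBound_of_fixedPointExponent_of_finite`) · v1.5–v1.9 (B′) decomposed: (B′-i′)
`BottomStrictFinite` PROVED in rank one by transport into the tree's strict Selmer group; rank-robust residue (B′-iv)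
`BottomKummerFiniteIndexAt`; limit step `AddSubgroup.relIndex_pos_and_le_of_monotone_cover` · v1.10 (g20) (B′-v) `Finite Sel_Gr[p]` PROVED
for any `E/K` (`finite_bottomSelmer_inf_torsionBy`) · v1.11 THE LEVELWISE IMAGE BOUND PROVED in rank one at a split `p`
(`exists_image_card_le_of_mordellWeilRank_eq_one`; reciprocity at the single relaxed place `v` + one point of infinite order), hence
(B′-iv), (B′) and `hfixBound_supersingular_of_HGZ` · v1.12 (A3″)_ord DECOMPOSED: the ordinary line EXISTS
(`exists_ordinaryLineAt_baseChange`), the tower twist (`exists_mem_pairKer_inf_inertia_smul_eq`), `OrdinaryLineAt → NoStableComplementAt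
→ (A3″)`; door `hfixBound_of_nonsplit_of_HGZ` from HGZ + the one typed input `OrdinaryNonsplit` at ordinary `p`; fact ledger `h₁ h₂` in
`hfixBound_of_nonsplit_of_analyticRankEK_eq_one` · v1.13 (section `SerreForm`) the residue in SERRE'S FORM over `ℚ`:
`SerreNonsplitAt p E 𝔔` at a prime `𝔔` of `\bar ℤ_ℚ`, the TRANSPORT `ordinaryNonsplit_baseChange_of_serreNonsplitAt` PROVED
(`res(D_v̄) = D_𝔔`, pull-back along `E(ℚ̄)[p^∞] ≃ E_K(K̄)[p^∞]`), the named-fact shape `Serre1968OrdinaryNonsplit` (hypothesis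
`¬ HasCM`; NOT proved), and the doors `hfixBound_of_serre_of_HGZ` / `hfixBound_of_serre_of_analyticRankEK_eq_one` (`¬ HasCM` from `Surj`
by the tree theorem `WeierstrassCurve.not_hasSurjectiveModNGaloisRep_of_hasCM`) · v1.14 the shape IS NOW A LITERATURE NAMED FACT
(`serre1968_locallyNonsplit_of_not_hasCM`, `Literature/NumberTheory/EllipticCurves/Serre1968OrdinaryLocalNonsplit.lean`, p701097):
`serre1968OrdinaryNonsplit_of_literature` (identity of bodies) and the door `hfixBound_of_literature_of_analyticRankEK_eq_one`.

STANDING after v1.14: door (7-bot)'s `hfix` holds on ALL residue types of 20728's range, on the analytic-rank-ONE slice of `E_K`,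
MODULO exactly the named facts {`h₁` = `analyticRankEK_eq_one_iff_LDerivEK_ne_zero` (GZ86 I.§7), `h₂` =
`mordellWeilRank_eq_one_of_LDerivEK_ne_zero` (GZ86 I.6.3 + Kolyvagin 1990 + Heegner-point existence)} and, at ordinary `p` only,
the Literature named fact `serre1968_locallyNonsplit_of_not_hasCM` (Serre 1968 IV-A.2 + Tate 1967 Thm. 4; = this file's shape
`Serre1968OrdinaryNonsplit`) — everything else is a binder of 20728 or a theorem of the tree.
Typed Props NOT proved here: `InertiaTowerFixedPointExponent` (A3″, proved at supersingular `v̄`, reduced to Serre's fact at ordinary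
`v̄`), `NoStableComplementAt` / `OrdinaryNonsplit` / `NoStableComplementAbs` / `SerreNonsplitAt` / `Serre1968OrdinaryNonsplit` (the
print input in three equivalent dresses). 20728 itself has NO analytic-rank binder (rank ≥ 3: door (7-bot) does not apply; input (7)
of the engine stays open there), and nothing here touches the Euler-system side (`DepthFibreBoundsDVR`, `KSIndS.md`). Every `theorem`
of this file is sorry-free (`lean check` rc 0). No summit statement is proved; BSD is not proved by this file.
-/

noncomputable section

set_option linter.dupNamespace false

namespace Summit.BirchSwinnertonDyer.BirchSwinnertonDyer.Cruxes.TwoVariableEulerSystemDivisibility.KatoLineSupply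

open NumberField IsDedekindDomain Field
open Literature.NumberTheory.GaloisRepresentations Literature.NumberTheory.EllipticCurves
open Literature.NumberTheory.EllipticCurves.Castella2018 Literature.NumberTheory.EllipticCurves.GreenbergSelmer

variable {p : ℕ} [Fact p.Prime]
variable {K : Type} [Field K] [NumberField K] (W : WeierstrassCurve K) (κ₁ κ₂ : ZpExtension K p)
  (vbar : HeightOneSpectrum (𝓞 K)) (γ₁ γ₂ : absoluteGaloisGroup K)

variable (p) in
/-- **`Sel_Gr(K, E[p^∞])`** — the bottom group of the `(∅,0)` tower: Castella's `Sel_{v̄}(K, E[p^∞])` over `K`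
itself (`H = ⊤ = Gal(K̄/K)`): strict at `v̄`, no condition above the other prime over `p`, locally trivial at the
finite `w ∤ p` and at `∞`. BSTW24 Part II §2.3.1 `Sel_Gr(g_{/L})` (their `v` is our `v̄`).
[cite: Castella2018, Def. 2.2] [cite: arXiv:2409.01350, Part II §2.3.1 (p. 69–70)] -/
abbrev bottomSelmer : AddSubgroup (subgroupH1 (⊤ : Subgroup (absoluteGaloisGroup K)) (W.geomPrimaryTorsion p)) :=
  AcSelmer.selmerOver ⊤ (W.geomPrimaryTorsion p) p vbar ∅

/-- Restriction `H¹(K, E[p^∞]) → H¹(K̃_∞, E[p^∞])` down the `ℤ_p²`-tower (`resOfLe` along `pairKer κ₁ κ₂ ≤ ⊤`).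
[cite: GreenbergLNM1716, §3] -/
abbrev resTower : subgroupH1 (⊤ : Subgroup (absoluteGaloisGroup K)) (W.geomPrimaryTorsion p) →+
    subgroupH1 (ZpExtension.pairKer κ₁ κ₂) (W.geomPrimaryTorsion p) :=
  resOfLe (W.geomPrimaryTorsion p) le_top

/-- Restriction carries `Sel_Gr(K, E[p^∞])` into `Sel_{∅,0}(K̃_∞, E[p^∞]) = unrSelmer₂` (compatibility of the
local conditions, tree `resOfLe_mem_datumSelmer_of_mem_selmerOver`). [cite: SkinnerUrban2014, §3.2.7] -/
theorem resTower_mem {t : subgroupH1 (⊤ : Subgroup (absoluteGaloisGroup K)) (W.geomPrimaryTorsion p)}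
    (ht : t ∈ bottomSelmer p W vbar) :
    resTower W κ₁ κ₂ t ∈ unrSelmer₂ κ₁ κ₂ (W.geomPrimaryTorsion p) vbar :=
  resOfLe_mem_datumSelmer_of_mem_selmerOver le_top ht

/-- **The `hfix` shape of `QtameDoor3.engine_door4_XGr₂`, by name**: `p^k` kills every class of
`Sel_{∅,0}(K̃_∞, E[p^∞])` fixed by `γ₁` and `γ₂`. -/
def HfixBound (k : ℕ) : Prop :=
  ∀ s : unrSelmer₂ κ₁ κ₂ (W.geomPrimaryTorsion p) vbar,
    conjSel₂ κ₁ κ₂ (W.geomPrimaryTorsion p) vbar γ₁ s = s →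
    conjSel₂ κ₁ κ₂ (W.geomPrimaryTorsion p) vbar γ₂ s = s → p ^ k • s = 0

/-- **(A′) bottom-layer control, exponent form**: some `p^m` multiplies every `⟨γ₁,γ₂⟩`-invariant class of `Sel_{∅,0}(K̃_∞, E[p^∞])`
into the restriction of `Sel_Gr(K, E[p^∞])` (printed one-variable model BSTW24 II Prop. 3.1(b)/Cor. 3.2; kernel side the tree's
`fixedPoints_pairKer_geomPrimaryTorsion_eq_bot`). DECOMPOSED (v1.1, `bottomControlExponent_of_pieces`); PROVED at a split SUPERSINGULAR `p`
(v1.3, `bottomControlExponent_supersingular`); at ordinary `p` reduced to Serre's local non-splitness (sections `OrdinaryResidue`,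
`SerreForm`). [cite: arXiv:2409.01350, Part II Prop. 3.1, Cor. 3.2 (p. 78)] [cite: GreenbergLNM1716, §3 Lemma 3.1, §4 Prop. 4.8] -/
def BottomControlExponent : Prop :=
  ∃ m : ℕ, ∀ s : unrSelmer₂ κ₁ κ₂ (W.geomPrimaryTorsion p) vbar,
    conjSel₂ κ₁ κ₂ (W.geomPrimaryTorsion p) vbar γ₁ s = s →
    conjSel₂ κ₁ κ₂ (W.geomPrimaryTorsion p) vbar γ₂ s = s →
      ∃ t ∈ bottomSelmer p W vbar,
        resTower W κ₁ κ₂ t =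
          p ^ m • (s : subgroupH1 (ZpExtension.pairKer κ₁ κ₂) (W.geomPrimaryTorsion p))

variable (p) in
/-- **(B′) the bottom group has finite exponent**: `p^n · Sel_Gr(K, E[p^∞]) = 0`. In analytic rank one over `K`
this follows from its finiteness: Skinner 2020 §2.3 Lemma 4 (`H¹_𝔭(K,V) = 0`) + Kolyvagin + Gross–Zagier.
[cite: arXiv:1405.7294, §2.3 Lemma 4 (p. 8)] [cite: Kolyvagin1990, Thm. A] -/
def BottomSelmerExponent : Prop :=
  ∃ n : ℕ, ∀ t ∈ bottomSelmer p W vbar, p ^ n • t = 0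

/-- **Door 4's `hfix` from (A′) + (B′)**: `k = n + m`. [cite: GreenbergLNM1716, §3] -/
theorem hfixBound_of_bottom (hA : BottomControlExponent W κ₁ κ₂ vbar γ₁ γ₂)
    (hB : BottomSelmerExponent p W vbar) : ∃ k : ℕ, HfixBound W κ₁ κ₂ vbar γ₁ γ₂ k := by
  obtain ⟨m, hm⟩ := hA
  obtain ⟨n, hn⟩ := hB
  refine ⟨n + m, fun s h1 h2 ↦ ?_⟩
  obtain ⟨t, ht, hts⟩ := hm s h1 h2
  have h0 : ((p ^ (n + m) • s : ↥(unrSelmer₂ κ₁ κ₂ (W.geomPrimaryTorsion p) vbar)) :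
      subgroupH1 (ZpExtension.pairKer κ₁ κ₂) (W.geomPrimaryTorsion p)) = 0 := by
    rw [AddSubmonoidClass.coe_nsmul, pow_add, mul_smul, ← hts, ← map_nsmul, hn t ht, map_zero]
  exact ZeroMemClass.coe_eq_zero.mp h0

omit [Fact p.Prime] in
variable (p) in
/-- (B′) from FINITENESS of `Sel_Gr(K, E[p^∞])` and the `p`-power torsion of its classes (coefficients
`E[p^∞]` are `p`-primary; Serre, *Galois Cohomology* I §2.2). [cite: arXiv:1405.7294, §2.3 Lemma 4 (p. 8)] -/
theorem bottomSelmerExponent_of_finite (hfin : (SetLike.coe (bottomSelmer p W vbar)).Finite)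
    (hprim : ∀ t ∈ bottomSelmer p W vbar, ∃ n : ℕ, p ^ n • t = 0) : BottomSelmerExponent p W vbar := by
  classical
  choose! n hn using hprim
  refine ⟨∑ u ∈ hfin.toFinset, n u, fun t ht ↦ ?_⟩
  have hmem : t ∈ hfin.toFinset := hfin.mem_toFinset.mpr ht
  have hle : n t ≤ ∑ u ∈ hfin.toFinset, n u :=
    Finset.single_le_sum (f := n) (fun _ _ ↦ Nat.zero_le _) hmem
  rw [← Nat.sub_add_cancel hle, pow_add, mul_smul, hn t ht, smul_zero]

/-- **Door 4's `hfix` from bottom control + finiteness of `Sel_Gr(K, E[p^∞])`** (the form in which the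
analytic-rank-one literature supplies it). [cite: arXiv:2409.01350, Part II Prop. 3.1 (p. 78)]
[cite: arXiv:1405.7294, §2.3 Lemma 4 (p. 8)] -/
theorem hfixBound_of_control_of_finite (hA : BottomControlExponent W κ₁ κ₂ vbar γ₁ γ₂)
    (hfin : (SetLike.coe (bottomSelmer p W vbar)).Finite)
    (hprim : ∀ t ∈ bottomSelmer p W vbar, ∃ n : ℕ, p ^ n • t = 0) :
    ∃ k : ℕ, HfixBound W κ₁ κ₂ vbar γ₁ γ₂ k :=
  hfixBound_of_bottom W κ₁ κ₂ vbar γ₁ γ₂ hA (bottomSelmerExponent_of_finite p W vbar hfin hprim)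

/-! ## (A′) decomposed: global surjectivity, away-from-`p` exponent, automatic strictness at a supersingular `v̄` -/

/-- **(A1′) global bottom surjectivity for the `ℤ_p²`-tower**: every `⟨γ₁,γ₂⟩`-invariant class of `Sel_{∅,0}(K̃_∞, E[p^∞])` is the
restriction of a class of `H¹(K, E[p^∞])` — Greenberg LNM 1716 §3 Lemma 3.2 along `γ₂` then `γ₁`, the intermediate class being invariant
because `E(K̃_∞)[p^∞] = 0` (tree `resOfLe_injective_of_forall_fixed_eq_zero`, `fixedPoints_pairKer_geomPrimaryTorsion_eq_bot`; one-variable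
twin `mem_range_resOfLe_of_conjH1_eq`). PROVED below under `E(K)[p] = 0` (`globalBottomSurjective_of_noPTorsion`, v1.3; from `Surj`:
`noPTorsion_baseChange_of_hasSurjectiveModNGaloisRep`). [cite: GreenbergLNM1716, §3 Lemma 3.2 (p. 86 of the held copy)] -/
def GlobalBottomSurjective : Prop :=
  ∀ s : unrSelmer₂ κ₁ κ₂ (W.geomPrimaryTorsion p) vbar,
    conjSel₂ κ₁ κ₂ (W.geomPrimaryTorsion p) vbar γ₁ s = s →
    conjSel₂ κ₁ κ₂ (W.geomPrimaryTorsion p) vbar γ₂ s = s →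
      ∃ t : subgroupH1 (⊤ : Subgroup (absoluteGaloisGroup K)) (W.geomPrimaryTorsion p),
        resTower W κ₁ κ₂ t = (s : subgroupH1 (ZpExtension.pairKer κ₁ κ₂) (W.geomPrimaryTorsion p))

/-- **(A2′) away-from-`p` exponent**: a uniform `p^m` makes every class of `H¹(K, E[p^∞])` whose restriction to `K̃_∞` lies in
`Sel_{∅,0}` locally trivial at every finite `w ∤ p` and at every infinite place (all conjugates). Content: `K̃_∞/K` is unramified at
`w ∤ p` and `H¹_ur(K_w, E[p^∞]) = E[p^∞]^{I_w}/(Frob_w - 1)` is FINITE (zero at good `w`); `K_w = ℂ` at `∞`. PROVED below for every `K`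
with all infinite places complex (`awayExponent_of_isComplex`, v1.3). [cite: GreenbergLNM1716, §3 Lemma 3.3, §4 (p. 109)]
[cite: arXiv:2409.01350, Part II Prop. 3.1 (p. 78)] -/
def AwayExponent : Prop :=
  ∃ m : ℕ, ∀ t : subgroupH1 (⊤ : Subgroup (absoluteGaloisGroup K)) (W.geomPrimaryTorsion p),
    resTower W κ₁ κ₂ t ∈ unrSelmer₂ κ₁ κ₂ (W.geomPrimaryTorsion p) vbar →
      (∀ v : HeightOneSpectrum (𝓞 K), ((p : ℕ) : 𝓞 K) ∉ v.asIdeal →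
          ∀ σ : absoluteGaloisGroup K,
            conjH1 ⊤ (W.geomPrimaryTorsion p) σ (p ^ m • t) ∈ awayKer ⊤ (W.geomPrimaryTorsion p) v) ∧
      ∀ (w : InfinitePlace K) (σ : absoluteGaloisGroup K),
        conjH1 ⊤ (W.geomPrimaryTorsion p) σ (p ^ m • t) ∈ infKer ⊤ (W.geomPrimaryTorsion p) w

/-- **(A3′) strictness exponent at `v̄`**: a uniform `p^{m₃}` makes every class of `H¹(K, E[p^∞])` whose restriction to
`K̃_∞` lies in `Sel_{∅,0}` (Greenberg's INERTIA condition `M⁺_{v̄} = 0` above `v̄`) STRICT at `v̄` (all conjugates). The obstruction is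
`H¹(D_v̄/N, E[p^∞]^N)`, `N = I_v̄ ∩ Gal(K̄/K̃_∞)` (inflation–restriction). SUPERSINGULAR `v̄`: `m₃ = 0` (`E[p]|_{I_p}` is the level-2
fundamental character of order `p² − 1` and `I_v̄/N` is pro-`p`, so `E[p^∞]^N = 0`; PROVED, `strictAtVbarExponent_of_inertia_cyclic`).
ORDINARY `v̄` (inside 20728's range — no supersingularity clause): `m₃ < ∞` iff `E[p^∞]|_{G_{ℚ_p}}` is NON-SPLIT, which holds for
non-CM `E` (Tate 1967 Thm. 4 + Raynaud 1974 + the Serre–Tate canonical lift: a splitting makes `E` a canonical lift, hence CM,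
contradicting `Surj`; Serre 1968 IV-A.2) — reduced in sections `StrictExponent`/`OrdinaryResidue`/`SerreForm` to the ONE named-fact
shape `Serre1968OrdinaryNonsplit`; in the CM/split case (outside 20728) no uniform `m₃` exists, so `Surj` is genuinely used (critic
V#23r). Tree twins: `Sprung2012.lem23_localTowerPoints_noPTorsion`, `fixedPoints_pairKer_geomPrimaryTorsion_eq_bot`.
[cite: GreenbergLNM1716, §4 Prop. 4.8 and its proof (p. 109)] [cite: Sprung2012, Lemma 2.3] [cite: arXiv:2409.01350, Part II Prop. 3.1(b) (p. 78)]
[cite: Tate1967, §4 Thm. 4 and Cor. 2] [cite: Raynaud1974, §3.3 Cor. 3.3.6] [cite: Messing1972, Ch. V Thm. 3.3 and Appendix]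
[cite: Serre1968, IV-A.2] [cite: Serre1972, §4.5] -/
def StrictAtVbarExponent : Prop :=
  ∃ m₃ : ℕ, ∀ t : subgroupH1 (⊤ : Subgroup (absoluteGaloisGroup K)) (W.geomPrimaryTorsion p),
    resTower W κ₁ κ₂ t ∈ unrSelmer₂ κ₁ κ₂ (W.geomPrimaryTorsion p) vbar →
      ∀ σ : absoluteGaloisGroup K,
        conjH1 ⊤ (W.geomPrimaryTorsion p) σ (p ^ m₃ • t) ∈
          (AcSelmer.strictDatum (W.geomPrimaryTorsion p) vbar).strictKer ⊤

/-- **(A1′) + (A2′) + (A3′) ⟹ (A′)** (bookkeeping through `AcSelmer.mem_selmerOver_iff`; the exponent of (A′) is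
`m₂ + m₃`). [cite: arXiv:2409.01350, Part II Prop. 3.1 (p. 78)] -/
theorem bottomControlExponent_of_pieces (h1 : GlobalBottomSurjective W κ₁ κ₂ vbar γ₁ γ₂)
    (h2 : AwayExponent W κ₁ κ₂ vbar) (h3 : StrictAtVbarExponent W κ₁ κ₂ vbar) :
    BottomControlExponent W κ₁ κ₂ vbar γ₁ γ₂ := by
  obtain ⟨m₂, hm₂⟩ := h2
  obtain ⟨m₃, hm₃⟩ := h3
  refine ⟨m₂ + m₃, fun s hs1 hs2 ↦ ?_⟩
  obtain ⟨t, ht⟩ := h1 s hs1 hs2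
  -- every `p`-power multiple of `t` still restricts into `Sel_{∅,0}`
  have htn : ∀ n : ℕ, resTower W κ₁ κ₂ (p ^ n • t) ∈ unrSelmer₂ κ₁ κ₂ (W.geomPrimaryTorsion p) vbar := by
    intro n; rw [map_nsmul, ht]; exact AddSubgroup.nsmul_mem _ s.2 _
  have e₂ : p ^ (m₂ + m₃) • t = p ^ m₂ • (p ^ m₃ • t) := by rw [pow_add, mul_smul]
  have e₃ : p ^ (m₂ + m₃) • t = p ^ m₃ • (p ^ m₂ • t) := by rw [pow_add, mul_comm, mul_smul]
  refine ⟨p ^ (m₂ + m₃) • t, ?_, by rw [map_nsmul, ht]⟩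
  rw [AcSelmer.mem_selmerOver_iff]
  obtain ⟨haway, hinf⟩ := hm₂ (p ^ m₃ • t) (htn m₃)
  refine ⟨fun v hv _ σ ↦ ?_, fun w σ ↦ ?_, fun σ ↦ ?_⟩
  · rw [e₂]; exact haway v hv σ
  · rw [e₂]; exact hinf w σ
  · rw [e₃]; exact hm₃ (p ^ m₂ • t) (htn m₂) σ

/-- **The whole by-name chain to door 4's `hfix`**: (A1′)+(A2′)+(A3′)+(B′) ⟹ `∃ k, HfixBound … k`.
[cite: GreenbergLNM1716, §3] [cite: arXiv:1405.7294, §2.3 Lemma 4 (p. 8)] -/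
theorem hfixBound_of_pieces (h1 : GlobalBottomSurjective W κ₁ κ₂ vbar γ₁ γ₂)
    (h2 : AwayExponent W κ₁ κ₂ vbar) (h3 : StrictAtVbarExponent W κ₁ κ₂ vbar)
    (hB : BottomSelmerExponent p W vbar) : ∃ k : ℕ, HfixBound W κ₁ κ₂ vbar γ₁ γ₂ k :=
  hfixBound_of_bottom W κ₁ κ₂ vbar γ₁ γ₂ (bottomControlExponent_of_pieces W κ₁ κ₂ vbar γ₁ γ₂ h1 h2 h3) hB

/-! ## (A3′) at a supersingular `v̄`: `m₃ = 0` — PROVED (v1.2; KatoLine.md §1d)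

Inflation–restriction with trivial invariants, at the cocycle level: if the restriction of `c ∈ H¹(K, M)` to `K̃_∞` satisfies
Greenberg's INERTIA condition at `v̄` and `M/M⁺` has no non-zero point fixed by `Gal(K̄/K̃_∞) ∩ I_v̄` (a normal subgroup of
`D_v̄`), then `c` is STRICT at `v̄`. For `M = E[p^∞]` at a SUPERSINGULAR `v̄ ∣ p` with `e(v̄|p) = 1` the invariants vanish by
Serre's Prop. 12 (c) (tree `InertiaFixedPoint.primary_eq_zero_of_forall_pairKer_inf_inertia_smul_eq`,
`InertiaFixedPoint.isCyclic_and_card_inertia_map_baseChange`). -/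

section StrictSupersingular

/-- Cocycle algebra: a crossed homomorphism `g` (`g(ab) = g(a) + a·g(b)`) vanishing on a conjugation-stable subset
`S` takes values fixed by `S`: `s·g(y) = g(sy) − g(s) = g(y·(y⁻¹sy)) = g(y)`.
[cite: SerreGaloisCohomology1997, I §2.6 (b)] -/
theorem smul_apply_eq_of_crossed_of_vanishing {G X : Type*} [Group G] [AddCommGroup X]
    [DistribMulAction G X] (g : G → X) (hg : ∀ a b, g (a * b) = g a + a • g b) (S : Set G)
    (hS : ∀ s ∈ S, g s = 0) (hconj : ∀ s ∈ S, ∀ y : G, y⁻¹ * s * y ∈ S) {s : G} (hs : s ∈ S)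
    (y : G) : s • g y = g y := by
  have h1 : g (s * y) = s • g y := by rw [hg, hS s hs, zero_add]
  have h2 : g (s * y) = g y := by
    have e : s * y = y * (y⁻¹ * s * y) := by group
    rw [e, hg, hS _ (hconj s hs y), smul_zero, add_zero]
  rw [← h1, h2]

/-- `I_v ⊴ D_v` for the tree's chosen local groups (`GreenbergSelmer.inertia`/`decomp` are the images of
`absInertia K_v ⊴ Γ_{K_v}` under `Γ_{K_v} → Γ_K`; `absInertia_normal_holds`).
[cite: SerreLocalFields1979, I §7 Prop. 20] -/
theorem conj_mem_inertia_of_mem_decomp {v : HeightOneSpectrum (𝓞 K)} {d i : absoluteGaloisGroup K}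
    (hd : d ∈ GreenbergSelmer.decomp v) (hi : i ∈ GreenbergSelmer.inertia v) :
    d⁻¹ * i * d ∈ GreenbergSelmer.inertia v := by
  obtain ⟨σ, rfl⟩ := hd
  obtain ⟨τ, hτ, rfl⟩ := hi
  haveI : (absInertia (v.adicCompletion K)).Normal := absInertia_normal_holds (v.adicCompletion K)
  exact ⟨σ⁻¹ * τ * σ, Subgroup.Normal.conj_mem' inferInstance τ hτ σ, by rw [map_mul, map_mul, map_inv]⟩

/-- **Inflation–restriction with trivial invariants (cocycle level).** For a normal subgroup `P ≤ Γ_K`, a local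
datum `N` at `v` and `c ∈ H¹(K, M) = H¹(⊤, M)`: if Greenberg's INERTIA map kills `res_P c`
(`N.greenbergMap P (res c) = 0 ∈ H¹(P ∩ I_v, M/M⁺)`) and `M/M⁺` has no non-zero point fixed by `P ∩ I_v`, then `c`
is STRICT at `v` (`N.strictMap ⊤ c = 0 ∈ H¹(D_v, M/M⁺)`). Proof: a representative `z` with `z|_{P ∩ I_v} = ∂n mod M⁺`
gives the crossed homomorphism `y ↦ z(y) − (y·n − n)` on `D_v` with values in `M/M⁺`, vanishing on the normal subgroup
`P ∩ I_v` of `D_v`, hence valued in `(M/M⁺)^{P ∩ I_v} = 0`; so `z ≡ ∂n` on `D_v`.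
[cite: SerreGaloisCohomology1997, I §2.6 (b)] [cite: GreenbergLNM1716, §4 Prop. 4.8 (proof, p. 109)] -/
theorem strictMap_top_eq_zero_of_greenbergMap_resOfLe_eq_zero
    {M : Type} [AddCommGroup M] [DistribMulAction (absoluteGaloisGroup K) M] [TopologicalSpace M]
    [DiscreteTopology M] (P : Subgroup (absoluteGaloisGroup K)) [P.Normal] {v : HeightOneSpectrum (𝓞 K)}
    (N : LocalDatum K M v)
    (hfix : ∀ x : N.Gr, (∀ d : GreenbergSelmer.decomp v, (d : absoluteGaloisGroup K) ∈ P →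
      (d : absoluteGaloisGroup K) ∈ GreenbergSelmer.inertia v → d • x = x) → x = 0)
    (c : subgroupH1 (⊤ : Subgroup (absoluteGaloisGroup K)) M)
    (hc : N.greenbergMap P (resOfLe M (le_top : P ≤ ⊤) c) = 0) :
    N.strictMap ⊤ c = 0 := by
  obtain ⟨z, rfl⟩ :=
    oneCocycleClass_surjective (discreteTopRep (⊤ : Subgroup (absoluteGaloisGroup K)) M) c
  -- the hypothesis on the representative: `z|_{P ∩ I_v} ≡ ∂n` in `M/M⁺`
  have e := congrArg (fun f ↦ f (oneCocycleClass _ z))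
    (resH1Hom_comp (subgroupInclusion (le_top : P ≤ ⊤)) (AddMonoidHom.id M) (fun _ _ ↦ rfl)
      (inertiaInToH P v) N.grMk (fun _ _ ↦ rfl))
  change N.greenbergMap P (resOfLe M le_top (oneCocycleClass _ z)) = _ at e
  rw [hc] at e
  obtain ⟨n, hn⟩ := (CocycleCriteria.resH1Hom_oneCocycleClass_eq_zero_iff _ _ _ z).1 e.symm
  -- the corrected crossed homomorphism on `D_v` (`= decompIn ⊤ v ≤ decomp v`) with values in `M/M⁺`
  have hcompat : ∀ (a : decompIn (⊤ : Subgroup (absoluteGaloisGroup K)) v) (m : M),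
      N.grMk (decompInToH ⊤ v a • m) = a • N.grMk m := fun _ _ ↦ rfl
  set g : decompIn (⊤ : Subgroup (absoluteGaloisGroup K)) v → N.Gr :=
    fun y ↦ N.grMk (z.1 (decompInToH ⊤ v y)) - (y • n - n) with hgdef
  have hg : ∀ a b, g (a * b) = g a + a • g b := by
    intro a b
    simp only [hgdef]
    rw [map_mul, z.2, discreteTopRep_ρ_apply, map_add, hcompat, mul_smul]
    simp only [smul_sub]
    abel
  set S : Set (decompIn (⊤ : Subgroup (absoluteGaloisGroup K)) v) :=
    {s | ((s : GreenbergSelmer.decomp v) : absoluteGaloisGroup K) ∈ P ∧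
      ((s : GreenbergSelmer.decomp v) : absoluteGaloisGroup K) ∈ GreenbergSelmer.inertia v} with hSdef
  have hS : ∀ s ∈ S, g s = 0 := by
    rintro s ⟨hsP, hsI⟩
    have h := hn ⟨(s : GreenbergSelmer.decomp v), (mem_inertiaIn_iff P v _).2 ⟨hsP, hsI⟩⟩
    simp only [hgdef]
    rw [sub_eq_zero]
    exact h
  have hconj : ∀ s ∈ S, ∀ y : decompIn (⊤ : Subgroup (absoluteGaloisGroup K)) v, y⁻¹ * s * y ∈ S := by
    rintro s ⟨hsP, hsI⟩ y
    refine ⟨?_, ?_⟩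
    · simp only [Subgroup.coe_mul, Subgroup.coe_inv]
      exact Subgroup.Normal.conj_mem' inferInstance _ hsP _
    · simp only [Subgroup.coe_mul, Subgroup.coe_inv]
      exact conj_mem_inertia_of_mem_decomp (y : GreenbergSelmer.decomp v).2 hsI
  -- every value of `g` is fixed by `P ∩ I_v`, hence `0`
  have hy : ∀ y, g y = 0 := fun y ↦ hfix (g y) fun d hdP hdI ↦
    smul_apply_eq_of_crossed_of_vanishing g hg S hS hconj
      (s := ⟨d, (mem_decompIn_iff ⊤ v d).2 (Subgroup.mem_top _)⟩) ⟨hdP, hdI⟩ y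
  -- so `z ≡ ∂n` on `D_v`: the strict class vanishes
  unfold LocalDatum.strictMap
  refine (CocycleCriteria.resH1Hom_oneCocycleClass_eq_zero_iff _ _ _ z).2 ⟨n, fun y ↦ ?_⟩
  have h := hy y
  simp only [hgdef] at h
  exact sub_eq_zero.1 h

/-- The strict datum has `M⁺ = 0`, so `M → M/M⁺` is injective and **no-fixed-points transports**: if no non-zero
point of `M` is fixed by `P ∩ I_v̄` then none of `M/M⁺ = M/0` is.
[cite: Castella2018, §2.1 Def. 2.1–2.2 (arXiv:1704.06608 p. 5)] -/
theorem strictDatum_gr_eq_zero_of_forall_smul_eq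
    {M : Type} [AddCommGroup M] [DistribMulAction (absoluteGaloisGroup K) M]
    (P : Subgroup (absoluteGaloisGroup K))
    (hM : ∀ m : M, (∀ t ∈ P ⊓ GreenbergSelmer.inertia vbar, t • m = m) → m = 0)
    (x : (AcSelmer.strictDatum M vbar).Gr)
    (hx : ∀ d : GreenbergSelmer.decomp vbar, (d : absoluteGaloisGroup K) ∈ P →
      (d : absoluteGaloisGroup K) ∈ GreenbergSelmer.inertia vbar → d • x = x) : x = 0 := by
  obtain ⟨m, rfl⟩ := (AcSelmer.strictDatum M vbar).grMk_surjective x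
  have hinj : Function.Injective (AcSelmer.strictDatum M vbar).grMk :=
    (AddMonoidHom.ker_eq_bot_iff _).1 (LocalDatum.ker_grMk _)
  have hm : m = 0 := hM m fun t ht ↦ hinj (by
    have h := hx ⟨t, inertia_le_decomp vbar (Subgroup.mem_inf.1 ht).2⟩ (Subgroup.mem_inf.1 ht).1
      (Subgroup.mem_inf.1 ht).2
    rwa [LocalDatum.smul_grMk] at h)
  rw [hm, map_zero]

/-- **(A3′) at a supersingular `v̄`, PROVED with `m₃ = 0`.** If `v̄ ∣ p` and the inertia group `I_v̄ ≤ Γ_K` acts on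
`E[p]` through a CYCLIC group of order `p² − 1` (Serre 1972 Prop. 12 (c): good supersingular reduction, `e(v̄|p) = 1`;
supplied for `E/ℚ` over an imaginary quadratic `K` with `p` split by
`InertiaFixedPoint.isCyclic_and_card_inertia_map_baseChange`), then EVERY class of `H¹(K, E[p^∞])` whose restriction to
`K̃_∞` lies in `Sel_{∅,0}(K̃_∞, E[p^∞])` is strict at `v̄`, with all its conjugates (no `p`-power needed):
`E[p^∞]^{Gal(K̄/K̃_∞) ∩ I_v̄} = 0` (tree `InertiaFixedPoint.primary_eq_zero_of_forall_pairKer_inf_inertia_smul_eq`),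
inflation–restriction (`strictMap_top_eq_zero_of_greenbergMap_resOfLe_eq_zero`), and `res ∘ conj_σ = conj_σ ∘ res`
(`resOfLe_comp_conjH1_holds`). No summit statement is proved. [cite: Serre1972, §1.11 Prop. 12 c)]
[cite: GreenbergLNM1716, §4 Prop. 4.8 (p. 109)] -/
theorem strictAtVbarExponent_of_inertia_cyclic [W.IsElliptic] (hv : ((p : ℕ) : 𝓞 K) ∈ vbar.asIdeal)
    (hcyc : IsCyclic ((GreenbergSelmer.inertia vbar).map (W.galoisRepTorsion (p : ℤ))))
    (hcard : Nat.card ((GreenbergSelmer.inertia vbar).map (W.galoisRepTorsion (p : ℤ))) = p ^ 2 - 1) :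
    StrictAtVbarExponent W κ₁ κ₂ vbar := by
  refine ⟨0, fun t ht σ ↦ ?_⟩
  rw [pow_zero, one_smul, LocalDatum.mem_strictKer_iff]
  -- Greenberg's (inertia) condition at `v̄` for `conj_σ (res t) = res (conj_σ t)`
  have h1 := ((GreenbergVatsal2000.mem_datumSelmer_iff _).1 ht).2 vbar hv σ
  rw [AcSelmer.bdpData_self, LocalDatum.mem_greenbergKer_iff] at h1
  have hcomm := congrArg (fun f ↦ f t)
    (resOfLe_comp_conjH1_holds (M := W.geomPrimaryTorsion p) (le_top : ZpExtension.pairKer κ₁ κ₂ ≤ ⊤) σ)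
  simp only [AddMonoidHom.comp_apply] at hcomm
  rw [← hcomm] at h1
  exact strictMap_top_eq_zero_of_greenbergMap_resOfLe_eq_zero (ZpExtension.pairKer κ₁ κ₂)
    (AcSelmer.strictDatum (W.geomPrimaryTorsion p) vbar)
    (strictDatum_gr_eq_zero_of_forall_smul_eq vbar (ZpExtension.pairKer κ₁ κ₂) fun m hm ↦
      InertiaFixedPoint.primary_eq_zero_of_forall_pairKer_inf_inertia_smul_eq W κ₁ κ₂ vbar hcyc hcard hm)
    _ h1

/-- **(A3′) with `m₃ = 0` for `E/ℚ` base-changed to `K`, at a split supersingular `p`** — 20728's setting plus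
`p ∣ a_p`: `E/ℚ` globally minimal with good reduction at the odd prime `p`, `p ∣ a_p(E)`, `K` imaginary quadratic
with `p = v v̄` split. Serre's Prop. 12 (c) over `K` at `v̄` is the tree's
`InertiaFixedPoint.isCyclic_and_card_inertia_map_baseChange`. [cite: Serre1972, §1.11 Prop. 12 c)] -/
theorem strictAtVbarExponent_baseChange_of_dvd_frobeniusTrace (W₀ : WeierstrassCurve ℚ) [W₀.IsElliptic]
    [W₀.IsGloballyMinimal] (hp2 : p ≠ 2) (hgood : W₀.HasGoodReductionAtPrime p)
    (hss : (p : ℤ) ∣ W₀.frobeniusTrace p) (hK : IsImaginaryQuadratic K)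
    {v : HeightOneSpectrum (𝓞 K)} (hpv : ((p : ℕ) : 𝓞 K) ∈ v.asIdeal)
    (hpvbar : ((p : ℕ) : 𝓞 K) ∈ vbar.asIdeal) (hne : vbar ≠ v) :
    StrictAtVbarExponent (W₀.baseChange K) κ₁ κ₂ vbar := by
  haveI : (W₀.baseChange K).IsElliptic := by rw [WeierstrassCurve.baseChange]; infer_instance
  obtain ⟨hcyc, hcard⟩ :=
    InertiaFixedPoint.isCyclic_and_card_inertia_map_baseChange W₀ hp2 hgood hss hK hpv hpvbar hne
  exact strictAtVbarExponent_of_inertia_cyclic (W₀.baseChange K) κ₁ κ₂ vbar hpvbar hcyc hcard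

/-- **(A′) at a split supersingular `p` from (A1′) + (A2′) alone** (the strictness piece (A3′) being proved):
bottom-layer control for `E/ℚ` base-changed to `K`. [cite: arXiv:2409.01350, Part II Prop. 3.1 (p. 78)]
[cite: Serre1972, §1.11 Prop. 12 c)] -/
theorem bottomControlExponent_of_pieces_supersingular (W₀ : WeierstrassCurve ℚ) [W₀.IsElliptic]
    [W₀.IsGloballyMinimal] (hp2 : p ≠ 2) (hgood : W₀.HasGoodReductionAtPrime p)
    (hss : (p : ℤ) ∣ W₀.frobeniusTrace p) (hK : IsImaginaryQuadratic K)
    {v : HeightOneSpectrum (𝓞 K)} (hpv : ((p : ℕ) : 𝓞 K) ∈ v.asIdeal)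
    (hpvbar : ((p : ℕ) : 𝓞 K) ∈ vbar.asIdeal) (hne : vbar ≠ v)
    (h1 : GlobalBottomSurjective (W₀.baseChange K) κ₁ κ₂ vbar γ₁ γ₂)
    (h2 : AwayExponent (W₀.baseChange K) κ₁ κ₂ vbar) :
    BottomControlExponent (W₀.baseChange K) κ₁ κ₂ vbar γ₁ γ₂ :=
  bottomControlExponent_of_pieces (W₀.baseChange K) κ₁ κ₂ vbar γ₁ γ₂ h1 h2
    (strictAtVbarExponent_baseChange_of_dvd_frobeniusTrace κ₁ κ₂ vbar W₀ hp2 hgood hss hK hpv hpvbar hne)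

end StrictSupersingular

/-! ## (A1′) PROVED: global bottom surjectivity `H¹(K, E[p^∞]) ↠ H¹(K̃_∞, E[p^∞])^{⟨γ₁,γ₂⟩}` under `E(K)[p] = 0`

The degenerate inflation–restriction sequence for the closed normal subgroup `Gal(K̄/K̃_∞) = pairKer κ₁ κ₂`:
`M^{pairKer} = E(K̃_∞)[p^∞] = 0` (tree `fixedPoints_pairKer_geomPrimaryTorsion_eq_bot`, from `E(K)[p] = 0` and
`Gal(K̃_∞/K) ≅ ℤ_p²` pro-`p`), so `H¹(K, M) → H¹(K̃_∞, M)^{Γ_K}` is onto (tree, PROVED: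
`SignedBaseChangeAcDivControlCoker.mem_range_resOfLe_of_forall_conjH1_eq`, Serre *Galois Cohomology* I.§2.6 (b));
and a class fixed by `conj_{γ₁}` and `conj_{γ₂}` is fixed by all of `Γ_K` (`conjH1_eq_of_pair_eq`: the tree's
`IwasawaTwoVariable.conjH1_eq_of_mem_kerSubgroup` gives `ker κ₁`; the remaining `ℤ_p`-direction is handled by the
same `p`-adic splitting `κ₁(g) = n + p^a β` against an open normal subgroup fixing the class). -/

section GlobalSurjective

open scoped Classical

open Summit.BirchSwinnertonDyer.BirchSwinnertonDyer.Theorems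

omit [NumberField K] in
/-- **Fixed by `conj_{γ₁}` and `conj_{γ₂}` ⟹ fixed by `conj_g` for every `g ∈ Γ_K`** (generator pair, `M` with open
stabilisers): with `Nrm` an open normal subgroup fixing `c`, of index `d = p^a e`, `p ∤ e`, write
`κ₁(g) = n + p^a β`, pick `h` with `κ₁(h) = e⁻¹ β`; then `g = γ₁^n · h^d · s` with `h^d ∈ Nrm` and `s ∈ ker κ₁`, and
`conj_s c = c` by the tree's `conjH1_eq_of_mem_kerSubgroup` (from the `γ₂`-invariance).
[cite: GreenbergLNM1716, §3 (action of `Γ = Gal(K_∞/K)` on `H¹(K_∞, ·)` through a topological generator)] -/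
theorem conjH1_eq_of_pair_eq {M : Type} [AddCommGroup M] [DistribMulAction (absoluteGaloisGroup K) M]
    [TopologicalSpace M] [DiscreteTopology M] [NumberField K]
    (hγ : ZpExtension.IsTopGeneratorPair κ₁ κ₂ γ₁ γ₂)
    (hstab : ∀ m : M,
      IsOpen (MulAction.stabilizer (absoluteGaloisGroup K) m : Set (absoluteGaloisGroup K)))
    {c : subgroupH1 (ZpExtension.pairKer κ₁ κ₂) M}
    (h1 : conjH1 (ZpExtension.pairKer κ₁ κ₂) M γ₁ c = c)
    (h2 : conjH1 (ZpExtension.pairKer κ₁ κ₂) M γ₂ c = c) (g : absoluteGaloisGroup K) :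
    conjH1 (ZpExtension.pairKer κ₁ κ₂) M g c = c := by
  obtain ⟨Nrm, hNrm⟩ := TwoVariableSelmer.exists_openNormalSubgroup_conjH1_pair_eq κ₁ κ₂ M hstab c
  haveI : Finite (absoluteGaloisGroup K ⧸ Nrm.toSubgroup) :=
    Subgroup.quotient_finite_of_isOpen _ Nrm.isOpen
  have hd : Nrm.toSubgroup.index ≠ 0 := Subgroup.index_ne_zero_of_finite
  obtain ⟨a, e, he, hde⟩ := Nat.exists_eq_pow_mul_and_not_dvd hd p (Fact.out : p.Prime).ne_one
  obtain ⟨u, hu⟩ := IwasawaDual.isUnit_natCast_padicInt (p := p) he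
  haveI : NeZero (p ^ a) := ⟨pow_ne_zero _ (Fact.out : p.Prime).ne_zero⟩
  set b : ℤ_[p] := Multiplicative.toAdd (κ₁ g) with hb
  set n : ℕ := (PadicInt.toZModPow a b).val with hn
  have hbn : (p : ℤ_[p]) ^ a ∣ b - n := by
    rw [← Ideal.mem_span_singleton, ← PadicInt.ker_toZModPow, RingHom.mem_ker, map_sub,
      map_natCast, hn, ZMod.natCast_zmod_val, sub_self]
  obtain ⟨β, hβ⟩ := hbn
  obtain ⟨h, hh₁, -⟩ :=
    TwoVariableSelmer.exists_apply_eq_of_isTopGeneratorPair hγ (((u⁻¹ : ℤ_[p]ˣ) : ℤ_[p]) * β) 0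
  have hτN : h ^ Nrm.toSubgroup.index ∈ Nrm := Nrm.toSubgroup.pow_index_mem h
  have heu : (e : ℤ_[p]) * ((u⁻¹ : ℤ_[p]ˣ) : ℤ_[p]) = 1 := by rw [← hu, Units.mul_inv]
  have hs : (γ₁ ^ n * h ^ Nrm.toSubgroup.index)⁻¹ * g ∈ κ₁.kerSubgroup := by
    rw [ZpExtension.mem_kerSubgroup, map_mul, map_inv, map_mul, map_pow, map_pow]
    apply Multiplicative.toAdd.injective
    rw [toAdd_mul, toAdd_inv, toAdd_mul, toAdd_pow, toAdd_pow, show κ₁ γ₁ = _ from hγ.left, hh₁,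
      toAdd_ofAdd, toAdd_ofAdd, toAdd_one, ← hb, nsmul_eq_mul, nsmul_eq_mul, hde]
    push_cast
    linear_combination hβ - (p : ℤ_[p]) ^ a * β * heu
  conv_lhs => rw [← mul_inv_cancel_left (γ₁ ^ n * h ^ Nrm.toSubgroup.index) g]
  rw [conjH1_mul_holds (ZpExtension.pairKer κ₁ κ₂) M, AddMonoidHom.comp_apply,
    IwasawaTwoVariable.conjH1_eq_of_mem_kerSubgroup hγ hstab h2 hs,
    conjH1_mul_holds (ZpExtension.pairKer κ₁ κ₂) M, AddMonoidHom.comp_apply, hNrm _ hτN,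
    IwasawaTwoVariable.conjH1_pow_eq_of_conjH1_eq h1 n]

/-- **(A1′) PROVED under `E(K)[p] = 0`**: for a generator pair `(γ₁, γ₂)` of `Gal(K̃_∞/K) ≅ ℤ_p²` and a curve with
no `K`-rational `p`-torsion, every `⟨γ₁,γ₂⟩`-invariant class of `Sel_{∅,0}(K̃_∞, E[p^∞])` is `resTower t` for some
`t ∈ H¹(K, E[p^∞])` — `GlobalBottomSurjective W κ₁ κ₂ vbar γ₁ γ₂`. Under 20728's binders `E(K)[p] = 0` follows from
`Rank1Residual.Surj W p`, `p ≥ 5` (the image of `G_K` in `GL₂(𝔽_p)` has index `≤ 2`, so contains `SL₂(𝔽_p)`, which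
fixes no non-zero vector). [cite: GreenbergLNM1716, §3 Lemma 3.2 (p. 86 of the held copy)]
[cite: SerreGaloisCohomology1997, I.§2.6 (b)] [cite: SkinnerUrban2014, Prop. 3.2.8 (p. 23)] -/
theorem globalBottomSurjective_of_noPTorsion [W.IsElliptic]
    (hγ : ZpExtension.IsTopGeneratorPair κ₁ κ₂ γ₁ γ₂)
    (hK : ∀ P : W.toAffine.Point, p • P = 0 → P = 0) :
    GlobalBottomSurjective W κ₁ κ₂ vbar γ₁ γ₂ := by
  intro s hs1 hs2
  have h1 : conjH1 (ZpExtension.pairKer κ₁ κ₂) (W.geomPrimaryTorsion p) γ₁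
      (s : subgroupH1 (ZpExtension.pairKer κ₁ κ₂) (W.geomPrimaryTorsion p)) = s := by
    rw [← coe_conjSel₂_apply, hs1]
  have h2 : conjH1 (ZpExtension.pairKer κ₁ κ₂) (W.geomPrimaryTorsion p) γ₂
      (s : subgroupH1 (ZpExtension.pairKer κ₁ κ₂) (W.geomPrimaryTorsion p)) = s := by
    rw [← coe_conjSel₂_apply, hs2]
  have hall : ∀ g ∈ (⊤ : Subgroup (absoluteGaloisGroup K)),
      conjH1 (ZpExtension.pairKer κ₁ κ₂) (W.geomPrimaryTorsion p) g
        (s : subgroupH1 (ZpExtension.pairKer κ₁ κ₂) (W.geomPrimaryTorsion p)) = s :=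
    fun g _ ↦ conjH1_eq_of_pair_eq κ₁ κ₂ γ₁ γ₂ hγ (W.isOpen_stabilizer_geomPrimaryTorsion' p) h1 h2 g
  obtain ⟨t, ht⟩ := SignedBaseChangeAcDivControlCoker.mem_range_resOfLe_of_forall_conjH1_eq
    (H := ZpExtension.pairKer κ₁ κ₂) (le_top : ZpExtension.pairKer κ₁ κ₂ ≤ ⊤)
    (TwoVariableSelmer.isClosed_pairKer κ₁ κ₂) (W.isOpen_stabilizer_geomPrimaryTorsion' p)
    (fun m hm ↦ W.eq_zero_of_forall_pairKer_smul_eq hγ hK hm)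
    (s : subgroupH1 (ZpExtension.pairKer κ₁ κ₂) (W.geomPrimaryTorsion p)) hall
  exact ⟨t, ht⟩

/-- **`E(K)[p] = 0` from 20728's binders** (`K` imaginary quadratic, `p` odd, `ρ̄_{E,p}` onto — Gross 1991 §2, tree
`torsionBy_eq_bot_of_isImaginaryQuadratic`), in the `ℕ`-scalar form consumed by
`fixedPoints_pairKer_geomPrimaryTorsion_eq_bot`. [cite: GrossLMS1991, §2 (sentence after (2.2))] -/
theorem noPTorsion_baseChange_of_hasSurjectiveModNGaloisRep (W₀ : WeierstrassCurve ℚ) [W₀.IsElliptic]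
    (hK : IsImaginaryQuadratic K) (hp2 : p ≠ 2) (hρ : W₀.HasSurjectiveModNGaloisRep p) :
    ∀ P : (W₀.baseChange K).toAffine.Point, p • P = 0 → P = 0 := by
  intro P hP
  have h := torsionBy_eq_bot_of_isImaginaryQuadratic W₀ K hK (Fact.out : p.Prime) hp2 hρ
  have hmem : P ∈ AddSubgroup.torsionBy (W₀.baseChange K).toAffine.Point (p : ℤ) :=
    AddSubgroup.torsionBy.nsmul_iff.mpr hP
  rw [h] at hmem
  exact (AddSubgroup.mem_bot).mp hmem

/-- **At a split supersingular `p ≥ 3` of an `E/ℚ` with `ρ̄_{E,p}` onto, base-changed to an imaginary quadratic `K`,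
(A′) follows from (A2′) ALONE** — all of it inside 20728's binders plus `p ∣ a_p`: (A1′) by
`globalBottomSurjective_of_noPTorsion` + `noPTorsion_baseChange_of_hasSurjectiveModNGaloisRep` (`Surj`), (A3′) by
`strictAtVbarExponent_baseChange_of_dvd_frobeniusTrace`. [cite: arXiv:2409.01350, Part II Prop. 3.1(b) (p. 78)]
[cite: GreenbergLNM1716, §3 Lemma 3.2] -/
theorem bottomControlExponent_of_away_supersingular (W₀ : WeierstrassCurve ℚ) [W₀.IsElliptic]
    [W₀.IsGloballyMinimal] (hp2 : p ≠ 2) (hgood : W₀.HasGoodReductionAtPrime p)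
    (hss : (p : ℤ) ∣ W₀.frobeniusTrace p) (hρ : W₀.HasSurjectiveModNGaloisRep p) (hK : IsImaginaryQuadratic K)
    {v : HeightOneSpectrum (𝓞 K)} (hpv : ((p : ℕ) : 𝓞 K) ∈ v.asIdeal) (hpvbar : ((p : ℕ) : 𝓞 K) ∈ vbar.asIdeal)
    (hne : vbar ≠ v) (hγ : ZpExtension.IsTopGeneratorPair κ₁ κ₂ γ₁ γ₂)
    (h2 : AwayExponent (W₀.baseChange K) κ₁ κ₂ vbar) :
    BottomControlExponent (W₀.baseChange K) κ₁ κ₂ vbar γ₁ γ₂ :=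
  bottomControlExponent_of_pieces_supersingular κ₁ κ₂ vbar γ₁ γ₂ W₀ hp2 hgood hss hK hpv hpvbar hne
    (globalBottomSurjective_of_noPTorsion (W₀.baseChange K) κ₁ κ₂ vbar γ₁ γ₂ hγ
      (noPTorsion_baseChange_of_hasSurjectiveModNGaloisRep W₀ hK hp2 hρ)) h2

/-- Hence, in that setting, door 4's `hfix` bound `∃ k, HfixBound … k` needs only (A2′) and (B′) (finiteness and
`p`-primarity of `Sel_Gr(K, E[p^∞])`). [cite: arXiv:2409.01350, Part II Prop. 3.1 (p. 78)] -/
theorem hfixBound_of_away_of_finite_supersingular (W₀ : WeierstrassCurve ℚ) [W₀.IsElliptic]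
    [W₀.IsGloballyMinimal] (hp2 : p ≠ 2) (hgood : W₀.HasGoodReductionAtPrime p)
    (hss : (p : ℤ) ∣ W₀.frobeniusTrace p) (hρ : W₀.HasSurjectiveModNGaloisRep p) (hK : IsImaginaryQuadratic K)
    {v : HeightOneSpectrum (𝓞 K)} (hpv : ((p : ℕ) : 𝓞 K) ∈ v.asIdeal) (hpvbar : ((p : ℕ) : 𝓞 K) ∈ vbar.asIdeal)
    (hne : vbar ≠ v) (hγ : ZpExtension.IsTopGeneratorPair κ₁ κ₂ γ₁ γ₂)
    (h2 : AwayExponent (W₀.baseChange K) κ₁ κ₂ vbar)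
    (hfin : (SetLike.coe (bottomSelmer p (W₀.baseChange K) vbar)).Finite)
    (hprim : ∀ t ∈ bottomSelmer p (W₀.baseChange K) vbar, ∃ n : ℕ, p ^ n • t = 0) :
    ∃ k : ℕ, HfixBound (W₀.baseChange K) κ₁ κ₂ vbar γ₁ γ₂ k :=
  hfixBound_of_control_of_finite (W₀.baseChange K) κ₁ κ₂ vbar γ₁ γ₂
    (bottomControlExponent_of_away_supersingular κ₁ κ₂ vbar γ₁ γ₂ W₀ hp2 hgood hss hρ hK hpv hpvbar hne hγ h2)
    hfin hprim

end GlobalSurjective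

/-! ## (A2′) PROVED: the away-from-`p` / archimedean exponent `AwayExponent` (v1.3)

KatoLine.md §1e. For `E/K` with all infinite places complex, `AwayExponent E κ₁ κ₂ v̄` HOLDS for ANY pair of `ℤ_p`-extensions: at
a finite `v ∤ p`, `I_v ≤ pairKer` (`IwasawaTwoVariable.inertia_le_kerSubgroup_of_not_mem`, Washington Prop. 13.2), so unramifiedness
transfers from `K̃_∞` back to `K` (`mem_unramifiedKer_of_resOfLe_mem`), and the LEAD's uniform local theorem
`SignedBaseChangeAcDivAwayDiscrepancy.exists_nsmul_mem_awayKer_of_decomp_le` (finitely many bad `v`, `finite_badPlaces_holds`) gives one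
`t₀ = p^m·e ≠ 0` with `t₀ · H¹_ur ⊆ awayKer`, whose prime-to-`p` part acts invertibly on the `p`-primary `H¹(K, E[p^∞])`
(`exists_pow_smul_eq_zero_top`, `mem_of_nsmul_mem_of_not_dvd`); at an infinite place `K_w = ℂ` (`decompInf_eq_bot_of_isComplex`).
Consequence: `hfixBound_of_finite_supersingular`. No summit statement is proved. [cite: GreenbergLNM1716, §3 Lemmas 3.2–3.3 (pp. 86–87)]
[cite: arXiv:2409.01350, Part II Prop. 3.1(b) (p. 78)] [cite: Castella2018, §2.2 (arXiv:1704.06608 p. 7)] [cite: Washington1997, Prop. 13.2] -/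

section Away

open scoped Classical

open Summit.BirchSwinnertonDyer.BirchSwinnertonDyer.Theorems

/-- **Place-wise converse of `resOfLe_mem_unramifiedKer`**: if `H ⊓ I_v ≤ S` (`K̄^S/K̄^H` unramified at the
chosen place above `v`) then a class of `H¹(H, M)` whose restriction to `S` is unramified at `v` is itself
unramified at `v` — the two inertia groups `H ⊓ I_v = S ⊓ I_v` coincide, so restriction between their
cohomologies is injective (`resOfLe_injective_of_ge`). The tree's `IwasawaTwoVariable.mem_datumSelmer_of_resOfLe_mem`
is this at every place at once. [cite: GreenbergVatsal2000, §2 p. 17] -/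
theorem mem_unramifiedKer_of_resOfLe_mem {M : Type} [AddCommGroup M]
    [DistribMulAction (absoluteGaloisGroup K) M] [TopologicalSpace M] [DiscreteTopology M]
    {S H : Subgroup (absoluteGaloisGroup K)} (hSH : S ≤ H) (v : HeightOneSpectrum (𝓞 K))
    (hI : H ⊓ inertia v ≤ S) {c : subgroupH1 H M}
    (h : resOfLe M hSH c ∈ GreenbergVatsal2000.unramifiedKer S M v) :
    c ∈ GreenbergVatsal2000.unramifiedKer H M v := by
  have h' : resH1Hom (inertiaInToH S v) (AddMonoidHom.id M) (IwasawaTwoVariable.id_smul_inertiaInToH S v)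
      (resOfLe M hSH c) = 0 := h
  rw [IwasawaTwoVariable.resH1Hom_inertiaIn_resOfLe_id] at h'
  have hinj : Function.Injective
      (Literature.NumberTheory.EllipticCurves.resOfLe M (IwasawaTwoVariable.inertiaIn_mono hSH v)) :=
    resOfLe_injective_of_ge M (IwasawaTwoVariable.inertiaIn_mono hSH v)
      (IwasawaTwoVariable.inertiaIn_le_of_inf_inertia_le v hI)
  exact (injective_iff_map_eq_zero _).1 hinj _ h'

/-- **`Γ_K ⊓ I_v ≤ pairKer κ₁ κ₂` for `v ∤ p`**: both `ℤ_p`-extensions are unramified at `v`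
(tree `IwasawaTwoVariable.inertia_le_kerSubgroup_of_not_mem`, Washington Prop. 13.2). [cite: Washington1997, Prop. 13.2] -/
theorem top_inf_inertia_le_pairKer {v : HeightOneSpectrum (𝓞 K)} (hpv : ((p : ℕ) : 𝓞 K) ∉ v.asIdeal) :
    (⊤ : Subgroup (absoluteGaloisGroup K)) ⊓ inertia v ≤ ZpExtension.pairKer κ₁ κ₂ := by
  intro x hx
  have hx' : x ∈ inertia v := (Subgroup.mem_inf.mp hx).2
  exact Subgroup.mem_inf.mpr
    ⟨IwasawaTwoVariable.inertia_le_kerSubgroup_of_not_mem κ₁ hpv hx',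
      IwasawaTwoVariable.inertia_le_kerSubgroup_of_not_mem κ₂ hpv hx'⟩

/-- **Every conjugate of a class of `H¹(K, E[p^∞])` restricting into `Sel_{∅,0}(K̃_∞, E[p^∞])` is unramified
at every `v ∤ p` over `K` itself** (restriction commutes with conjugation, `resOfLe_comp_conjH1_holds`;
`Sel_{∅,0}` is unramified at all conjugates of `v`; `⊤ ⊓ I_v ≤ pairKer`). [cite: GreenbergVatsal2000, §2 p. 17]
[cite: Washington1997, Prop. 13.2] -/
theorem conjH1_mem_unramifiedKer_top_of_resTower_mem
    {t : subgroupH1 (⊤ : Subgroup (absoluteGaloisGroup K)) (W.geomPrimaryTorsion p)}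
    (ht : resTower W κ₁ κ₂ t ∈ unrSelmer₂ κ₁ κ₂ (W.geomPrimaryTorsion p) vbar)
    {v : HeightOneSpectrum (𝓞 K)} (hpv : ((p : ℕ) : 𝓞 K) ∉ v.asIdeal) (σ : absoluteGaloisGroup K) :
    conjH1 ⊤ (W.geomPrimaryTorsion p) σ t ∈ GreenbergVatsal2000.unramifiedKer ⊤ (W.geomPrimaryTorsion p) v := by
  have h1 := (GreenbergVatsal2000.mem_unramifiedOutside_iff _).1
    ((GreenbergVatsal2000.mem_datumSelmer_iff _).1 ht).1 v (Set.notMem_empty v) hpv σ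
  have hcomm := congrArg (fun f ↦ f t)
    (resOfLe_comp_conjH1_holds (M := W.geomPrimaryTorsion p) (le_top : ZpExtension.pairKer κ₁ κ₂ ≤ ⊤) σ)
  simp only [AddMonoidHom.comp_apply] at hcomm
  rw [← hcomm] at h1
  exact mem_unramifiedKer_of_resOfLe_mem le_top v (top_inf_inertia_le_pairKer κ₁ κ₂ hpv) h1

omit [Fact p.Prime] [NumberField K] in
/-- **Every class of `H¹(K, E[p^∞])` is killed by a power of `p`** (`Γ_K` compact, `E[p^∞]` discrete and
`p`-primary: a continuous cocycle takes finitely many values; tree `IwasawaDual.exists_pow_smul_oneCocycleClass_eq_zero`).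
This also discharges the `p`-primarity half `hprim` of (B′). [cite: GreenbergLNM1716, §1 p. 60] -/
theorem exists_pow_smul_eq_zero_top
    (c : subgroupH1 (⊤ : Subgroup (absoluteGaloisGroup K)) (W.geomPrimaryTorsion p)) :
    ∃ k : ℕ, p ^ k • c = 0 := by
  haveI := absoluteGaloisGroup_compactSpace K
  haveI : CompactSpace (⊤ : Subgroup (absoluteGaloisGroup K)) :=
    isCompact_iff_compactSpace.mp (by rw [Subgroup.coe_top]; exact isCompact_univ)
  obtain ⟨φ, rfl⟩ := oneCocycleClass_surjective _ c
  exact IwasawaDual.exists_pow_smul_oneCocycleClass_eq_zero φ fun σ ↦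
    W.exists_pow_smul_geomPrimaryTorsion_eq_zero p (φ.1 σ)

omit [Fact p.Prime] in
/-- **Prime-to-`p` integers act invertibly on `p`-primary elements** (Bezout): if `p ∤ e`, `p^k · y = 0` and
`e · y ∈ B` then `y ∈ B`. [folklore] -/
theorem mem_of_nsmul_mem_of_not_dvd (hp : p.Prime) {A : Type} [AddCommGroup A] (B : AddSubgroup A)
    {e k : ℕ} (he : ¬ p ∣ e) {y : A} (hk : p ^ k • y = 0) (h : e • y ∈ B) : y ∈ B := by
  have hcop : IsCoprime (e : ℤ) ((p : ℤ) ^ k) := by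
    rw [← Nat.cast_pow, Nat.isCoprime_iff_coprime]
    exact Nat.Coprime.pow_right k ((Nat.Prime.coprime_iff_not_dvd hp).2 he).symm
  obtain ⟨a, b, hab⟩ := hcop
  have e1 : y = a • ((e : ℤ) • y) + b • (((p : ℤ) ^ k) • y) := by
    rw [← mul_smul, ← mul_smul, ← add_smul, hab, one_smul]
  have h1 : (e : ℤ) • y ∈ B := by rw [natCast_zsmul]; exact h
  have h2 : ((p : ℤ) ^ k) • y = 0 := by rw [← Nat.cast_pow, natCast_zsmul]; exact hk
  rw [e1, h2, smul_zero, add_zero]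
  exact B.zsmul_mem h1 a

/-- **The LEAD's uniform away-from-`p` comparison, over the base `K` itself (`H = ⊤`)**: for an elliptic `E`
over a number field `K` and a prime `p` there is ONE integer `t ≠ 0` such that at every finite `v ∤ p` every
class of `H¹(K, E[p^∞])` unramified at the chosen place above `v` becomes locally trivial there after
multiplication by `t` (`t_v = 1` at good `v`, Greenberg's Lemma 3.3; the bad `v` are finitely many). Same proof
as `SignedBaseChangeAcDivAwayDiscrepancy.exists_nsmul_mem_awayKer_of_mem_unramifiedKer` with `D_v ≤ ⊤` for free.
[cite: GreenbergLNM1716, §3 Lemma 3.3 (p. 87)] [cite: Castella2018, §2.2 (arXiv:1704.06608 p. 7)]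
[cite: MilneADT2006, Ch. I §2 Lemma 2.10] -/
theorem exists_nsmul_mem_awayKer_top [W.IsElliptic] :
    ∃ t : ℕ, t ≠ 0 ∧ ∀ (v : HeightOneSpectrum (𝓞 K)), ((p : ℕ) : 𝓞 K) ∉ v.asIdeal →
      ∀ y : subgroupH1 (⊤ : Subgroup (absoluteGaloisGroup K)) (W.geomPrimaryTorsion p),
        y ∈ GreenbergVatsal2000.unramifiedKer ⊤ (W.geomPrimaryTorsion p) v →
          t • y ∈ awayKer ⊤ (W.geomPrimaryTorsion p) v := by
  -- the finitely many bad places away from `p`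
  set S : Set (HeightOneSpectrum (𝓞 K)) :=
    {v | ¬ W.HasGoodReductionAt v ∧ ((p : ℕ) : 𝓞 K) ∉ v.asIdeal} with hS
  have hSfin : S.Finite := by
    refine (W.finite_badPlaces_holds (𝓞 K)).subset ?_
    rintro v ⟨hv, -⟩
    exact hv
  -- the local exponents (the lead's local theorem, any `H ≥ D_v`)
  let T : HeightOneSpectrum (𝓞 K) → ℕ := fun v ↦
    if h : ((p : ℕ) : 𝓞 K) ∉ v.asIdeal then
      Classical.choose
        (SignedBaseChangeAcDivAwayDiscrepancy.exists_nsmul_mem_awayKer_of_decomp_le W p h) else 1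
  have hT : ∀ (v : HeightOneSpectrum (𝓞 K)) (h : ((p : ℕ) : 𝓞 K) ∉ v.asIdeal),
      T v ≠ 0 ∧ ∀ (H : Subgroup (absoluteGaloisGroup K)), decomp v ≤ H →
        ∀ y : W.subgroupH1 p H, y ∈ GreenbergVatsal2000.unramifiedKer H (W.geomPrimaryTorsion p) v →
          T v • y ∈ awayKer H (W.geomPrimaryTorsion p) v := by
    intro v h
    have e : T v = Classical.choose
        (SignedBaseChangeAcDivAwayDiscrepancy.exists_nsmul_mem_awayKer_of_decomp_le W p h) := dif_pos h
    rw [e]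
    exact Classical.choose_spec
      (SignedBaseChangeAcDivAwayDiscrepancy.exists_nsmul_mem_awayKer_of_decomp_le W p h)
  refine ⟨∏ v ∈ hSfin.toFinset, T v, ?_, fun v hpv y hy ↦ ?_⟩
  · rw [Finset.prod_ne_zero_iff]
    intro v hv
    rw [Set.Finite.mem_toFinset] at hv
    exact (hT v hv.2).1
  · by_cases hgood : W.HasGoodReductionAt v
    · exact AddSubgroup.nsmul_mem _
        (SignedBaseChangeAcDivAwayDiscrepancy.mem_awayKer_of_mem_unramifiedKer_of_decomp_le W p hpv
          hgood le_top hy) _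
    · have hvS : v ∈ hSfin.toFinset := by
        rw [Set.Finite.mem_toFinset]
        exact ⟨hgood, hpv⟩
      obtain ⟨q, hq⟩ := Finset.dvd_prod_of_mem T hvS
      rw [hq, mul_comm, mul_smul]
      exact AddSubgroup.nsmul_mem _ ((hT v hpv).2 _ le_top y hy) q

/-- **… and a power of `p` suffices** (`t = p^m · e` with `p ∤ e`; `e` is invertible on the `p`-primary group
`H¹(K, E[p^∞])`). [cite: GreenbergLNM1716, §3 Lemma 3.3 (p. 87)] -/
theorem exists_pow_smul_mem_awayKer_top [W.IsElliptic] :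
    ∃ m : ℕ, ∀ (v : HeightOneSpectrum (𝓞 K)), ((p : ℕ) : 𝓞 K) ∉ v.asIdeal →
      ∀ y : subgroupH1 (⊤ : Subgroup (absoluteGaloisGroup K)) (W.geomPrimaryTorsion p),
        y ∈ GreenbergVatsal2000.unramifiedKer ⊤ (W.geomPrimaryTorsion p) v →
          p ^ m • y ∈ awayKer ⊤ (W.geomPrimaryTorsion p) v := by
  obtain ⟨t, ht0, ht⟩ := exists_nsmul_mem_awayKer_top W (p := p)
  obtain ⟨m, e, he, rfl⟩ := Nat.exists_eq_pow_mul_and_not_dvd ht0 p (Nat.Prime.one_lt Fact.out).ne'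
  refine ⟨m, fun v hpv y hy ↦ ?_⟩
  obtain ⟨k, hk⟩ := exists_pow_smul_eq_zero_top W (p := p) (p ^ m • y)
  refine mem_of_nsmul_mem_of_not_dvd Fact.out _ he hk ?_
  rw [← mul_smul, mul_comm]
  exact ht v hpv y hy

/-- **(A2′) PROVED for `K` with all infinite places complex.** [cite: GreenbergLNM1716, §3 Lemmas 3.2–3.3 (pp. 86–87)]
[cite: arXiv:2409.01350, Part II Prop. 3.1(b) (p. 78)] [cite: Washington1997, Prop. 13.2] -/
theorem awayExponent_of_isComplex [W.IsElliptic] (hK : ∀ w : InfinitePlace K, w.IsComplex) :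
    AwayExponent W κ₁ κ₂ vbar := by
  obtain ⟨m, hm⟩ := exists_pow_smul_mem_awayKer_top W (p := p)
  refine ⟨m, fun t ht ↦ ⟨fun v hpv σ ↦ ?_, fun w σ ↦ ?_⟩⟩
  · rw [map_nsmul]
    exact hm v hpv _ (conjH1_mem_unramifiedKer_top_of_resTower_mem W κ₁ κ₂ vbar ht hpv σ)
  · exact SignedBaseChangeAcDivAwayDiscrepancy.mem_infKer_of_decompInf_eq_bot' W p w
      (Summit.BirchSwinnertonDyer.Rank1Residual.X11b.AcSelmer.decompInf_eq_bot_of_isComplex (hK w)) _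

/-- **(A2′) PROVED inside 20728's binders** (`K` imaginary quadratic; nothing else is used — not `Surj`, not
`p ≥ 5`, not the reduction type). [cite: GreenbergLNM1716, §3 Lemmas 3.2–3.3 (pp. 86–87)]
[cite: arXiv:2409.01350, Part II Prop. 3.1(b) (p. 78)] -/
theorem awayExponent_of_isImaginaryQuadratic [W.IsElliptic] (hK : IsImaginaryQuadratic K) :
    AwayExponent W κ₁ κ₂ vbar :=
  awayExponent_of_isComplex W κ₁ κ₂ vbar fun w ↦ (IsImaginaryQuadratic.isTotallyComplex hK).isComplex w

/-- **(A′) bottom-layer control at a split supersingular `p ≥ 3` with `ρ̄_{E,p}` onto, over an imaginary quadratic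
`K` — UNCONDITIONALLY** ((A1′) `globalBottomSurjective_of_noPTorsion`, (A2′) `awayExponent_of_isImaginaryQuadratic`,
(A3′)_ss `strictAtVbarExponent_baseChange_of_dvd_frobeniusTrace`). All hypotheses are 20728 binders plus `p ∣ a_p`.
[cite: arXiv:2409.01350, Part II Prop. 3.1(b), Cor. 3.2 (p. 78)] [cite: GreenbergLNM1716, §3 Lemmas 3.1–3.3] -/
theorem bottomControlExponent_supersingular (W₀ : WeierstrassCurve ℚ) [W₀.IsElliptic]
    [W₀.IsGloballyMinimal] (hp2 : p ≠ 2) (hgood : W₀.HasGoodReductionAtPrime p)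
    (hss : (p : ℤ) ∣ W₀.frobeniusTrace p) (hρ : W₀.HasSurjectiveModNGaloisRep p) (hK : IsImaginaryQuadratic K)
    {v : HeightOneSpectrum (𝓞 K)} (hpv : ((p : ℕ) : 𝓞 K) ∈ v.asIdeal) (hpvbar : ((p : ℕ) : 𝓞 K) ∈ vbar.asIdeal)
    (hne : vbar ≠ v) (hγ : ZpExtension.IsTopGeneratorPair κ₁ κ₂ γ₁ γ₂) :
    BottomControlExponent (W₀.baseChange K) κ₁ κ₂ vbar γ₁ γ₂ :=
  haveI : (W₀.baseChange K).IsElliptic := by rw [WeierstrassCurve.baseChange]; infer_instance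
  bottomControlExponent_of_away_supersingular κ₁ κ₂ vbar γ₁ γ₂ W₀ hp2 hgood hss hρ hK hpv hpvbar hne hγ
    (awayExponent_of_isImaginaryQuadratic (W₀.baseChange K) κ₁ κ₂ vbar hK)

/-- **Door 4's `hfix` bound from (B′)-finiteness ALONE**, in the supersingular sub-range of 20728: if
`Sel_Gr(K, E[p^∞]) = bottomSelmer` is finite then `∃ k, HfixBound (E.baseChange K) κ₁ κ₂ v̄ γ₁ γ₂ k` (its
`p`-primarity is `exists_pow_smul_eq_zero_top`). What remains OPEN on this supply line at supersingular `p`: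
(B′) = `Set.Finite (bottomSelmer p (E.baseChange K) v̄)` (rank-one input: Kolyvagin + Gross–Zagier + Skinner 2020
§2.3 Lemma 4), and at ordinary `p` additionally (A3′)_ord. No summit statement is proved.
[cite: arXiv:2409.01350, Part II Prop. 3.1, Cor. 3.2 (p. 78)] [cite: arXiv:1405.7294, §2.3 Lemma 4 (p. 8)]
[cite: Kolyvagin1990, Thm. A] -/
theorem hfixBound_of_finite_supersingular (W₀ : WeierstrassCurve ℚ) [W₀.IsElliptic]
    [W₀.IsGloballyMinimal] (hp2 : p ≠ 2) (hgood : W₀.HasGoodReductionAtPrime p)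
    (hss : (p : ℤ) ∣ W₀.frobeniusTrace p) (hρ : W₀.HasSurjectiveModNGaloisRep p) (hK : IsImaginaryQuadratic K)
    {v : HeightOneSpectrum (𝓞 K)} (hpv : ((p : ℕ) : 𝓞 K) ∈ v.asIdeal) (hpvbar : ((p : ℕ) : 𝓞 K) ∈ vbar.asIdeal)
    (hne : vbar ≠ v) (hγ : ZpExtension.IsTopGeneratorPair κ₁ κ₂ γ₁ γ₂)
    (hfin : (SetLike.coe (bottomSelmer p (W₀.baseChange K) vbar)).Finite) :
    ∃ k : ℕ, HfixBound (W₀.baseChange K) κ₁ κ₂ vbar γ₁ γ₂ k :=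
  hfixBound_of_control_of_finite (W₀.baseChange K) κ₁ κ₂ vbar γ₁ γ₂
    (bottomControlExponent_supersingular κ₁ κ₂ vbar γ₁ γ₂ W₀ hp2 hgood hss hρ hK hpv hpvbar hne hγ)
    hfin (fun t _ ↦ exists_pow_smul_eq_zero_top (W₀.baseChange K) t)

end Away

/-! ## (A3′) in EXPONENT form on all of 20728's range: `p^c · E[p^∞]^{Gal(K̄/K̃_∞) ∩ I_v̄} = 0 ⟹ m₃ = c` (v1.4)

KatoLine.md §1f. If the `Gal(K̄/K̃_∞) ∩ I_v̄`-fixed points of `E[p^∞]` are killed by `p^c` then `StrictAtVbarExponent` holds with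
`m₃ = c` (cocycle-level inflation–restriction; the supersingular `strictAtVbarExponent_of_inertia_cyclic` is `c = 0`). This isolates the
ORDINARY residue of (A3′) as the typed local (A3″) `InertiaTowerFixedPointExponent` — true at a good ordinary `v̄` exactly when
`E[p^∞]|_{G_{K_v̄}}` is non-split (non-CM; sections `OrdinaryResidue`, `SerreForm`), false in the CM case (outside 20728). Consequence:
`hfixBound_of_fixedPointExponent_of_finite`. No summit statement is proved. [cite: GreenbergLNM1716, §4 Prop. 4.8 (p. 109)]
[cite: Tate1967, Thm. 4] [cite: Raynaud1974, Cor. 3.3.6] [cite: arXiv:2409.01350, Part II Prop. 3.1(b) (p. 78), term `H_v`] -/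

section StrictExponent

open scoped Classical

/-- **Inflation–restriction with invariants of finite exponent, at the cocycle level** (exponent form of
`strictMap_top_eq_zero_of_greenbergMap_resOfLe_eq_zero`): for ANY normal `P ≤ Γ_K` and ANY local datum `N` at `v`, if
`e` kills every `P ∩ I_v`-fixed point of `M/M⁺_v` and the restriction of `c ∈ H¹(K, M)` to `P` satisfies Greenberg's
inertia condition at `v`, then `e · (strict image of c at v) = 0`. [cite: SerreGaloisCohomology1997, I §2.6 (b)]
[cite: GreenbergLNM1716, §4 Prop. 4.8 (p. 109)] -/
theorem nsmul_strictMap_top_eq_zero_of_greenbergMap_resOfLe_eq_zero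
    {M : Type} [AddCommGroup M] [DistribMulAction (absoluteGaloisGroup K) M] [TopologicalSpace M]
    [DiscreteTopology M] (P : Subgroup (absoluteGaloisGroup K)) [P.Normal] {v : HeightOneSpectrum (𝓞 K)}
    (N : LocalDatum K M v) (e : ℕ)
    (hfix : ∀ x : N.Gr, (∀ d : GreenbergSelmer.decomp v, (d : absoluteGaloisGroup K) ∈ P →
      (d : absoluteGaloisGroup K) ∈ GreenbergSelmer.inertia v → d • x = x) → e • x = 0)
    (c : subgroupH1 (⊤ : Subgroup (absoluteGaloisGroup K)) M)
    (hc : N.greenbergMap P (resOfLe M (le_top : P ≤ ⊤) c) = 0) :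
    e • N.strictMap ⊤ c = 0 := by
  obtain ⟨z, rfl⟩ :=
    oneCocycleClass_surjective (discreteTopRep (⊤ : Subgroup (absoluteGaloisGroup K)) M) c
  -- the hypothesis on the representative: `z|_{P ∩ I_v} ≡ ∂n` in `M/M⁺`
  have e1 := congrArg (fun f ↦ f (oneCocycleClass _ z))
    (resH1Hom_comp (subgroupInclusion (le_top : P ≤ ⊤)) (AddMonoidHom.id M) (fun _ _ ↦ rfl)
      (inertiaInToH P v) N.grMk (fun _ _ ↦ rfl))
  change N.greenbergMap P (resOfLe M le_top (oneCocycleClass _ z)) = _ at e1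
  rw [hc] at e1
  obtain ⟨n, hn⟩ := (CocycleCriteria.resH1Hom_oneCocycleClass_eq_zero_iff _ _ _ z).1 e1.symm
  -- the corrected crossed homomorphism on `D_v` with values in `M/M⁺`
  have hcompat : ∀ (a : decompIn (⊤ : Subgroup (absoluteGaloisGroup K)) v) (m : M),
      N.grMk (decompInToH ⊤ v a • m) = a • N.grMk m := fun _ _ ↦ rfl
  set g : decompIn (⊤ : Subgroup (absoluteGaloisGroup K)) v → N.Gr :=
    fun y ↦ N.grMk (z.1 (decompInToH ⊤ v y)) - (y • n - n) with hgdef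
  have hg : ∀ a b, g (a * b) = g a + a • g b := by
    intro a b
    simp only [hgdef]
    rw [map_mul, z.2, discreteTopRep_ρ_apply, map_add, hcompat, mul_smul]
    simp only [smul_sub]
    abel
  set S : Set (decompIn (⊤ : Subgroup (absoluteGaloisGroup K)) v) :=
    {s | ((s : GreenbergSelmer.decomp v) : absoluteGaloisGroup K) ∈ P ∧
      ((s : GreenbergSelmer.decomp v) : absoluteGaloisGroup K) ∈ GreenbergSelmer.inertia v} with hSdef
  have hS : ∀ s ∈ S, g s = 0 := by
    rintro s ⟨hsP, hsI⟩
    have h := hn ⟨(s : GreenbergSelmer.decomp v), (mem_inertiaIn_iff P v _).2 ⟨hsP, hsI⟩⟩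
    simp only [hgdef]
    rw [sub_eq_zero]
    exact h
  have hconj : ∀ s ∈ S, ∀ y : decompIn (⊤ : Subgroup (absoluteGaloisGroup K)) v, y⁻¹ * s * y ∈ S := by
    rintro s ⟨hsP, hsI⟩ y
    refine ⟨?_, ?_⟩
    · simp only [Subgroup.coe_mul, Subgroup.coe_inv]
      exact Subgroup.Normal.conj_mem' inferInstance _ hsP _
    · simp only [Subgroup.coe_mul, Subgroup.coe_inv]
      exact conj_mem_inertia_of_mem_decomp (y : GreenbergSelmer.decomp v).2 hsI
  -- every value of `g` is fixed by `P ∩ I_v`, hence killed by `e`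
  have hy : ∀ y, e • g y = 0 := fun y ↦ hfix (g y) fun d hdP hdI ↦
    smul_apply_eq_of_crossed_of_vanishing g hg S hS hconj
      (s := ⟨d, (mem_decompIn_iff ⊤ v d).2 (Subgroup.mem_top _)⟩) ⟨hdP, hdI⟩ y
  -- so `e·z ≡ ∂(e·n)` on `D_v`: the strict class of `e·c` vanishes
  have hs := oneCocycleClass_smul (discreteTopRep (⊤ : Subgroup (absoluteGaloisGroup K)) M) ((e : ℕ) : ℤ) z
  simp only [Nat.cast_smul_eq_nsmul] at hs
  rw [← map_nsmul, ← hs]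
  unfold LocalDatum.strictMap
  refine (CocycleCriteria.resH1Hom_oneCocycleClass_eq_zero_iff _ _ _ (e • z)).2 ⟨e • n, fun y ↦ ?_⟩
  have h := hy y
  simp only [hgdef, smul_sub, sub_eq_zero] at h
  change N.grMk (e • z.1 (decompInToH ⊤ v y)) = _
  rw [map_nsmul, h, smul_comm y e n]

/-- For the strict datum (`M⁺ = 0`, `M → M/M⁺` injective) **a bound on the fixed points of `M` transports to `M/M⁺`**:
if `e` kills every `P ∩ I_v̄`-fixed point of `M` then it kills every such point of `M/M⁺ = M/0`.
[cite: Castella2018, §2.1 Def. 2.1–2.2 (arXiv:1704.06608 p. 5)] -/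
theorem strictDatum_gr_nsmul_eq_zero_of_forall_smul_eq
    {M : Type} [AddCommGroup M] [DistribMulAction (absoluteGaloisGroup K) M]
    (P : Subgroup (absoluteGaloisGroup K)) (e : ℕ)
    (hM : ∀ m : M, (∀ t ∈ P ⊓ GreenbergSelmer.inertia vbar, t • m = m) → e • m = 0)
    (x : (AcSelmer.strictDatum M vbar).Gr)
    (hx : ∀ d : GreenbergSelmer.decomp vbar, (d : absoluteGaloisGroup K) ∈ P →
      (d : absoluteGaloisGroup K) ∈ GreenbergSelmer.inertia vbar → d • x = x) : e • x = 0 := by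
  obtain ⟨m, rfl⟩ := (AcSelmer.strictDatum M vbar).grMk_surjective x
  have hinj : Function.Injective (AcSelmer.strictDatum M vbar).grMk :=
    (AddMonoidHom.ker_eq_bot_iff _).1 (LocalDatum.ker_grMk _)
  have hm : e • m = 0 := hM m fun t ht ↦ hinj (by
    have h := hx ⟨t, inertia_le_decomp vbar (Subgroup.mem_inf.1 ht).2⟩ (Subgroup.mem_inf.1 ht).1
      (Subgroup.mem_inf.1 ht).2
    rwa [LocalDatum.smul_grMk] at h)
  rw [← map_nsmul, hm, map_zero]

/-- **(A3″) the local residue of (A3′)**: the `Gal(K̄/K̃_∞) ∩ I_v̄`-fixed points of `E[p^∞]` have finite exponent.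
`c = 0` at a supersingular `v̄` of `E/ℚ` base-changed to `K` with `p` split (Serre 1972 Prop. 12 (c); tree
`InertiaFixedPoint.primary_eq_zero_of_forall_pairKer_inf_inertia_smul_eq`); FINITE at a good ordinary `v̄` iff
`E[p^∞]|_{G_{K_v̄}}` is non-split, which 20728's `Surj` forces for `p ≥ 5` (Tate 1967 Thm. 4, Raynaud 1974 `e = 1 < p − 1`,
Serre–Tate canonical lift ⟹ CM ⟹ Cartan normaliser; critic V#23r) — that implication is print-composite and OPEN TO
PROVE here; in the CM / split case (outside 20728) (A3″) is false. [cite: Tate1967, Thm. 4] [cite: Raynaud1974, Cor. 3.3.6]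
[cite: Serre1972, §4.5] [cite: GreenbergLNM1716, §4 Prop. 4.8 (p. 109)] -/
def InertiaTowerFixedPointExponent : Prop :=
  ∃ c : ℕ, ∀ m : W.geomPrimaryTorsion p,
    (∀ t ∈ ZpExtension.pairKer κ₁ κ₂ ⊓ GreenbergSelmer.inertia vbar, t • m = m) → p ^ c • m = 0

/-- **(A3″) ⟹ (A3′), with `m₃ = c`** (any elliptic `E/K`, any pair, `v̄ ∣ p`). The supersingular theorem
`strictAtVbarExponent_of_inertia_cyclic` is its case `c = 0`. [cite: GreenbergLNM1716, §4 Prop. 4.8 (p. 109)]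
[cite: SerreGaloisCohomology1997, I §2.6 (b)] -/
theorem strictAtVbarExponent_of_fixedPointExponent (hv : ((p : ℕ) : 𝓞 K) ∈ vbar.asIdeal)
    (h : InertiaTowerFixedPointExponent W κ₁ κ₂ vbar) : StrictAtVbarExponent W κ₁ κ₂ vbar := by
  obtain ⟨c, hc⟩ := h
  refine ⟨c, fun t ht σ ↦ ?_⟩
  rw [map_nsmul, LocalDatum.mem_strictKer_iff, map_nsmul]
  -- Greenberg's (inertia) condition at `v̄` for `conj_σ (res t) = res (conj_σ t)`
  have h1 := ((GreenbergVatsal2000.mem_datumSelmer_iff _).1 ht).2 vbar hv σ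
  rw [AcSelmer.bdpData_self, LocalDatum.mem_greenbergKer_iff] at h1
  have hcomm := congrArg (fun f ↦ f t)
    (resOfLe_comp_conjH1_holds (M := W.geomPrimaryTorsion p) (le_top : ZpExtension.pairKer κ₁ κ₂ ≤ ⊤) σ)
  simp only [AddMonoidHom.comp_apply] at hcomm
  rw [← hcomm] at h1
  exact nsmul_strictMap_top_eq_zero_of_greenbergMap_resOfLe_eq_zero (ZpExtension.pairKer κ₁ κ₂)
    (AcSelmer.strictDatum (W.geomPrimaryTorsion p) vbar) (p ^ c)
    (strictDatum_gr_nsmul_eq_zero_of_forall_smul_eq vbar (ZpExtension.pairKer κ₁ κ₂) (p ^ c) hc) _ h1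

/-- **On ALL of 20728's range (ordinary `v̄` included), (A′) ⟸ (A3″)** — (A1′) and (A2′) being theorems (v1.3):
`E/ℚ`, `p` odd, `ρ̄_{E,p}` onto, `K` imaginary quadratic, `v̄ ∣ p`, `(γ₁,γ₂)` a generator pair.
[cite: arXiv:2409.01350, Part II Prop. 3.1(b), Cor. 3.2 (p. 78)] [cite: GreenbergLNM1716, §3 Lemmas 3.1–3.3, §4 Prop. 4.8] -/
theorem bottomControlExponent_of_fixedPointExponent (W₀ : WeierstrassCurve ℚ) [W₀.IsElliptic]
    (hp2 : p ≠ 2) (hρ : W₀.HasSurjectiveModNGaloisRep p) (hK : IsImaginaryQuadratic K)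
    (hpvbar : ((p : ℕ) : 𝓞 K) ∈ vbar.asIdeal) (hγ : ZpExtension.IsTopGeneratorPair κ₁ κ₂ γ₁ γ₂)
    (h3 : InertiaTowerFixedPointExponent (W₀.baseChange K) κ₁ κ₂ vbar) :
    BottomControlExponent (W₀.baseChange K) κ₁ κ₂ vbar γ₁ γ₂ :=
  haveI : (W₀.baseChange K).IsElliptic := by rw [WeierstrassCurve.baseChange]; infer_instance
  bottomControlExponent_of_pieces (W₀.baseChange K) κ₁ κ₂ vbar γ₁ γ₂
    (globalBottomSurjective_of_noPTorsion (W₀.baseChange K) κ₁ κ₂ vbar γ₁ γ₂ hγ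
      (noPTorsion_baseChange_of_hasSurjectiveModNGaloisRep W₀ hK hp2 hρ))
    (awayExponent_of_isImaginaryQuadratic (W₀.baseChange K) κ₁ κ₂ vbar hK)
    (strictAtVbarExponent_of_fixedPointExponent (W₀.baseChange K) κ₁ κ₂ vbar hpvbar h3)

/-- **Door 4's `hfix` bound on ALL of 20728's range from (A3″) + (B′)-finiteness.** At a supersingular `v̄` (A3″) holds
with `c = 0` and this is `hfixBound_of_finite_supersingular`. No summit statement is proved.
[cite: arXiv:2409.01350, Part II Prop. 3.1, Cor. 3.2 (p. 78)] [cite: arXiv:1405.7294, §2.3 Lemma 4 (p. 8)] -/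
theorem hfixBound_of_fixedPointExponent_of_finite (W₀ : WeierstrassCurve ℚ) [W₀.IsElliptic]
    (hp2 : p ≠ 2) (hρ : W₀.HasSurjectiveModNGaloisRep p) (hK : IsImaginaryQuadratic K)
    (hpvbar : ((p : ℕ) : 𝓞 K) ∈ vbar.asIdeal) (hγ : ZpExtension.IsTopGeneratorPair κ₁ κ₂ γ₁ γ₂)
    (h3 : InertiaTowerFixedPointExponent (W₀.baseChange K) κ₁ κ₂ vbar)
    (hfin : (SetLike.coe (bottomSelmer p (W₀.baseChange K) vbar)).Finite) :
    ∃ k : ℕ, HfixBound (W₀.baseChange K) κ₁ κ₂ vbar γ₁ γ₂ k :=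
  hfixBound_of_control_of_finite (W₀.baseChange K) κ₁ κ₂ vbar γ₁ γ₂
    (bottomControlExponent_of_fixedPointExponent κ₁ κ₂ vbar γ₁ γ₂ W₀ hp2 hρ hK hpvbar hγ h3)
    hfin (fun t _ ↦ exists_pow_smul_eq_zero_top (W₀.baseChange K) t)

/-- Consistency check: at a split supersingular `p` (A3″) holds with `c = 0` (the v1.2 input, repackaged).
[cite: Serre1972, §1.11 Prop. 12 c)] -/
theorem inertiaTowerFixedPointExponent_baseChange_of_dvd_frobeniusTrace (W₀ : WeierstrassCurve ℚ) [W₀.IsElliptic]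
    [W₀.IsGloballyMinimal] (hp2 : p ≠ 2) (hgood : W₀.HasGoodReductionAtPrime p)
    (hss : (p : ℤ) ∣ W₀.frobeniusTrace p) (hK : IsImaginaryQuadratic K)
    {v : HeightOneSpectrum (𝓞 K)} (hpv : ((p : ℕ) : 𝓞 K) ∈ v.asIdeal) (hpvbar : ((p : ℕ) : 𝓞 K) ∈ vbar.asIdeal)
    (hne : vbar ≠ v) :
    InertiaTowerFixedPointExponent (W₀.baseChange K) κ₁ κ₂ vbar := by
  haveI : (W₀.baseChange K).IsElliptic := by rw [WeierstrassCurve.baseChange]; infer_instance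
  obtain ⟨hcyc, hcard⟩ := InertiaFixedPoint.isCyclic_and_card_inertia_map_baseChange W₀ hp2 hgood hss hK hpv hpvbar hne
  refine ⟨0, fun m hm ↦ ?_⟩
  rw [pow_zero, one_smul]
  exact InertiaFixedPoint.primary_eq_zero_of_forall_pairKer_inf_inertia_smul_eq (W₀.baseChange K) κ₁ κ₂ vbar hcyc
    hcard hm

end StrictExponent

/-! ## (B′) DECOMPOSED: strict-at-both finiteness + finite image at `v` ⟹ `Set.Finite ↑(bottomSelmer)` (v1.5)

KatoLine.md §1g. `bottomSelmer p W v̄ = Sel_Gr(K, E[p^∞])` is strict at `v̄` and RELAXED at `v`; restricting to `D_v` cuts it into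
(B′-i′) the kernel (strict at BOTH `v`, `v̄`) — inside the tree's strict Selmer group, finite under rank `E(K) = 1 ∧ Ш(E/K)[p^∞]` finite
(`finite_strictSelmer_adicCompletion_of_mordellWeilRank_eq_one_of_ncard_primesOver_eq`; transport in section `Transport` via X11b's
`LocBridge.topEquivH1`: `bottomStrictFinite_of_mordellWeilRank_eq_one`) — and (B′-ii′) the IMAGE in `H¹(D_v, E[p^∞])` (Skinner 2020 §2.3
Lemma 4's content; settled in rank one by v1.11). Glue `#S = #(S ∩ ker f) · #f(S)`. No summit statement is proved.
[cite: arXiv:1405.7294, §2.3 Lemmas 3–4 (p. 8)] [cite: Greenberg1989, §1 p. 98] -/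

section BottomFinite

/-- `#A = #(A ⧸ N) · #N`: finite subgroup and finite quotient ⟹ finite group. [folklore] -/
theorem finite_of_finite_quotient_of_finite_addSubgroup' {A : Type*} [AddCommGroup A] (N : AddSubgroup A)
    (hN : Finite N) (hQ : Finite (A ⧸ N)) : Finite A := by
  apply Nat.finite_of_card_ne_zero
  rw [N.card_eq_card_quotient_mul_card_addSubgroup]
  exact mul_ne_zero (Nat.card_pos (α := A ⧸ N)).ne' (Nat.card_pos (α := N)).ne'

/-- **A subgroup with finite intersection with `ker f` and finite image under `f` is finite.** [folklore] -/
theorem AddSubgroup.finite_of_finite_inf_ker_of_finite_image {A B : Type*} [AddCommGroup A] [AddCommGroup B]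
    (f : A →+ B) (S : AddSubgroup A) (hk : (SetLike.coe (S ⊓ f.ker)).Finite)
    (hi : (f '' (S : Set A)).Finite) : (S : Set A).Finite := by
  -- the kernel of `f|_S` embeds into `S ⊓ ker f`
  haveI hker : Finite (f.restrict S).ker := by
    haveI : Finite (SetLike.coe (S ⊓ f.ker)) := hk.to_subtype
    have hmem : ∀ x : (f.restrict S).ker, ((x : S) : A) ∈ S ⊓ f.ker := fun x ↦ by
      have hx := x.2
      rw [AddMonoidHom.mem_ker, AddMonoidHom.restrict_apply] at hx
      exact AddSubgroup.mem_inf.2 ⟨(x : S).2, (AddMonoidHom.mem_ker).2 hx⟩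
    refine Finite.of_injective (fun x : (f.restrict S).ker ↦ (⟨((x : S) : A), hmem x⟩ : SetLike.coe (S ⊓ f.ker))) ?_
    intro x y hxy
    apply Subtype.ext; apply Subtype.ext
    exact congrArg (fun z : SetLike.coe (S ⊓ f.ker) ↦ (z : A)) hxy
  -- the range of `f|_S` is `f '' S`
  haveI hrange : Finite (f.restrict S).range := by
    haveI : Finite (f '' (S : Set A)) := hi.to_subtype
    have hmem : ∀ y : (f.restrict S).range, (y : B) ∈ f '' (S : Set A) := fun y ↦ by
      obtain ⟨x, hx⟩ := y.2
      exact ⟨x, x.2, by rw [← hx, AddMonoidHom.restrict_apply]⟩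
    refine Finite.of_injective (fun y : (f.restrict S).range ↦ (⟨(y : B), hmem y⟩ : f '' (S : Set A))) ?_
    intro x y hxy
    apply Subtype.ext
    exact congrArg (fun z : f '' (S : Set A) ↦ (z : B)) hxy
  haveI : Finite (S ⧸ (f.restrict S).ker) :=
    Finite.of_equiv _ (QuotientAddGroup.quotientKerEquivRange (f.restrict S)).symm.toEquiv
  haveI : Finite S := finite_of_finite_quotient_of_finite_addSubgroup' (f.restrict S).ker hker inferInstance
  exact Set.toFinite _

variable (v : HeightOneSpectrum (𝓞 K))

variable (p) in
/-- **(B′-i′) strict-at-both finiteness**: the classes of `Sel_Gr(K, E[p^∞])` that ALSO die on `D_v` — strict at `v` and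
at `v̄`, locally trivial away from `p` — form a finite group. A subgroup of `Sel_{p^∞}(E/K) ∩ ker res_v̄` (strict ⟹ Selmer
condition; trivial ⟹ Selmer condition), finite when rank `E(K) = 1` and `Ш(E/K)[p^∞]` is finite (tree
`finite_strictSelmer_of_mordellWeilRank_eq_one_of_hom`, any number field; at `r_an(E/K) = 1` by Gross–Zagier + Kolyvagin);
the model transport `subgroupH1 ⊤ → galH1Primary` is `toGalH1` of section `Transport` below (PROVED there in rank one).
[cite: arXiv:1405.7294, §2.2 Lemma 2 (p. 8)] [cite: Greenberg1999, §2] -/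
def BottomStrictFinite : Prop :=
  (SetLike.coe (bottomSelmer p W vbar ⊓
    (AcSelmer.strictDatum (W.geomPrimaryTorsion p) v).strictKer (⊤ : Subgroup (absoluteGaloisGroup K)))).Finite

variable (p) in
/-- **(B′-ii′) finite image at `v`**: the image of `Sel_Gr(K, E[p^∞])` in `H¹(D_v, E[p^∞])` (restriction to the
decomposition group at `v`, where `Sel_Gr` imposes nothing) is finite. This is the `E[p^∞]`-shadow of Skinner's
`X_𝔭̄ = 0` (the image of `H¹_𝔭̄(K,V)` in `H¹(K_p,V)` vanishes when `dim im(H¹_f(K,V) → H¹_f(K_p,V)) = 1`): Poitou–Tate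
LAGRANGIAN position of the global image (Lemma 3, `dim = 2`) + the swap `c : X_𝔭 ↔ X_𝔭̄` — OPEN here (L-sized at finite
level, uniformly in `k`; the tree's Greenberg–Wiles formula is void for this structure since `F* = c(F)`).
[cite: arXiv:1405.7294, §2.3 Lemmas 3–4 (p. 8)] [cite: MilneADT2006, I Thm. 4.10] -/
def BottomImageFiniteAt : Prop :=
  ((AcSelmer.strictDatum (W.geomPrimaryTorsion p) v).strictMap (⊤ : Subgroup (absoluteGaloisGroup K)) ''
    (SetLike.coe (bottomSelmer p W vbar))).Finite

omit [Fact p.Prime] in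
/-- **(B′-i′) ∧ (B′-ii′) ⟹ (B′)** (`#S = #(S ∩ ker) · #image`). [folklore] [cite: arXiv:1405.7294, §2.3 Lemma 4 (p. 8)] -/
theorem bottomSelmer_finite_of_pieces (h1 : BottomStrictFinite p W vbar v) (h2 : BottomImageFiniteAt p W vbar v) :
    (SetLike.coe (bottomSelmer p W vbar)).Finite :=
  AddSubgroup.finite_of_finite_inf_ker_of_finite_image _ _ h1 h2

/-- **Door 4's `hfix` bound from (A3″) + (B′-i′) + (B′-ii′)** on all of 20728's range (`E/ℚ`, `p ≠ 2`, `Surj`, `K` imaginary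
quadratic, `v̄ ∣ p`, generator pair; `v` is ANY finite place — in the application the other prime above `p`).
No summit statement is proved. [cite: arXiv:2409.01350, Part II Prop. 3.1, Cor. 3.2 (p. 78)]
[cite: arXiv:1405.7294, §2.3 Lemma 4 (p. 8)] -/
theorem hfixBound_of_fixedPointExponent_of_pieces (W₀ : WeierstrassCurve ℚ) [W₀.IsElliptic]
    (hp2 : p ≠ 2) (hρ : W₀.HasSurjectiveModNGaloisRep p) (hK : IsImaginaryQuadratic K)
    (hpvbar : ((p : ℕ) : 𝓞 K) ∈ vbar.asIdeal) (hγ : ZpExtension.IsTopGeneratorPair κ₁ κ₂ γ₁ γ₂)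
    (h3 : InertiaTowerFixedPointExponent (W₀.baseChange K) κ₁ κ₂ vbar)
    (hB1 : BottomStrictFinite p (W₀.baseChange K) vbar v) (hB2 : BottomImageFiniteAt p (W₀.baseChange K) vbar v) :
    ∃ k : ℕ, HfixBound (W₀.baseChange K) κ₁ κ₂ vbar γ₁ γ₂ k :=
  hfixBound_of_fixedPointExponent_of_finite κ₁ κ₂ vbar γ₁ γ₂ W₀ hp2 hρ hK hpvbar hγ h3
    (bottomSelmer_finite_of_pieces (W₀.baseChange K) vbar v hB1 hB2)

/-- … and at a split SUPERSINGULAR `p` from (B′-i′) + (B′-ii′) alone. [cite: Serre1972, §1.11 Prop. 12 c)]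
[cite: arXiv:1405.7294, §2.3 Lemma 4 (p. 8)] -/
theorem hfixBound_of_pieces_supersingular (W₀ : WeierstrassCurve ℚ) [W₀.IsElliptic] [W₀.IsGloballyMinimal]
    (hp2 : p ≠ 2) (hgood : W₀.HasGoodReductionAtPrime p) (hss : (p : ℤ) ∣ W₀.frobeniusTrace p)
    (hρ : W₀.HasSurjectiveModNGaloisRep p) (hK : IsImaginaryQuadratic K)
    (hpv : ((p : ℕ) : 𝓞 K) ∈ v.asIdeal) (hpvbar : ((p : ℕ) : 𝓞 K) ∈ vbar.asIdeal) (hne : vbar ≠ v)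
    (hγ : ZpExtension.IsTopGeneratorPair κ₁ κ₂ γ₁ γ₂)
    (hB1 : BottomStrictFinite p (W₀.baseChange K) vbar v) (hB2 : BottomImageFiniteAt p (W₀.baseChange K) vbar v) :
    ∃ k : ℕ, HfixBound (W₀.baseChange K) κ₁ κ₂ vbar γ₁ γ₂ k :=
  hfixBound_of_fixedPointExponent_of_pieces κ₁ κ₂ vbar γ₁ γ₂ v W₀ hp2 hρ hK hpvbar hγ
    (inertiaTowerFixedPointExponent_baseChange_of_dvd_frobeniusTrace κ₁ κ₂ vbar W₀ hp2 hgood hss hK hpv hpvbar hne)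
    hB1 hB2

end BottomFinite

/-! ## (B′-i′) PROVED in rank one: transport to the tree's strict Selmer group (v1.5; KatoLine.md §1g)

The classes of `Sel_Gr(K, E[p^∞])` that also die on `D_v` inject into the tree's `v̄`-strict Selmer group
`W.selmerGroupPInfty p ⊓ selmerLocalKerPrimaryTorsion W (K_v̄) p` (restriction TO `D_w` vs. ALONG `Γ_{K_w} → D_w`, cocycle
criterion; complex places impose nothing); with `p = v v̄` split every place above `p` is `v` or `v̄`, so (B′-i′) follows from
`finite_strictSelmer_adicCompletion_of_mordellWeilRank_eq_one_of_ncard_primesOver_eq_two` (rank `E(K) = 1`, `Ш(E/K)[p^∞]` finite).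
No summit statement is proved. [cite: arXiv:1405.7294, §2.2 Lemma 2 (p. 8)] [cite: Greenberg1999, §2] [cite: GreenbergLNM1716, §2]
[cite: arXiv:2409.01350, §12.1.2, proof of Thm. 12.3 (p. 96)] -/

section Transport

open scoped Classical

open Summit.BirchSwinnertonDyer.Rank1Residual.X11b.LocBridge (toDiscreteH1 topEquivH1 isOpen_stabilizer_geomPrimaryTorsion
  resSubgroup_oneCocycleClass_eq_zero_iff topEquivH1_mem_awayKer_iff topEquivH1_mem_strictKer_strictDatum_iff)
open Summit.BirchSwinnertonDyer.BirchSwinnertonDyer.Theorems.GreenbergFullAtSelmer (eq_or_eq_of_natCast_mem_of_ne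
  ncard_primesOver_eq_two_and_deg_one_of_ne)

omit [Fact p.Prime] in
/-- **Dying on `D_w` ⟹ dying in `H¹(K_w, E(K̄_w)[p^∞])`** (restriction along `Γ_{K_w} → D_w ≤ Γ_K` followed by
`E[p^∞](K̄) → E[p^∞](K̄_w)`; cocycle criterion). [cite: Greenberg1999, §2] [cite: SerreGaloisCohomology1997, I §5.1] -/
theorem mem_selmerLocalKerPrimaryTorsion_of_resSubgroup_eq_zero (w : HeightOneSpectrum (𝓞 K))
    (d : W.galH1Primary p) (hd : ResKernel.resSubgroup (decomp w) (W.geomPrimaryTorsion p) d = 0) :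
    d ∈ selmerLocalKerPrimaryTorsion W (w.adicCompletion K) p := by
  obtain ⟨z, rfl⟩ :=
    oneCocycleClass_surjective (discreteTopRep (absoluteGaloisGroup K) (W.geomPrimaryTorsion p)) d
  obtain ⟨a, ha⟩ := (resSubgroup_oneCocycleClass_eq_zero_iff (decomp w) z).1 hd
  rw [selmerLocalKerPrimaryTorsion, oneCocycleClass_mem_resKer_iff]
  refine ⟨primaryPointsMap W _ p a, fun x ↦ ?_⟩
  rw [ha (resGal (K := K) (w.adicCompletion K) x) ⟨x, rfl⟩, map_sub, primaryPointsMap_smul]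

omit [Fact p.Prime] in
/-- **Dying on `D_w` ⟹ the Selmer local condition at `w`** (dying in `H¹(K_w, E(K̄_w))`). [cite: Greenberg1999, §2] -/
theorem mem_selmerLocalKerPrimary_of_resSubgroup_eq_zero (w : HeightOneSpectrum (𝓞 K))
    (d : W.galH1Primary p) (hd : ResKernel.resSubgroup (decomp w) (W.geomPrimaryTorsion p) d = 0) :
    d ∈ W.selmerLocalKerPrimary (w.adicCompletion K) p := by
  obtain ⟨z, rfl⟩ :=
    oneCocycleClass_surjective (discreteTopRep (absoluteGaloisGroup K) (W.geomPrimaryTorsion p)) d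
  obtain ⟨a, ha⟩ := (resSubgroup_oneCocycleClass_eq_zero_iff (decomp w) z).1 hd
  rw [WeierstrassCurve.selmerLocalKerPrimary, oneCocycleClass_mem_resKer_iff]
  refine ⟨pointsMap W _ (a : W.geomPoints), fun x ↦ ?_⟩
  rw [ha (resGal (K := K) (w.adicCompletion K) x) ⟨x, rfl⟩]
  simp only [AddMonoidHom.comp_apply, AddSubgroup.coe_subtype, map_sub,
    Literature.NumberTheory.EllipticCurves.primaryComponent.coe_smul, pointsMap_smul]

omit [Fact p.Prime] [NumberField K] in
/-- **A complex place imposes no Selmer condition** (`Γ_{K_w}` is trivial). [cite: GrossLMS1991, §5 (5.1)] -/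
theorem mem_selmerLocalKerPrimary_completion_of_isComplex {w : InfinitePlace K} (hw : w.IsComplex)
    (d : W.galH1Primary p) : d ∈ W.selmerLocalKerPrimary w.Completion p := by
  haveI : IsAlgClosed w.Completion :=
    isAlgClosed_of_ringEquiv (InfinitePlace.Completion.ringEquivComplexOfIsComplex hw).symm
  haveI := Literature.NumberTheory.EllipticCurves.subsingleton_absoluteGaloisGroup_of_isAlgClosed w.Completion
  obtain ⟨z, rfl⟩ :=
    oneCocycleClass_surjective (discreteTopRep (absoluteGaloisGroup K) (W.geomPrimaryTorsion p)) d
  rw [WeierstrassCurve.selmerLocalKerPrimary, oneCocycleClass_mem_resKer_iff]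
  refine ⟨0, fun x ↦ ?_⟩
  rw [Subsingleton.elim x 1, map_one, contOneCocycles.apply_one, map_zero, smul_zero, sub_zero]

variable (p) in
/-- **The transport map** `Sel-side`: `H¹(⊤, E[p^∞]) → H¹(K, E[p^∞])` (inverse of restriction to `⊤ ≤ Γ_K`, through
X11b's `topEquivH1` / `toDiscreteH1`). [folklore] -/
def toGalH1 : subgroupH1 (⊤ : Subgroup (absoluteGaloisGroup K)) (W.geomPrimaryTorsion p) → W.galH1Primary p :=
  fun c ↦ toDiscreteH1 (isOpen_stabilizer_geomPrimaryTorsion W p)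
    ((topEquivH1 (isOpen_stabilizer_geomPrimaryTorsion W p)).symm c)

omit [Fact p.Prime] [NumberField K] in
/-- `toGalH1` is injective (a composite of equivalences). [folklore] -/
theorem toGalH1_injective : Function.Injective (toGalH1 p W) :=
  (toDiscreteH1 _).injective.comp (topEquivH1 _).symm.injective

omit [Fact p.Prime] in
/-- Strict at `w` (dies on `D_w` in the `⊤`-model) ⟹ `toGalH1 c` dies on `decomp w`. [cite: Greenberg1989, §1 p. 98] -/
theorem resSubgroup_toGalH1_eq_zero_of_mem_strictKer (w : HeightOneSpectrum (𝓞 K))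
    (c : subgroupH1 (⊤ : Subgroup (absoluteGaloisGroup K)) (W.geomPrimaryTorsion p))
    (hc : c ∈ (AcSelmer.strictDatum (W.geomPrimaryTorsion p) w).strictKer ⊤) :
    ResKernel.resSubgroup (decomp w) (W.geomPrimaryTorsion p) (toGalH1 p W c) = 0 := by
  -- X11b's `strictDatum` is a verbatim copy of Castella2018's (`plus := ⊥`): the two kernels agree definitionally
  refine (topEquivH1_mem_strictKer_strictDatum_iff w _).1 ?_
  rw [AddEquiv.apply_symm_apply]
  exact hc

omit [Fact p.Prime] in
/-- Locally trivial at `w` (`awayKer`) ⟹ `toGalH1 c` dies on `decomp w`. [cite: GreenbergLNM1716, §2] -/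
theorem resSubgroup_toGalH1_eq_zero_of_mem_awayKer (w : HeightOneSpectrum (𝓞 K))
    (c : subgroupH1 (⊤ : Subgroup (absoluteGaloisGroup K)) (W.geomPrimaryTorsion p))
    (hc : c ∈ GreenbergSelmer.awayKer ⊤ (W.geomPrimaryTorsion p) w) :
    ResKernel.resSubgroup (decomp w) (W.geomPrimaryTorsion p) (toGalH1 p W c) = 0 := by
  refine (topEquivH1_mem_awayKer_iff w _).1 ?_
  rw [AddEquiv.apply_symm_apply]
  exact hc

omit [Fact p.Prime] in
/-- Membership in `Sel_Gr(K, E[p^∞])` (`H = ⊤`, where conjugation acts trivially): away from `p` locally trivial,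
strict at `v̄`. [cite: arXiv:2409.01350, Part II §1.2 (pp. 63–64)] [cite: Castella2018, Def. 2.2] -/
theorem awayKer_and_strictKer_of_mem_bottomSelmer
    (c : subgroupH1 (⊤ : Subgroup (absoluteGaloisGroup K)) (W.geomPrimaryTorsion p))
    (hc : c ∈ bottomSelmer p W vbar) :
    (∀ w : HeightOneSpectrum (𝓞 K), ((p : ℕ) : 𝓞 K) ∉ w.asIdeal →
        c ∈ GreenbergSelmer.awayKer ⊤ (W.geomPrimaryTorsion p) w) ∧
      c ∈ (AcSelmer.strictDatum (W.geomPrimaryTorsion p) vbar).strictKer ⊤ := by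
  have e : ∀ σ : absoluteGaloisGroup K, conjH1 ⊤ (W.geomPrimaryTorsion p) σ c = c := fun σ ↦ by
    rw [Literature.NumberTheory.EllipticCurves.conjH1_of_mem_holds ⊤ (W.geomPrimaryTorsion p) (Subgroup.mem_top σ),
      AddMonoidHom.id_apply]
  obtain ⟨hA, -, hS⟩ := (AcSelmer.mem_selmerOver_iff c).1 hc
  exact ⟨fun w hw ↦ by simpa only [e] using hA w hw (Set.notMem_empty w) 1, by simpa only [e] using hS 1⟩

variable (v : HeightOneSpectrum (𝓞 K))

omit [Fact p.Prime] in
/-- **The injection (B′-i′)-group ↪ the tree's `v̄`-strict Selmer group.** If every place above `p` is `v` or `v̄` and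
every infinite place of `K` is complex, then for `c ∈ Sel_Gr(K, E[p^∞])` dying on `D_v`, `toGalH1 c` lies in
`Sel_{p^∞}(E/K) ∩ ker res_v̄`. [cite: arXiv:1405.7294, §2.2–2.3 (p. 8)] [cite: Greenberg1999, §2] -/
theorem toGalH1_mem_strictSelmer (hK : ∀ w : InfinitePlace K, w.IsComplex)
    (hSp : ∀ w : HeightOneSpectrum (𝓞 K), ((p : ℕ) : 𝓞 K) ∈ w.asIdeal → w = v ∨ w = vbar)
    (c : subgroupH1 (⊤ : Subgroup (absoluteGaloisGroup K)) (W.geomPrimaryTorsion p))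
    (hc : c ∈ bottomSelmer p W vbar)
    (hcv : c ∈ (AcSelmer.strictDatum (W.geomPrimaryTorsion p) v).strictKer ⊤) :
    toGalH1 p W c ∈ W.selmerGroupPInfty p ⊓ selmerLocalKerPrimaryTorsion W (vbar.adicCompletion K) p := by
  obtain ⟨hA, hS⟩ := awayKer_and_strictKer_of_mem_bottomSelmer W vbar c hc
  refine AddSubgroup.mem_inf.2 ⟨?_, mem_selmerLocalKerPrimaryTorsion_of_resSubgroup_eq_zero W vbar _
    (resSubgroup_toGalH1_eq_zero_of_mem_strictKer W vbar c hS)⟩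
  rw [WeierstrassCurve.selmerGroupPInfty, AddSubgroup.mem_inf, AddSubgroup.mem_iInf, AddSubgroup.mem_iInf]
  refine ⟨fun w ↦ mem_selmerLocalKerPrimary_of_resSubgroup_eq_zero W w _ ?_,
    fun w ↦ mem_selmerLocalKerPrimary_completion_of_isComplex W (hK w) _⟩
  by_cases hw : ((p : ℕ) : 𝓞 K) ∈ w.asIdeal
  · rcases hSp w hw with rfl | rfl
    · exact resSubgroup_toGalH1_eq_zero_of_mem_strictKer W _ c hcv
    · exact resSubgroup_toGalH1_eq_zero_of_mem_strictKer W _ c hS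
  · exact resSubgroup_toGalH1_eq_zero_of_mem_awayKer W w c (hA w hw)

omit [Fact p.Prime] in
/-- **(B′-i′) from the finiteness of the tree's `v̄`-strict Selmer group** (any `E/K`, `K` totally complex, the places
above `p` being `v`, `v̄`). [cite: arXiv:1405.7294, §2.2 Lemma 2 (p. 8)] -/
theorem bottomStrictFinite_of_finite_strictSelmer (hK : ∀ w : InfinitePlace K, w.IsComplex)
    (hSp : ∀ w : HeightOneSpectrum (𝓞 K), ((p : ℕ) : 𝓞 K) ∈ w.asIdeal → w = v ∨ w = vbar)
    (hfin : Finite ↥(W.selmerGroupPInfty p ⊓ selmerLocalKerPrimaryTorsion W (vbar.adicCompletion K) p)) :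
    BottomStrictFinite p W vbar v := by
  haveI : Finite ↥(bottomSelmer p W vbar ⊓ (AcSelmer.strictDatum (W.geomPrimaryTorsion p) v).strictKer ⊤) := by
    refine Finite.of_injective (fun c ↦ (⟨toGalH1 p W c, toGalH1_mem_strictSelmer W vbar v hK hSp c
      (AddSubgroup.mem_inf.1 c.2).1 (AddSubgroup.mem_inf.1 c.2).2⟩ :
      ↥(W.selmerGroupPInfty p ⊓ selmerLocalKerPrimaryTorsion W (vbar.adicCompletion K) p))) ?_
    intro x y hxy
    exact Subtype.ext (toGalH1_injective W (congrArg Subtype.val hxy))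
  unfold BottomStrictFinite
  exact Set.toFinite _

/-- **(B′-i′) PROVED in rank one** for ANY elliptic curve over a quadratic field `K` with every infinite place complex
and `p = v v̄` split: rank `E(K) = 1` and `Ш(E/K)[p^∞]` finite ⟹ `BottomStrictFinite`. (At `r_an(E/K) = 1` the two
hypotheses are Gross–Zagier + Kolyvagin, tree facts `gross_zagier` / `kolyvagin`.)
[cite: arXiv:1405.7294, §2.2 Lemma 2 (p. 8)] [cite: arXiv:2409.01350, §12.1.2, proof of Thm. 12.3 (p. 96)]
[cite: Kolyvagin1990, Thm. A] -/
theorem bottomStrictFinite_of_mordellWeilRank_eq_one [W.IsElliptic] (h2 : Module.finrank ℚ K = 2)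
    (hK : ∀ w : InfinitePlace K, w.IsComplex)
    (hpv : ((p : ℕ) : 𝓞 K) ∈ v.asIdeal) (hpvbar : ((p : ℕ) : 𝓞 K) ∈ vbar.asIdeal) (hne : vbar ≠ v)
    (hrank : W.mordellWeilRank = 1) [Finite (AddCommGroup.primaryComponent W.sha p)] :
    BottomStrictFinite p W vbar v := by
  have hSp : ∀ w : HeightOneSpectrum (𝓞 K), ((p : ℕ) : 𝓞 K) ∈ w.asIdeal → w = v ∨ w = vbar :=
    fun w hw ↦ eq_or_eq_of_natCast_mem_of_ne h2 hpv hpvbar hne hw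
  have hsplit : ((Ideal.span {(p : ℤ)}).primesOver (𝓞 K)).ncard = 2 :=
    (ncard_primesOver_eq_two_and_deg_one_of_ne h2 hpv hpvbar hne).1
  exact bottomStrictFinite_of_finite_strictSelmer W vbar v hK hSp
    (finite_strictSelmer_adicCompletion_of_mordellWeilRank_eq_one_of_ncard_primesOver_eq_two W p h2 hsplit hrank
      vbar hpvbar)

/-- **Door 4's `hfix` in rank one from (A3″) + (B′-ii′) alone** — 20728's setting (`E/ℚ`, `p ≠ 2`, `Surj`, `K` imaginary
quadratic, `p = v v̄` split, generator pair) plus rank `E(K) = 1` and `Ш(E/K)[p^∞]` finite (= `r_an(E/K) = 1` by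
Gross–Zagier–Kolyvagin). The open arithmetic inputs of the Kato line are now exactly (A3″) (a theorem at supersingular `p`)
and (B′-ii′). No summit statement is proved. [cite: arXiv:2409.01350, Part II Prop. 3.1, Cor. 3.2 (p. 78)]
[cite: arXiv:1405.7294, §2.3 Lemma 4 (p. 8)] -/
theorem hfixBound_of_fixedPointExponent_of_rankOne (W₀ : WeierstrassCurve ℚ) [W₀.IsElliptic]
    (hp2 : p ≠ 2) (hρ : W₀.HasSurjectiveModNGaloisRep p) (hK : IsImaginaryQuadratic K)
    (hpv : ((p : ℕ) : 𝓞 K) ∈ v.asIdeal) (hpvbar : ((p : ℕ) : 𝓞 K) ∈ vbar.asIdeal) (hne : vbar ≠ v)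
    (hγ : ZpExtension.IsTopGeneratorPair κ₁ κ₂ γ₁ γ₂)
    (h3 : InertiaTowerFixedPointExponent (W₀.baseChange K) κ₁ κ₂ vbar)
    (hrank : (W₀.baseChange K).mordellWeilRank = 1)
    [Finite (AddCommGroup.primaryComponent (W₀.baseChange K).sha p)]
    (hB2 : BottomImageFiniteAt p (W₀.baseChange K) vbar v) :
    ∃ k : ℕ, HfixBound (W₀.baseChange K) κ₁ κ₂ vbar γ₁ γ₂ k := by
  haveI : (W₀.baseChange K).IsElliptic := by rw [WeierstrassCurve.baseChange]; infer_instance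
  haveI := hK.2
  exact hfixBound_of_fixedPointExponent_of_pieces κ₁ κ₂ vbar γ₁ γ₂ v W₀ hp2 hρ hK hpvbar hγ h3
    (bottomStrictFinite_of_mordellWeilRank_eq_one (W₀.baseChange K) vbar v hK.1 IsTotallyComplex.isComplex hpv hpvbar
      hne hrank) hB2

/-- … and at a split SUPERSINGULAR `p`: `hfix` ⇐ (B′-ii′) alone in rank one. [cite: Serre1972, §1.11 Prop. 12 c)]
[cite: arXiv:1405.7294, §2.3 Lemma 4 (p. 8)] -/
theorem hfixBound_of_rankOne_supersingular (W₀ : WeierstrassCurve ℚ) [W₀.IsElliptic] [W₀.IsGloballyMinimal]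
    (hp2 : p ≠ 2) (hgood : W₀.HasGoodReductionAtPrime p) (hss : (p : ℤ) ∣ W₀.frobeniusTrace p)
    (hρ : W₀.HasSurjectiveModNGaloisRep p) (hK : IsImaginaryQuadratic K)
    (hpv : ((p : ℕ) : 𝓞 K) ∈ v.asIdeal) (hpvbar : ((p : ℕ) : 𝓞 K) ∈ vbar.asIdeal) (hne : vbar ≠ v)
    (hγ : ZpExtension.IsTopGeneratorPair κ₁ κ₂ γ₁ γ₂)
    (hrank : (W₀.baseChange K).mordellWeilRank = 1)
    [Finite (AddCommGroup.primaryComponent (W₀.baseChange K).sha p)]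
    (hB2 : BottomImageFiniteAt p (W₀.baseChange K) vbar v) :
    ∃ k : ℕ, HfixBound (W₀.baseChange K) κ₁ κ₂ vbar γ₁ γ₂ k :=
  hfixBound_of_fixedPointExponent_of_rankOne κ₁ κ₂ vbar γ₁ γ₂ v W₀ hp2 hρ hK hpv hpvbar hne hγ
    (inertiaTowerFixedPointExponent_baseChange_of_dvd_frobeniusTrace κ₁ κ₂ vbar W₀ hp2 hgood hss hK hpv hpvbar hne)
    hrank hB2

/-- **Door 4's `hfix` in rank one from (A3″) + (B′-ii′), consuming EXACTLY the conclusion of the tree's Heegner-point facts**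
(`kolyvagin` / `mordellWeilRank_eq_one_of_LDerivEK_ne_zero` in `HeegnerPoints.lean` conclude
`(E.baseChange K).mordellWeilRank = 1 ∧ (E.baseChange K).ShaFinite` at `r_an(E/K) = 1` under the Heegner hypothesis).
No summit statement is proved. [cite: Gross1991, (1.1) and Thm. 1.3] [cite: Kolyvagin1990, Thm. A] -/
theorem hfixBound_of_fixedPointExponent_of_shaFinite (W₀ : WeierstrassCurve ℚ) [W₀.IsElliptic]
    (hp2 : p ≠ 2) (hρ : W₀.HasSurjectiveModNGaloisRep p) (hK : IsImaginaryQuadratic K)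
    (hpv : ((p : ℕ) : 𝓞 K) ∈ v.asIdeal) (hpvbar : ((p : ℕ) : 𝓞 K) ∈ vbar.asIdeal) (hne : vbar ≠ v)
    (hγ : ZpExtension.IsTopGeneratorPair κ₁ κ₂ γ₁ γ₂)
    (h3 : InertiaTowerFixedPointExponent (W₀.baseChange K) κ₁ κ₂ vbar)
    (hGZK : (W₀.baseChange K).mordellWeilRank = 1 ∧ (W₀.baseChange K).ShaFinite)
    (hB2 : BottomImageFiniteAt p (W₀.baseChange K) vbar v) :
    ∃ k : ℕ, HfixBound (W₀.baseChange K) κ₁ κ₂ vbar γ₁ γ₂ k := by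
  haveI : Finite (W₀.baseChange K).sha := hGZK.2
  exact hfixBound_of_fixedPointExponent_of_rankOne κ₁ κ₂ vbar γ₁ γ₂ v W₀ hp2 hρ hK hpv hpvbar hne hγ h3 hGZK.1 hB2

/-- … and at a split SUPERSINGULAR `p`: `hfix` ⇐ (B′-ii′) + `rank E(K) = 1 ∧ Ш(E/K) finite` (the Heegner-point facts'
conclusion). No summit statement is proved. [cite: Serre1972, §1.11 Prop. 12 c)] [cite: Gross1991, Thm. 1.3] -/
theorem hfixBound_of_rankOne_supersingular_of_shaFinite (W₀ : WeierstrassCurve ℚ) [W₀.IsElliptic]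
    [W₀.IsGloballyMinimal] (hp2 : p ≠ 2) (hgood : W₀.HasGoodReductionAtPrime p) (hss : (p : ℤ) ∣ W₀.frobeniusTrace p)
    (hρ : W₀.HasSurjectiveModNGaloisRep p) (hK : IsImaginaryQuadratic K)
    (hpv : ((p : ℕ) : 𝓞 K) ∈ v.asIdeal) (hpvbar : ((p : ℕ) : 𝓞 K) ∈ vbar.asIdeal) (hne : vbar ≠ v)
    (hγ : ZpExtension.IsTopGeneratorPair κ₁ κ₂ γ₁ γ₂)
    (hGZK : (W₀.baseChange K).mordellWeilRank = 1 ∧ (W₀.baseChange K).ShaFinite)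
    (hB2 : BottomImageFiniteAt p (W₀.baseChange K) vbar v) :
    ∃ k : ℕ, HfixBound (W₀.baseChange K) κ₁ κ₂ vbar γ₁ γ₂ k := by
  haveI : Finite (W₀.baseChange K).sha := hGZK.2
  exact hfixBound_of_rankOne_supersingular κ₁ κ₂ vbar γ₁ γ₂ v W₀ hp2 hgood hss hρ hK hpv hpvbar hne hγ hGZK.1 hB2

end Transport

/-! ## The limit step of §1h (v1.7b): a relative index bounded along a monotone cover is bounded

Pure group theory for step 5 of the route to (B′-iv): if `S = ⋃_k (S ∩ T_k)` along a monotone family `T_k` and the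
relative index of `N` in each `S ∩ T_k` is positive and `≤ C`, then the relative index of `N` in `S` is positive and
`≤ C` (any `C + 1` cosets have representatives in a common `T_k`). Instantiated with `S = Sel_Gr`, `N = kummerAt` and
`T_k` = the image of `H¹(K, E[p^k])`, it reduces (B′-iv) to the LEVELWISE bound `[H¹_{𝓖_k} : H¹_{𝓕_k}] ≤ C` that the
finite-level relative Poitou–Tate count is to deliver (`KatoLine.md` §1h steps 2–4; OPEN). [folklore]
[cite: Rubin2000, Thm. 1.7.3] [cite: MilneADT2006, I Thm. 4.10] -/

section IndexLimit

/-- **A relative index bounded along a monotone cover is bounded.** [folklore] -/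
theorem AddSubgroup.relIndex_pos_and_le_of_monotone_cover {A : Type*} [AddCommGroup A] (N S : AddSubgroup A)
    (T : ℕ → AddSubgroup A) (hT : Monotone T) (hcov : ∀ x ∈ S, ∃ k, x ∈ T k) (C : ℕ)
    (hC : ∀ k, 0 < N.relIndex (S ⊓ T k) ∧ N.relIndex (S ⊓ T k) ≤ C) :
    0 < N.relIndex S ∧ N.relIndex S ≤ C := by
  classical
  -- representatives and levels
  set Q := ↥S ⧸ N.addSubgroupOf S with hQ
  have hrel : N.relIndex S = Nat.card Q := rfl
  have rep_spec : ∀ q : Q, ∃ s : S, (QuotientAddGroup.mk s : Q) = q := fun q ↦ QuotientAddGroup.mk_surjective q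
  choose rep hrep using rep_spec
  have lev_spec : ∀ q : Q, ∃ k, ((rep q : S) : A) ∈ T k := fun q ↦ hcov _ (rep q).2
  choose lev hlev using lev_spec
  -- every finite set of cosets has at most `C` elements
  have key : ∀ F : Finset Q, F.card ≤ C := by
    intro F
    set k := F.sup lev with hk
    have hmem : ∀ q ∈ F, ((rep q : S) : A) ∈ S ⊓ T k := fun q hq ↦
      AddSubgroup.mem_inf.2 ⟨(rep q).2, hT (Finset.le_sup hq) (hlev q)⟩
    haveI : Finite (↥(S ⊓ T k) ⧸ N.addSubgroupOf (S ⊓ T k)) :=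
      Nat.finite_of_card_ne_zero (hC k).1.ne'
    let φ : {q // q ∈ F} → ↥(S ⊓ T k) ⧸ N.addSubgroupOf (S ⊓ T k) :=
      fun q ↦ QuotientAddGroup.mk ⟨((rep q.1 : S) : A), hmem q.1 q.2⟩
    have hφ : Function.Injective φ := by
      rintro ⟨q₁, hq₁⟩ ⟨q₂, hq₂⟩ h
      have h' := (QuotientAddGroup.eq.1 h)
      rw [AddSubgroup.mem_addSubgroupOf] at h'
      -- `-rep q₁ + rep q₂ ∈ N`, as elements of `A`
      have hN : -((rep q₁ : S) : A) + ((rep q₂ : S) : A) ∈ N := by simpa using h'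
      apply Subtype.ext
      show q₁ = q₂
      rw [← hrep q₁, ← hrep q₂]
      refine QuotientAddGroup.eq.2 ?_
      rw [AddSubgroup.mem_addSubgroupOf]
      simpa using hN
    have hle := Nat.card_le_card_of_injective φ hφ
    rw [Nat.card_eq_finsetCard] at hle
    exact hle.trans (hC k).2
  -- hence the quotient is finite, of size `≤ C`, and nonempty
  have hfin : Finite Q := by
    by_contra h
    rw [not_finite_iff_infinite] at h
    obtain ⟨F, hF⟩ := Infinite.exists_subset_card_eq Q (C + 1)
    have := key F
    omega
  letI : Fintype Q := Fintype.ofFinite Q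
  refine ⟨hrel ▸ Nat.card_pos, ?_⟩
  rw [hrel, Nat.card_eq_fintype_card, ← Finset.card_univ]
  exact key _

end IndexLimit

/-! ## (B′-iv) the Kummer-at-`v` part of `Sel_Gr` has finite index — the rank-robust residue of (B′) (v1.7; KatoLine.md §1h)

`Sel_Gr = bottomSelmer` is RELAXED at `v`; its classes satisfying the Kummer condition at `v` transport into the tree's `v̄`-strict
Selmer group as in section `Transport`, so (B′) ⟸ (B′-iv) «`[Sel_Gr : Sel_Gr ∩ {Kummer at v}] < ∞`» + finiteness of that strict
Selmer group. (B′-iv) is expected for EVERY `E(K)` of rank `≥ 1` and is PROVED in rank one at a split `p` in section `LevelwiseImage`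
(v1.11). [cite: MilneADT2006, I Thm. 4.10] [cite: Rubin2000, Thm. 1.7.3] [cite: arXiv:1405.7294, §2.3 Lemma 4 (p. 8)] -/

section KummerIndex

open scoped Classical

open Summit.BirchSwinnertonDyer.Rank1Residual.X11b.LocBridge (toDiscreteH1 topEquivH1 isOpen_stabilizer_geomPrimaryTorsion
  resSubgroup_oneCocycleClass_eq_zero_iff topEquivH1_mem_awayKer_iff topEquivH1_mem_strictKer_strictDatum_iff)
open Summit.BirchSwinnertonDyer.BirchSwinnertonDyer.Theorems.GreenbergFullAtSelmer (eq_or_eq_of_natCast_mem_of_ne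
  ncard_primesOver_eq_two_and_deg_one_of_ne)

variable (p) in
/-- The transport map `toGalH1` as an additive homomorphism. [folklore] -/
def toGalH1Hom : subgroupH1 (⊤ : Subgroup (absoluteGaloisGroup K)) (W.geomPrimaryTorsion p) →+ W.galH1Primary p :=
  (toDiscreteH1 (isOpen_stabilizer_geomPrimaryTorsion W p)).toAddMonoidHom.comp
    (topEquivH1 (isOpen_stabilizer_geomPrimaryTorsion W p)).symm.toAddMonoidHom

omit [Fact p.Prime] [NumberField K] in
theorem toGalH1Hom_apply (c : subgroupH1 (⊤ : Subgroup (absoluteGaloisGroup K)) (W.geomPrimaryTorsion p)) :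
    toGalH1Hom p W c = toGalH1 p W c := rfl

variable (v : HeightOneSpectrum (𝓞 K))

variable (p) in
/-- **The Kummer-at-`v` classes** of the `⊤`-model `H¹(K, E[p^∞])`: those whose transport satisfies the Selmer local
condition at `v` (restriction to `K_v` comes from `E(K_v) ⊗ ℚ_p/ℤ_p`, i.e. dies in `H¹(K_v, E)`). [cite: GrossLMS1991, §2] -/
def kummerAt : AddSubgroup (subgroupH1 (⊤ : Subgroup (absoluteGaloisGroup K)) (W.geomPrimaryTorsion p)) :=
  (W.selmerLocalKerPrimary (v.adicCompletion K) p).comap (toGalH1Hom p W)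

variable (p) in
/-- **(B′-iv) finite Kummer index at `v`**: the classes of `Sel_Gr(K, E[p^∞])` satisfying the Kummer condition at `v` have
finite index in `Sel_Gr(K, E[p^∞])` (`AddSubgroup.index ≠ 0`). Implied by (B′-ii′) (strict at `v` ⟹ Kummer at `v`);
expected whenever rank `E(K) ≥ 1` via the finite-level relative Poitou–Tate count at `v` + `c` + a large Kummer image at
`v̄` (`KatoLine.md` §1h) — OPEN. [cite: MilneADT2006, I Thm. 4.10] [cite: arXiv:1405.7294, §2.3 Lemma 4 (p. 8)] -/
def BottomKummerFiniteIndexAt : Prop :=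
  ((kummerAt p W v).addSubgroupOf (bottomSelmer p W vbar)).index ≠ 0

omit [Fact p.Prime] in
/-- Transport of a `Sel_Gr`-class that is Kummer at `v` lands in the tree's `v̄`-strict Selmer group (as in
`toGalH1_mem_strictSelmer`, with the Kummer condition at `v` in place of strictness). [cite: Greenberg1999, §2] -/
theorem toGalH1_mem_strictSelmer_of_mem_kummerAt (hK : ∀ w : InfinitePlace K, w.IsComplex)
    (hSp : ∀ w : HeightOneSpectrum (𝓞 K), ((p : ℕ) : 𝓞 K) ∈ w.asIdeal → w = v ∨ w = vbar)
    (c : subgroupH1 (⊤ : Subgroup (absoluteGaloisGroup K)) (W.geomPrimaryTorsion p))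
    (hc : c ∈ bottomSelmer p W vbar) (hcv : c ∈ kummerAt p W v) :
    toGalH1 p W c ∈ W.selmerGroupPInfty p ⊓ selmerLocalKerPrimaryTorsion W (vbar.adicCompletion K) p := by
  obtain ⟨hA, hS⟩ := awayKer_and_strictKer_of_mem_bottomSelmer W vbar c hc
  refine AddSubgroup.mem_inf.2 ⟨?_, mem_selmerLocalKerPrimaryTorsion_of_resSubgroup_eq_zero W vbar _
    (resSubgroup_toGalH1_eq_zero_of_mem_strictKer W vbar c hS)⟩
  rw [WeierstrassCurve.selmerGroupPInfty, AddSubgroup.mem_inf, AddSubgroup.mem_iInf, AddSubgroup.mem_iInf]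
  refine ⟨fun w ↦ ?_, fun w ↦ mem_selmerLocalKerPrimary_completion_of_isComplex W (hK w) _⟩
  by_cases hw : ((p : ℕ) : 𝓞 K) ∈ w.asIdeal
  · rcases hSp w hw with rfl | rfl
    · exact AddSubgroup.mem_comap.1 hcv
    · exact mem_selmerLocalKerPrimary_of_resSubgroup_eq_zero W _ _ (resSubgroup_toGalH1_eq_zero_of_mem_strictKer W _ c hS)
  · exact mem_selmerLocalKerPrimary_of_resSubgroup_eq_zero W w _ (resSubgroup_toGalH1_eq_zero_of_mem_awayKer W w c (hA w hw))

omit [Fact p.Prime] in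
/-- The Kummer-at-`v` part of `Sel_Gr` is finite when the tree's `v̄`-strict Selmer group is. [folklore] -/
theorem finite_kummerAt_addSubgroupOf_bottomSelmer (hK : ∀ w : InfinitePlace K, w.IsComplex)
    (hSp : ∀ w : HeightOneSpectrum (𝓞 K), ((p : ℕ) : 𝓞 K) ∈ w.asIdeal → w = v ∨ w = vbar)
    (hfin : Finite ↥(W.selmerGroupPInfty p ⊓ selmerLocalKerPrimaryTorsion W (vbar.adicCompletion K) p)) :
    Finite ↥((kummerAt p W v).addSubgroupOf (bottomSelmer p W vbar)) := by
  refine Finite.of_injective (fun c ↦ (⟨toGalH1 p W (c : bottomSelmer p W vbar),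
    toGalH1_mem_strictSelmer_of_mem_kummerAt W vbar v hK hSp _ (c : bottomSelmer p W vbar).2
      (AddSubgroup.mem_addSubgroupOf.1 c.2)⟩ :
    ↥(W.selmerGroupPInfty p ⊓ selmerLocalKerPrimaryTorsion W (vbar.adicCompletion K) p))) ?_
  intro x y hxy
  apply Subtype.ext; apply Subtype.ext
  exact toGalH1_injective W (congrArg Subtype.val hxy)

omit [Fact p.Prime] in
/-- **(B′-iv) + finiteness of the `v̄`-strict Selmer group ⟹ (B′)** (`#S = [S : S ∩ Kummer_v] · #(S ∩ Kummer_v)`).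
[folklore] [cite: arXiv:1405.7294, §2.3 Lemma 4 (p. 8)] -/
theorem bottomSelmer_finite_of_kummerFiniteIndex (hK : ∀ w : InfinitePlace K, w.IsComplex)
    (hSp : ∀ w : HeightOneSpectrum (𝓞 K), ((p : ℕ) : 𝓞 K) ∈ w.asIdeal → w = v ∨ w = vbar)
    (hfin : Finite ↥(W.selmerGroupPInfty p ⊓ selmerLocalKerPrimaryTorsion W (vbar.adicCompletion K) p))
    (h4 : BottomKummerFiniteIndexAt p W vbar v) : (SetLike.coe (bottomSelmer p W vbar)).Finite := by
  haveI := finite_kummerAt_addSubgroupOf_bottomSelmer W vbar v hK hSp hfin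
  haveI : Finite ↥(bottomSelmer p W vbar) := by
    apply Nat.finite_of_card_ne_zero
    rw [← ((kummerAt p W v).addSubgroupOf (bottomSelmer p W vbar)).index_mul_card]
    exact mul_ne_zero h4 (Nat.card_pos (α := ↥((kummerAt p W v).addSubgroupOf (bottomSelmer p W vbar)))).ne'
  exact Set.toFinite _

omit [Fact p.Prime] in
/-- **(B′-ii′) ⟹ (B′-iv)**: strict at `v` ⟹ Kummer at `v`, and a finite image means finite index of the kernel part.
[folklore] -/
theorem bottomKummerFiniteIndexAt_of_bottomImageFiniteAt (h2 : BottomImageFiniteAt p W vbar v) :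
    BottomKummerFiniteIndexAt p W vbar v := by
  set f := (AcSelmer.strictDatum (W.geomPrimaryTorsion p) v).strictMap (⊤ : Subgroup (absoluteGaloisGroup K)) with hf
  -- the `v`-strict part of `Sel_Gr` has finite index (= the size of the image)
  have hker : (f.ker.addSubgroupOf (bottomSelmer p W vbar)).index ≠ 0 := by
    rw [← AddMonoidHom.ker_restrict, AddSubgroup.index_ker]
    haveI : Finite (f '' (SetLike.coe (bottomSelmer p W vbar))) := h2.to_subtype
    haveI : Finite (f.restrict (bottomSelmer p W vbar)).range := by
      have hmem : ∀ y : (f.restrict (bottomSelmer p W vbar)).range,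
          y.1 ∈ f '' (SetLike.coe (bottomSelmer p W vbar)) := fun y ↦ by
        obtain ⟨x, hx⟩ := y.2
        exact ⟨x, x.2, by rw [← hx, AddMonoidHom.restrict_apply]⟩
      refine Finite.of_injective (fun y ↦ (⟨y.1, hmem y⟩ : f '' (SetLike.coe (bottomSelmer p W vbar)))) ?_
      intro x y hxy
      apply Subtype.ext
      exact congrArg (fun z : f '' (SetLike.coe (bottomSelmer p W vbar)) ↦ z.1) hxy
    exact (Nat.card_pos (α := (f.restrict (bottomSelmer p W vbar)).range)).ne'
  -- strict at `v` ⟹ Kummer at `v`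
  have hle : f.ker.addSubgroupOf (bottomSelmer p W vbar) ≤ (kummerAt p W v).addSubgroupOf (bottomSelmer p W vbar) := by
    intro c hc
    rw [AddSubgroup.mem_addSubgroupOf] at hc ⊢
    have hcv : (c : subgroupH1 (⊤ : Subgroup (absoluteGaloisGroup K)) (W.geomPrimaryTorsion p)) ∈
        (AcSelmer.strictDatum (W.geomPrimaryTorsion p) v).strictKer ⊤ := hc
    exact AddSubgroup.mem_comap.2
      (mem_selmerLocalKerPrimary_of_resSubgroup_eq_zero W v _ (resSubgroup_toGalH1_eq_zero_of_mem_strictKer W v _ hcv))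
  intro h0
  exact hker (Nat.eq_zero_of_zero_dvd (h0 ▸ AddSubgroup.index_dvd_of_le hle))

/-- **(B′) in rank one from (B′-iv)**, for ANY elliptic curve over a quadratic field with complex infinite places and
`p = v v̄` split: rank `E(K) = 1`, `Ш(E/K)[p^∞]` finite and (B′-iv) ⟹ `Sel_Gr(K, E[p^∞])` finite.
[cite: arXiv:1405.7294, §2.2 Lemma 2, §2.3 Lemma 4 (p. 8)] [cite: Kolyvagin1990, Thm. A] -/
theorem bottomSelmer_finite_of_kummerFiniteIndex_of_mordellWeilRank_eq_one [W.IsElliptic]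
    (h2 : Module.finrank ℚ K = 2) (hK : ∀ w : InfinitePlace K, w.IsComplex)
    (hpv : ((p : ℕ) : 𝓞 K) ∈ v.asIdeal) (hpvbar : ((p : ℕ) : 𝓞 K) ∈ vbar.asIdeal) (hne : vbar ≠ v)
    (hrank : W.mordellWeilRank = 1) [Finite (AddCommGroup.primaryComponent W.sha p)]
    (h4 : BottomKummerFiniteIndexAt p W vbar v) : (SetLike.coe (bottomSelmer p W vbar)).Finite := by
  have hSp : ∀ w : HeightOneSpectrum (𝓞 K), ((p : ℕ) : 𝓞 K) ∈ w.asIdeal → w = v ∨ w = vbar :=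
    fun w hw ↦ eq_or_eq_of_natCast_mem_of_ne h2 hpv hpvbar hne hw
  have hsplit : ((Ideal.span {(p : ℤ)}).primesOver (𝓞 K)).ncard = 2 :=
    (ncard_primesOver_eq_two_and_deg_one_of_ne h2 hpv hpvbar hne).1
  exact bottomSelmer_finite_of_kummerFiniteIndex W vbar v hK hSp
    (finite_strictSelmer_adicCompletion_of_mordellWeilRank_eq_one_of_ncard_primesOver_eq_two W p h2 hsplit hrank
      vbar hpvbar) h4

/-- **Door 4's `hfix` in rank one from (A3″) + (B′-iv)** (20728's setting + rank `E(K) = 1 ∧ Ш(E/K)` finite, the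
Heegner-point facts' conclusion). No summit statement is proved. [cite: arXiv:2409.01350, Part II Prop. 3.1 (p. 78)]
[cite: Gross1991, Thm. 1.3] [cite: Kolyvagin1990, Thm. A] -/
theorem hfixBound_of_fixedPointExponent_of_kummerFiniteIndex (W₀ : WeierstrassCurve ℚ) [W₀.IsElliptic]
    (hp2 : p ≠ 2) (hρ : W₀.HasSurjectiveModNGaloisRep p) (hK : IsImaginaryQuadratic K)
    (hpv : ((p : ℕ) : 𝓞 K) ∈ v.asIdeal) (hpvbar : ((p : ℕ) : 𝓞 K) ∈ vbar.asIdeal) (hne : vbar ≠ v)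
    (hγ : ZpExtension.IsTopGeneratorPair κ₁ κ₂ γ₁ γ₂)
    (h3 : InertiaTowerFixedPointExponent (W₀.baseChange K) κ₁ κ₂ vbar)
    (hGZK : (W₀.baseChange K).mordellWeilRank = 1 ∧ (W₀.baseChange K).ShaFinite)
    (h4 : BottomKummerFiniteIndexAt p (W₀.baseChange K) vbar v) :
    ∃ k : ℕ, HfixBound (W₀.baseChange K) κ₁ κ₂ vbar γ₁ γ₂ k := by
  haveI : (W₀.baseChange K).IsElliptic := by rw [WeierstrassCurve.baseChange]; infer_instance
  haveI := hK.2
  haveI : Finite (W₀.baseChange K).sha := hGZK.2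
  exact hfixBound_of_fixedPointExponent_of_finite κ₁ κ₂ vbar γ₁ γ₂ W₀ hp2 hρ hK hpvbar hγ h3
    (bottomSelmer_finite_of_kummerFiniteIndex_of_mordellWeilRank_eq_one (W₀.baseChange K) vbar v hK.1
      IsTotallyComplex.isComplex hpv hpvbar hne hGZK.1 h4)

/-- … and at a split SUPERSINGULAR `p`: `hfix` ⇐ (B′-iv) + `rank E(K) = 1 ∧ Ш(E/K)` finite — (B′-iv) is then the ONLY
open arithmetic input of door (7-bot). No summit statement is proved. [cite: Serre1972, §1.11 Prop. 12 c)]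
[cite: MilneADT2006, I Thm. 4.10] [cite: Gross1991, Thm. 1.3] -/
theorem hfixBound_of_kummerFiniteIndex_supersingular (W₀ : WeierstrassCurve ℚ) [W₀.IsElliptic]
    [W₀.IsGloballyMinimal] (hp2 : p ≠ 2) (hgood : W₀.HasGoodReductionAtPrime p) (hss : (p : ℤ) ∣ W₀.frobeniusTrace p)
    (hρ : W₀.HasSurjectiveModNGaloisRep p) (hK : IsImaginaryQuadratic K)
    (hpv : ((p : ℕ) : 𝓞 K) ∈ v.asIdeal) (hpvbar : ((p : ℕ) : 𝓞 K) ∈ vbar.asIdeal) (hne : vbar ≠ v)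
    (hγ : ZpExtension.IsTopGeneratorPair κ₁ κ₂ γ₁ γ₂)
    (hGZK : (W₀.baseChange K).mordellWeilRank = 1 ∧ (W₀.baseChange K).ShaFinite)
    (h4 : BottomKummerFiniteIndexAt p (W₀.baseChange K) vbar v) :
    ∃ k : ℕ, HfixBound (W₀.baseChange K) κ₁ κ₂ vbar γ₁ γ₂ k :=
  hfixBound_of_fixedPointExponent_of_kummerFiniteIndex κ₁ κ₂ vbar γ₁ γ₂ v W₀ hp2 hρ hK hpv hpvbar hne hγ
    (inertiaTowerFixedPointExponent_baseChange_of_dvd_frobeniusTrace κ₁ κ₂ vbar W₀ hp2 hgood hss hK hpv hpvbar hne)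
    hGZK h4

omit [Fact p.Prime] in
/-- **(B′-iv) from a LEVELWISE bound along a monotone cover of `Sel_Gr`** (the limit step 5 of `KatoLine.md` §1h, PROVED):
it remains to bound `[Sel_Gr ∩ T_k : Sel_Gr ∩ T_k ∩ Kummer_v] ≤ C` level by level. [folklore] [cite: Rubin2000, Thm. 1.7.3] -/
theorem bottomKummerFiniteIndexAt_of_levelwise_bound
    (T : ℕ → AddSubgroup (subgroupH1 (⊤ : Subgroup (absoluteGaloisGroup K)) (W.geomPrimaryTorsion p)))
    (hT : Monotone T) (hcov : ∀ x ∈ bottomSelmer p W vbar, ∃ k, x ∈ T k) (C : ℕ)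
    (hC : ∀ k, 0 < (kummerAt p W v).relIndex (bottomSelmer p W vbar ⊓ T k) ∧
      (kummerAt p W v).relIndex (bottomSelmer p W vbar ⊓ T k) ≤ C) :
    BottomKummerFiniteIndexAt p W vbar v :=
  (AddSubgroup.relIndex_pos_and_le_of_monotone_cover (kummerAt p W v) (bottomSelmer p W vbar) T hT hcov C hC).1.ne'

omit [Fact p.Prime] in
/-- **(B′-iv) from a bound on the `p^k`-torsion levels** `Sel_Gr[p^k] = Sel_Gr ∩ H¹(K, E[p^∞])[p^k]` (the image of the
finite-level group `H¹_{𝓖_k}(K, E[p^k])` of `KatoLine.md` §1h step 1): if `0 < [Sel_Gr[p^k] : Sel_Gr[p^k] ∩ Kummer_v] ≤ C`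
for every `k` then (B′-iv). The cover is automatic (`exists_pow_smul_eq_zero_top`). What is left OPEN is exactly the
levelwise relative Poitou–Tate squeeze (§1h steps 2–4). [folklore] [cite: MilneADT2006, I Thm. 4.10]
[cite: Rubin2000, Thm. 1.7.3] -/
theorem bottomKummerFiniteIndexAt_of_torsionLevel_bound (C : ℕ)
    (hC : ∀ k : ℕ, 0 < (kummerAt p W v).relIndex (bottomSelmer p W vbar ⊓ AddSubgroup.torsionBy _ ((p ^ k : ℕ) : ℤ)) ∧
      (kummerAt p W v).relIndex (bottomSelmer p W vbar ⊓ AddSubgroup.torsionBy _ ((p ^ k : ℕ) : ℤ)) ≤ C) :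
    BottomKummerFiniteIndexAt p W vbar v := by
  refine bottomKummerFiniteIndexAt_of_levelwise_bound W vbar v (fun k ↦ AddSubgroup.torsionBy _ ((p ^ k : ℕ) : ℤ))
    ?_ ?_ C hC
  · intro k l hkl x hx
    rw [AddSubgroup.torsionBy.nsmul_iff] at hx ⊢
    obtain ⟨d, rfl⟩ := Nat.exists_eq_add_of_le hkl
    rw [pow_add, mul_comm, mul_smul, hx, smul_zero]
  · intro x _
    obtain ⟨k, hk⟩ := exists_pow_smul_eq_zero_top W x
    exact ⟨k, AddSubgroup.torsionBy.nsmul_iff.2 hk⟩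

/-! ### (v1.9) Positivity of the levelwise index is automatic from the single finiteness `Finite Sel_Gr[p]` -/

omit [Fact p.Prime] in
/-- Pure group theory: for `B ≤ A` and `n : ℤ`, if `B ⊓ A[n]` is finite then so is `B ⊓ A[n ^ k]` for every `k`
(`#B[ab] ≤ #B[a] · #B[b]`, the tree's `finite_torsionBy_mul`, transported along `↥B ↪ A`). [folklore]
[cite: Serre1972, §1.11 Prop. 12 c)] -/
theorem finite_inf_torsionBy_pow_of_finite_inf_torsionBy {A : Type} [AddCommGroup A] (B : AddSubgroup A) (n : ℤ)
    (hfin : Finite ↥(B ⊓ AddSubgroup.torsionBy A n)) (k : ℕ) :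
    Finite ↥(B ⊓ AddSubgroup.torsionBy A (n ^ k)) := by
  -- membership transport between `(↥B)[m]` and `B ⊓ A[m]`
  have hmem : ∀ (m : ℤ) (x : ↥B), x ∈ AddSubgroup.torsionBy (↥B) m ↔ (x : A) ∈ AddSubgroup.torsionBy A m := by
    intro m x
    rw [mem_torsionBy_iff, mem_torsionBy_iff, ← AddSubgroup.coe_zsmul]
    exact ⟨fun h ↦ by rw [h, AddSubgroup.coe_zero], fun h ↦ Subtype.ext (by rw [h, AddSubgroup.coe_zero])⟩
  -- `(↥B)[m]` finite ⟹ `B ⊓ A[m]` finite, and conversely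
  have hdown : ∀ m : ℤ, Finite ↥(AddSubgroup.torsionBy (↥B) m) → Finite ↥(B ⊓ AddSubgroup.torsionBy A m) := by
    intro m hm
    refine Finite.of_injective (fun x : ↥(B ⊓ AddSubgroup.torsionBy A m) ↦
      (⟨⟨x.1, (AddSubgroup.mem_inf.mp x.2).1⟩, (hmem m _).2 (AddSubgroup.mem_inf.mp x.2).2⟩ :
        ↥(AddSubgroup.torsionBy (↥B) m))) ?_
    intro x y hxy
    have h := congrArg (fun z : ↥(AddSubgroup.torsionBy (↥B) m) ↦ ((z : ↥B) : A)) hxy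
    exact Subtype.ext h
  have hup : Finite ↥(AddSubgroup.torsionBy (↥B) n) := by
    refine Finite.of_injective (fun x : ↥(AddSubgroup.torsionBy (↥B) n) ↦
      (⟨((x : ↥B) : A), AddSubgroup.mem_inf.mpr ⟨(x : ↥B).2, (hmem n _).1 x.2⟩⟩ :
        ↥(B ⊓ AddSubgroup.torsionBy A n))) ?_
    intro x y hxy
    have h := congrArg (fun z : ↥(B ⊓ AddSubgroup.torsionBy A n) ↦ (z : A)) hxy
    exact Subtype.ext (Subtype.ext h)
  refine hdown (n ^ k) ?_
  induction k with
  | zero => rw [pow_zero]; exact finite_torsionBy_one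
  | succ k ih => rw [pow_succ]; exact finite_torsionBy_mul ih hup

omit [Fact p.Prime] in
/-- **(B′-iv) from `Finite Sel_Gr[p]` and the uniform UPPER bound alone** (v1.9): the positivity half of the hypothesis of
`bottomKummerFiniteIndexAt_of_torsionLevel_bound` is automatic once `Sel_Gr[p] := Sel_Gr ⊓ H¹(K, E[p^∞])[p]` is finite — then
every `Sel_Gr[p^k]` is (`finite_inf_torsionBy_pow_of_finite_inf_torsionBy`), so every levelwise relative index is positive.
`Finite Sel_Gr[p]` is ONE finite-level statement (lift `p`-torsion classes to `H¹(K, E[p])` by the tree's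
`exists_torsionToPrimaryH1_eq`, land in a Selmer-type subgroup unramified outside `S ∪ {v}`, finite by the fact
`finite_h1Unramified`); it and the levelwise UPPER bound (`KatoLine.md` §1h steps 2–4) are what is left OPEN of (B′).
[folklore] [cite: MilneADT2006, I Thm. 4.10] [cite: Rubin2000, Thm. 1.7.3] -/
theorem bottomKummerFiniteIndexAt_of_finite_torsion_of_levelwise_le
    (hfin : Finite ↥(bottomSelmer p W vbar ⊓ AddSubgroup.torsionBy _ (p : ℤ))) (C : ℕ)
    (hC : ∀ k : ℕ, (kummerAt p W v).relIndex (bottomSelmer p W vbar ⊓ AddSubgroup.torsionBy _ ((p ^ k : ℕ) : ℤ)) ≤ C) :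
    BottomKummerFiniteIndexAt p W vbar v := by
  refine bottomKummerFiniteIndexAt_of_torsionLevel_bound W vbar v C fun k ↦ ⟨?_, hC k⟩
  haveI : Finite ↥(bottomSelmer p W vbar ⊓ AddSubgroup.torsionBy _ ((p ^ k : ℕ) : ℤ)) := by
    rw [Nat.cast_pow]
    exact finite_inf_torsionBy_pow_of_finite_inf_torsionBy _ (p : ℤ) hfin k
  exact Nat.pos_of_ne_zero AddSubgroup.index_ne_zero_of_finite

end KummerIndex

/-! ## (v1.10) `Finite Sel_Gr[p]` — (B′-v) PROVED; (B′-iv) ⟸ the levelwise UPPER bound alone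

For ANY elliptic curve `E` over ANY number field `K`, any prime `p` and any finite place `v̄`, the `p`-torsion of
`Sel_Gr(K, E[p^∞]) = bottomSelmer p E v̄` is finite. Printed shape: Greenberg, LNM 1716 §1 p. 60 (finiteness of
`H¹(K_Σ/K, E[p])`, Silverman X.4.3, through the Kummer lift `H¹(K, E[p]) ↠ H¹(K, E[p^∞])[p]`); here the local conditions of
`Sel_Gr` away from `p` (locally TRIVIAL at every finite `w ∤ p`) make every lift unramified outside `{bad} ∪ {w ∣ p}` directly.
[cite: GreenbergLNM1716, §1 p. 60; §5 p. 114 (proof of Prop. 5.8)] [cite: SilvermanAEC2009, Lemma X.4.3, Prop. VII.4.1(a)]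
[cite: NeukirchANT1999, Ch. II §9 Prop. (9.6)] -/

section TorsionLevelFinite

open scoped Classical

open Summit.BirchSwinnertonDyer.Rank1Residual.X11b.LocBridge (toDiscreteH1 topEquivH1 isOpen_stabilizer_geomPrimaryTorsion
  resSubgroup_oneCocycleClass_eq_zero_iff topEquivH1_mem_awayKer_iff topEquivH1_mem_strictKer_strictDatum_iff)
open Summit.BirchSwinnertonDyer.BirchSwinnertonDyer.Theorems.GreenbergFullAtSelmer (eq_or_eq_of_natCast_mem_of_ne
  ncard_primesOver_eq_two_and_deg_one_of_ne)

omit [Fact p.Prime] in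
/-- **`I_w = I_{𝔓₀}`**: the tree's inertia group at `w` for the chosen embedding (`GreenbergSelmer.inertia w`, image of the
local inertia group) is the inertia group of the prime `𝔓₀ = adicCompletionPrime K w` of `\bar ℤ_K` that embedding cuts out
(both are `res(I_{K_w})`, Neukirch II (9.6); the Theorems-side twin is `IwasawaTwoVariable.greenbergSelmer_inertia_eq`, restated
so that this workfile does not depend on that module). [cite: NeukirchANT1999, Ch. II §9 Prop. (9.6)] -/
theorem inertia_eq_inertia_adicCompletionPrime (w : HeightOneSpectrum (𝓞 K)) :
    GreenbergSelmer.inertia w = (adicCompletionPrime K w).inertia (absoluteGaloisGroup K) := by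
  rw [GreenbergSelmer.inertia, inertia_adicCompletionPrime_eq_map_absInertia]

variable (p) in
/-- The exceptional set `S = {bad places of E} ∪ {w ∣ p}` outside which `Sel_Gr`-classes are unramified.
[cite: SilvermanAEC2009, Thm. X.4.2(b) (proof), Cor. X.4.4] -/
def ramSet : Set (HeightOneSpectrum (𝓞 K)) :=
  W.badPlaces (𝓞 K) ∪ {w | ((p : ℤ) : 𝓞 K) ∈ w.asIdeal}

/-- `S = {bad} ∪ {w ∣ p}` is finite (tree `finite_badPlaces_holds`, `finite_setOf_intCast_mem_asIdeal`).
[cite: SilvermanAEC2009, VII.§5 (remark before Prop. 5.1), VIII.§1] -/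
theorem ramSet_finite [W.IsElliptic] : (ramSet p W).Finite :=
  (W.finite_badPlaces_holds (𝓞 K)).union
    (WeierstrassCurve.finite_setOf_intCast_mem_asIdeal (K := K) (n := (p : ℤ))
      (by exact_mod_cast (Fact.out : p.Prime).ne_zero))

omit [Fact p.Prime] in
/-- **Every Kummer lift of a transported `Sel_Gr`-class is unramified outside `S = {bad} ∪ {w ∣ p}`.** If
`x ∈ H¹(⊤, E[p^∞])` is locally trivial at every finite `w ∤ p` (`awayKer`) and `y ∈ H¹(K, E[p])` maps to `toGalH1 x` under
`H¹(K, E[p]) → H¹(K, E[p^∞])`, then `y ∈ H¹(G_{K̄/K}, E[p]; S)`: at a good `w ∤ p`, `toGalH1 x` dies on `D_w ⊇ I_w = I_{𝔓₀}`, so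
`y|_{I_{𝔓₀}}` composed with `E[p] ↪ E[p^∞]` is the coboundary of a `p`-power torsion point `a`; `I_{𝔓₀}` fixes `a`
(Silverman VII.4.1(a)), so `y` VANISHES on `I_{𝔓₀}`, and unramifiedness at the other primes above `w` follows from
`unramifiedKer_eq_of_mem_primesAbove`. [cite: SilvermanAEC2009, Prop. VII.4.1(a), VIII.§2 Definition p. 191, Remark X.4.1.1]
[cite: GreenbergLNM1716, §5 p. 114] [cite: NeukirchANT1999, Ch. II §9 Prop. (9.6)] -/
theorem mem_h1Unramified_of_torsionToPrimaryH1_eq [W.IsElliptic]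
    (x : subgroupH1 (⊤ : Subgroup (absoluteGaloisGroup K)) (W.geomPrimaryTorsion p))
    (hx : ∀ w : HeightOneSpectrum (𝓞 K), ((p : ℕ) : 𝓞 K) ∉ w.asIdeal →
      x ∈ GreenbergSelmer.awayKer ⊤ (W.geomPrimaryTorsion p) w)
    {y : W.galH1Torsion (p : ℤ)} (hy : W.torsionToPrimaryH1 p y = toGalH1 p W x) :
    y ∈ h1Unramified (W.geomTorsion (p : ℤ)) (ramSet p W) := by
  rw [mem_h1Unramified_iff]
  intro w hwS 𝔓 h𝔓
  have hgood : W.HasGoodReductionAt w := by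
    by_contra h
    exact hwS (Or.inl h)
  have hn : ((p : ℤ) : 𝓞 K) ∉ w.asIdeal := fun h ↦ hwS (Or.inr h)
  have hpw : ((p : ℕ) : 𝓞 K) ∉ w.asIdeal := by
    rwa [Int.cast_natCast] at hn
  rw [W.unramifiedKer_eq_of_mem_primesAbove hgood hn h𝔓 (adicCompletionPrime_mem_primesAbove K w)]
  obtain ⟨φ, rfl⟩ := oneCocycleClass_surjective _ y
  rw [unramifiedKer, oneCocycleClass_mem_subgroupResKer_iff]
  refine ⟨0, fun τ ↦ ?_⟩
  rw [smul_zero, sub_zero]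
  -- `toGalH1 x` dies on `D_w`: its cocycle `E[p] ↪ E[p^∞] ∘ φ` is principal there
  have h0 := resSubgroup_toGalH1_eq_zero_of_mem_awayKer W w x (hx w hpw)
  rw [← hy, WeierstrassCurve.torsionToPrimaryH1_oneCocycleClass, resSubgroup_oneCocycleClass_eq_zero_iff] at h0
  obtain ⟨a, ha⟩ := h0
  have hτI : (τ : absoluteGaloisGroup K) ∈ GreenbergSelmer.inertia w := by
    rw [inertia_eq_inertia_adicCompletionPrime]
    exact τ.2
  have e := ha τ (GreenbergSelmer.inertia_le_decomp w hτI)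
  rw [contOneCocycles.push_apply] at e
  -- `I_{𝔓₀}` fixes the `p`-power torsion point `a` (good reduction at `w ∤ p`)
  obtain ⟨k, hk⟩ := a.2
  have hfix : (τ : absoluteGaloisGroup K) • a = a := by
    apply Subtype.ext
    rw [Literature.NumberTheory.EllipticCurves.primaryComponent.coe_smul]
    refine W.smul_eq_of_mem_inertia_of_nsmul_eq_zero hgood (n := p ^ k) ?_
      (adicCompletionPrime_mem_primesAbove K w) τ.2 hk
    rw [Nat.cast_pow]
    exact fun h ↦ hpw (w.isPrime.mem_of_pow_mem k h)
  rw [hfix, sub_self] at e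
  exact AddSubgroup.inclusion_injective _ (by rw [e, map_zero])

/-- **(B′-v) `Finite Sel_Gr[p]` — PROVED** for every elliptic curve over every number field, every prime `p` and every `v̄`:
the `p`-torsion classes of `Sel_Gr(K, E[p^∞])` inject (`toGalH1`, then ANY Kummer lift, `exists_torsionToPrimaryH1_eq`) into the
finite group `H¹(G_{K̄/K}, E[p]; {bad} ∪ {w ∣ p})` (Silverman X.4.3, tree `finite_h1Unramified_holds`) — two classes with the same
lift have the same transport. [cite: GreenbergLNM1716, §1 p. 60] [cite: SilvermanAEC2009, Lemma X.4.3] -/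
theorem finite_bottomSelmer_inf_torsionBy [W.IsElliptic] :
    Finite ↥(bottomSelmer p W vbar ⊓ AddSubgroup.torsionBy _ (p : ℤ)) := by
  haveI : ContinuousSMul (absoluteGaloisGroup K) (W.geomTorsion (p : ℤ)) :=
    W.continuousSMul_geomTorsion (WeierstrassCurve.isOpen_stabilizer_point_holds W) (p : ℤ)
  haveI : Finite (W.geomTorsion (p : ℤ)) :=
    W.finite_torsionPoints_holds (AlgebraicClosure K) (by exact_mod_cast (Fact.out : p.Prime).ne_zero)
  haveI : Finite ↥(h1Unramified (W.geomTorsion (p : ℤ)) (ramSet p W)) :=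
    finite_h1Unramified_holds K (W.geomTorsion (p : ℤ)) (ramSet_finite W)
  -- every class of `Sel_Gr[p]` has a Kummer lift in `H¹(K, E[p]; S)`
  have hlift : ∀ x : ↥(bottomSelmer p W vbar ⊓ AddSubgroup.torsionBy _ (p : ℤ)),
      ∃ y : ↥(h1Unramified (W.geomTorsion (p : ℤ)) (ramSet p W)),
        W.torsionToPrimaryH1 p (y : W.galH1Torsion (p : ℤ)) =
          toGalH1 p W (x : subgroupH1 (⊤ : Subgroup (absoluteGaloisGroup K)) (W.geomPrimaryTorsion p)) := by
    intro x
    obtain ⟨hxB, hxT⟩ := AddSubgroup.mem_inf.mp x.2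
    have hpx : p • toGalH1Hom p W x = 0 := by
      rw [← map_nsmul, AddSubgroup.torsionBy.nsmul_iff.mp hxT, map_zero]
    obtain ⟨y, hy⟩ := W.exists_torsionToPrimaryH1_eq p (WeierstrassCurve.zsmul_geomPoints_surjective_holds W) hpx
    rw [toGalH1Hom_apply] at hy
    exact ⟨⟨y, mem_h1Unramified_of_torsionToPrimaryH1_eq W _ (awayKer_and_strictKer_of_mem_bottomSelmer W vbar _ hxB).1 hy⟩,
      hy⟩
  choose f hf using hlift
  refine Finite.of_injective f fun x₁ x₂ h ↦ ?_
  have e : toGalH1 p W x₁ = toGalH1 p W x₂ := by rw [← hf x₁, ← hf x₂, h]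
  exact Subtype.ext (toGalH1_injective W e)

variable (v : HeightOneSpectrum (𝓞 K))

/-- **(B′-iv) ⟸ the uniform levelwise UPPER bound ALONE** (v1.10 = v1.9 with (B′-v) discharged): if
`[Sel_Gr[p^k] : Sel_Gr[p^k] ∩ Kummer_v] ≤ C` for every `k`, then the Kummer-at-`v` classes have finite index in `Sel_Gr`.
[folklore] [cite: MilneADT2006, I Thm. 4.10] [cite: Rubin2000, Thm. 1.7.3] -/
theorem bottomKummerFiniteIndexAt_of_levelwise_le [W.IsElliptic] (C : ℕ)
    (hC : ∀ k : ℕ, (kummerAt p W v).relIndex (bottomSelmer p W vbar ⊓ AddSubgroup.torsionBy _ ((p ^ k : ℕ) : ℤ)) ≤ C) :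
    BottomKummerFiniteIndexAt p W vbar v :=
  bottomKummerFiniteIndexAt_of_finite_torsion_of_levelwise_le W vbar v (finite_bottomSelmer_inf_torsionBy W vbar) C hC

/-- **(B′) in rank one ⟸ the levelwise bound**: ANY elliptic curve over a quadratic `K` with complex infinite places, `p = v v̄`
split, rank `E(K) = 1`, `Ш(E/K)[p^∞]` finite. [cite: arXiv:1405.7294, §2.2 Lemma 2, §2.3 Lemma 4 (p. 8)] [cite: Kolyvagin1990, Thm. A] -/
theorem bottomSelmer_finite_of_levelwise_le_of_mordellWeilRank_eq_one [W.IsElliptic]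
    (h2 : Module.finrank ℚ K = 2) (hK : ∀ w : InfinitePlace K, w.IsComplex)
    (hpv : ((p : ℕ) : 𝓞 K) ∈ v.asIdeal) (hpvbar : ((p : ℕ) : 𝓞 K) ∈ vbar.asIdeal) (hne : vbar ≠ v)
    (hrank : W.mordellWeilRank = 1) [Finite (AddCommGroup.primaryComponent W.sha p)] (C : ℕ)
    (hC : ∀ k : ℕ, (kummerAt p W v).relIndex (bottomSelmer p W vbar ⊓ AddSubgroup.torsionBy _ ((p ^ k : ℕ) : ℤ)) ≤ C) :
    (SetLike.coe (bottomSelmer p W vbar)).Finite :=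
  bottomSelmer_finite_of_kummerFiniteIndex_of_mordellWeilRank_eq_one W vbar v h2 hK hpv hpvbar hne hrank
    (bottomKummerFiniteIndexAt_of_levelwise_le W vbar v C hC)

/-- **Door 4's `hfix` in rank one from (A3″) + the levelwise bound** (20728's setting + the Heegner-point facts' conclusion).
No summit statement is proved. [cite: arXiv:2409.01350, Part II Prop. 3.1 (p. 78)] [cite: Gross1991, Thm. 1.3]
[cite: Kolyvagin1990, Thm. A] -/
theorem hfixBound_of_fixedPointExponent_of_levelwise_le (W₀ : WeierstrassCurve ℚ) [W₀.IsElliptic]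
    (hp2 : p ≠ 2) (hρ : W₀.HasSurjectiveModNGaloisRep p) (hK : IsImaginaryQuadratic K)
    (hpv : ((p : ℕ) : 𝓞 K) ∈ v.asIdeal) (hpvbar : ((p : ℕ) : 𝓞 K) ∈ vbar.asIdeal) (hne : vbar ≠ v)
    (hγ : ZpExtension.IsTopGeneratorPair κ₁ κ₂ γ₁ γ₂)
    (h3 : InertiaTowerFixedPointExponent (W₀.baseChange K) κ₁ κ₂ vbar)
    (hGZK : (W₀.baseChange K).mordellWeilRank = 1 ∧ (W₀.baseChange K).ShaFinite) (C : ℕ)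
    (hC : ∀ k : ℕ, (kummerAt p (W₀.baseChange K) v).relIndex
      (bottomSelmer p (W₀.baseChange K) vbar ⊓ AddSubgroup.torsionBy _ ((p ^ k : ℕ) : ℤ)) ≤ C) :
    ∃ k : ℕ, HfixBound (W₀.baseChange K) κ₁ κ₂ vbar γ₁ γ₂ k := by
  haveI : (W₀.baseChange K).IsElliptic := by rw [WeierstrassCurve.baseChange]; infer_instance
  exact hfixBound_of_fixedPointExponent_of_kummerFiniteIndex κ₁ κ₂ vbar γ₁ γ₂ v W₀ hp2 hρ hK hpv hpvbar hne hγ h3 hGZK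
    (bottomKummerFiniteIndexAt_of_levelwise_le (W₀.baseChange K) vbar v C hC)

/-- … and at a split SUPERSINGULAR `p` of analytic rank one over `K`: **door (7-bot)'s `hfix` ⟸ the levelwise bound
`[Sel_Gr[p^k] : Sel_Gr[p^k] ∩ Kummer_v] ≤ C` ALONE** — the single remaining arithmetic input of this supply line there.
No summit statement is proved. [cite: Serre1972, §1.11 Prop. 12 c)] [cite: MilneADT2006, I Thm. 4.10] [cite: Gross1991, Thm. 1.3] -/
theorem hfixBound_of_levelwise_le_supersingular (W₀ : WeierstrassCurve ℚ) [W₀.IsElliptic]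
    [W₀.IsGloballyMinimal] (hp2 : p ≠ 2) (hgood : W₀.HasGoodReductionAtPrime p) (hss : (p : ℤ) ∣ W₀.frobeniusTrace p)
    (hρ : W₀.HasSurjectiveModNGaloisRep p) (hK : IsImaginaryQuadratic K)
    (hpv : ((p : ℕ) : 𝓞 K) ∈ v.asIdeal) (hpvbar : ((p : ℕ) : 𝓞 K) ∈ vbar.asIdeal) (hne : vbar ≠ v)
    (hγ : ZpExtension.IsTopGeneratorPair κ₁ κ₂ γ₁ γ₂)
    (hGZK : (W₀.baseChange K).mordellWeilRank = 1 ∧ (W₀.baseChange K).ShaFinite) (C : ℕ)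
    (hC : ∀ k : ℕ, (kummerAt p (W₀.baseChange K) v).relIndex
      (bottomSelmer p (W₀.baseChange K) vbar ⊓ AddSubgroup.torsionBy _ ((p ^ k : ℕ) : ℤ)) ≤ C) :
    ∃ k : ℕ, HfixBound (W₀.baseChange K) κ₁ κ₂ vbar γ₁ γ₂ k :=
  hfixBound_of_fixedPointExponent_of_levelwise_le κ₁ κ₂ vbar γ₁ γ₂ v W₀ hp2 hρ hK hpv hpvbar hne hγ
    (inertiaTowerFixedPointExponent_baseChange_of_dvd_frobeniusTrace κ₁ κ₂ vbar W₀ hp2 hgood hss hK hpv hpvbar hne)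
    hGZK C hC

/-! ### The levelwise bound as a bound on the IMAGE of `Sel_Gr[p^k]` in `H¹(K_v, E(K̄_v))` -/

variable (p) in
/-- **The localisation `H¹(K, E[p^∞]) → H¹(F, E(K̄_F))`** at a `K`-field `F` (a completion `K_v`), along the compatible pair
`(resGal F, pointsMap ∘ (E[p^∞] ↪ E(K̄)))`; its kernel is the tree's Selmer local condition `selmerLocalKerPrimary`
(`selmerLocalKerPrimary_eq_ker_locE`, definitional). [cite: Greenberg1999, §2] [cite: MilneADT2006, I §6] -/
def locE (F : Type) [Field F] [Algebra K F] : W.galH1Primary p →+ discreteH1 (absoluteGaloisGroup F) (localPoints W F) :=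
  resH1Hom (resGal (K := K) F) ((pointsMap W F).comp (W.geomPrimaryTorsion p).subtype) fun σ P ↦ by
    simp only [AddMonoidHom.coe_comp, AddSubgroup.coe_subtype, Function.comp_apply,
      Literature.NumberTheory.EllipticCurves.primaryComponent.coe_smul]
    exact pointsMap_smul W F σ P

omit [Fact p.Prime] [NumberField K] in
/-- The Selmer local condition at `F` is the kernel of `locE` (definitional, tree `resKer_eq_ker`). [folklore] -/
theorem selmerLocalKerPrimary_eq_ker_locE (F : Type) [Field F] [Algebra K F] :
    W.selmerLocalKerPrimary F p = (locE p W F).ker :=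
  rfl

omit [Fact p.Prime] in
/-- `Kummer_v = ker (locE_v ∘ toGalH1)` in the `⊤`-model. [folklore] -/
theorem kummerAt_eq_ker : kummerAt p W v = ((locE p W (v.adicCompletion K)).comp (toGalH1Hom p W)).ker :=
  rfl

omit [Fact p.Prime] in
/-- **Index of a kernel = size of the image**: `[B : B ∩ Kummer_v] = #(locE_v ∘ toGalH1)(B)` for every subgroup `B` of the
`⊤`-model (Mathlib `AddSubgroup.relIndex_ker`). [folklore] -/
theorem relIndex_kummerAt_eq_ncard_image
    (B : AddSubgroup (subgroupH1 (⊤ : Subgroup (absoluteGaloisGroup K)) (W.geomPrimaryTorsion p))) :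
    (kummerAt p W v).relIndex B = Nat.card (B.map ((locE p W (v.adicCompletion K)).comp (toGalH1Hom p W))) := by
  rw [kummerAt_eq_ker, AddSubgroup.relIndex_ker]

/-- **(B′-iv) ⟸ a uniform bound on the size of the image of `Sel_Gr[p^k]` in `H¹(K_v, E(K̄_v))`** — the form in which the
reciprocity argument (`KatoLine.md` §1i: Poitou–Tate vanishing + Kummer isotropy + local Tate duality at `v` + a point of infinite
order) delivers the levelwise bound. [folklore] [cite: MilneADT2006, I Thm. 4.10(b), I Cor. 3.4] -/
theorem bottomKummerFiniteIndexAt_of_image_card_le [W.IsElliptic] (C : ℕ)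
    (hC : ∀ k : ℕ, Nat.card ((bottomSelmer p W vbar ⊓ AddSubgroup.torsionBy _ ((p ^ k : ℕ) : ℤ)).map
      ((locE p W (v.adicCompletion K)).comp (toGalH1Hom p W))) ≤ C) :
    BottomKummerFiniteIndexAt p W vbar v :=
  bottomKummerFiniteIndexAt_of_levelwise_le W vbar v C fun k ↦ by
    rw [relIndex_kummerAt_eq_ncard_image]
    exact hC k

end TorsionLevelFinite

/-! ## (v1.11) The levelwise image bound in rank one at a split `p` — (B′-iv), (B′) and door (7-bot)'s `hfix` PROVED

KatoLine.md §1i (steps (L1)–(L5) with tree decl names). For `E` elliptic over a quadratic `K` with complex infinite places,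
`p = v v̄` split and rank `E(K) = 1`: `#(image of Sel_Gr[p^k] in H¹(K_v, E)) ≤ t·p^a` uniformly in `k`
(`exists_image_card_le_of_mordellWeilRank_eq_one`): lift to `H¹(K, E[p^{k+1}])` (tree `exists_torsionToPrimaryHom`), land in
`kummerOutside E p^{k+1} {v}` (`lift_mem_kummerOutside`), bound the index over `Sel^{(p^{k+1})}(E/K) ⊆ ker loc_v` by the tree's
`exists_relIndex_selmerGroup_kummerOutside_mul_pow_le` (Poitou–Tate reciprocity + local Euler characteristic + the Kummer class of a
point of infinite order at the degree-one place `v`), and count `#(𝓞_v/p^k) = p^k`, `#E(K_v)[n] ≤ t`. Hence (B′-iv)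
`bottomKummerFiniteIndexAt_of_mordellWeilRank_eq_one`, (B′) `bottomSelmer_finite_of_mordellWeilRank_eq_one` (+ `Ш[p^∞]` finite) and
`hfixBound_supersingular_of_HGZ`. No summit statement is proved. [cite: MilneADT2006, I Thm. 4.10, I §6 (6.14)]
[cite: JetchevSkinnerWan2017, Prop. 3.2.1] [cite: SilvermanAEC2009, Prop. VII.6.3, X.§4] [cite: GreenbergLNM1716, §5 p. 114]
[cite: arXiv:1405.7294, §2.3 Lemma 4 (p. 8)] -/

section LevelwiseImage

open scoped Classical

open Summit.BirchSwinnertonDyer.Rank1Residual.X11b.LocBridge (toDiscreteH1 topEquivH1 isOpen_stabilizer_geomPrimaryTorsion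
  resSubgroup_oneCocycleClass_eq_zero_iff topEquivH1_mem_awayKer_iff topEquivH1_mem_strictKer_strictDatum_iff)
open Summit.BirchSwinnertonDyer.BirchSwinnertonDyer.Theorems.GreenbergFullAtSelmer (eq_or_eq_of_natCast_mem_of_ne
  ncard_primesOver_eq_two_and_deg_one_of_ne)
open Summit.BirchSwinnertonDyer.BirchSwinnertonDyer.Theorems.CongruentShaFreeCutSelmerRelaxationUniform
  (exists_relIndex_selmerGroup_kummerOutside_mul_pow_le)
open Summit.BirchSwinnertonDyer.Rank1Residual.GaloisImage (exists_natCard_ker_nsmul_adicCompletion_le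
  natCard_quotient_span_singleton_mul')

variable (v : HeightOneSpectrum (𝓞 K))

omit [Fact p.Prime] [NumberField K] in
/-- `locE_F = loc_F ∘ (H¹(K, E[p^∞]) → H¹(K, E))` (functoriality, Mathlib `ContinuousCohomology.map_comp`).
[cite: SerreGaloisCohomology1997, I.§2.4] -/
theorem locE_eq_localRestrictionHom_comp (F : Type) [Field F] [Algebra K F] :
    locE p W F = (W.localRestrictionHom F).comp (W.primaryH1ToH1 p) := by
  rw [locE, WeierstrassCurve.primaryH1ToH1,
    show W.localRestrictionHom F = resH1Hom (resGal (K := K) F) (pointsMap W F) (pointsMap_smul W F) from rfl,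
    resH1Hom_comp]
  exact resH1Hom_congr rfl rfl _ _

omit [Fact p.Prime] in
/-- A class of `Sel_Gr(K, E[p^∞])` satisfies the `p^∞`-Selmer local condition at every finite place `w ≠ v` (the places
above `p` being `v`, `v̄`: locally trivial at `w ∤ p`, strict at `v̄`). [cite: Castella2018, Def. 2.2] [cite: Greenberg1999, §2] -/
theorem toGalH1_mem_selmerLocalKerPrimary_of_ne
    (hSp : ∀ w : HeightOneSpectrum (𝓞 K), ((p : ℕ) : 𝓞 K) ∈ w.asIdeal → w = v ∨ w = vbar)
    (c : subgroupH1 (⊤ : Subgroup (absoluteGaloisGroup K)) (W.geomPrimaryTorsion p)) (hc : c ∈ bottomSelmer p W vbar)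
    {w : HeightOneSpectrum (𝓞 K)} (hw : w ≠ v) :
    toGalH1 p W c ∈ W.selmerLocalKerPrimary (w.adicCompletion K) p := by
  obtain ⟨hA, hS⟩ := awayKer_and_strictKer_of_mem_bottomSelmer W vbar c hc
  refine mem_selmerLocalKerPrimary_of_resSubgroup_eq_zero W w _ ?_
  by_cases hpw : ((p : ℕ) : 𝓞 K) ∈ w.asIdeal
  · rcases hSp w hpw with rfl | rfl
    · exact absurd rfl hw
    · exact resSubgroup_toGalH1_eq_zero_of_mem_strictKer W _ c hS
  · exact resSubgroup_toGalH1_eq_zero_of_mem_awayKer W w c (hA w hpw)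

omit [Fact p.Prime] in
/-- **(L1)+(L2): a level-`p^e` Kummer lift of a `Sel_Gr`-class lies in `H¹_{𝓛, ⊤ at v}(K, E[p^e])`.** If
`T : H¹(K, E[p^e]) → H¹(K, E[p^∞])` is compatible with the maps to `H¹(K, E)` and `T y = toGalH1 c` with `c ∈ Sel_Gr`, then `y`
satisfies the local Kummer condition at every place `w ≠ v` (`K` with complex infinite places, the places above `p` being `v`, `v̄`).
[cite: MilneADT2006, I §6 (6.14)] [cite: SilvermanAEC2009, X.§4 diagram (**)] [cite: GreenbergLNM1716, §5 p. 114] -/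
theorem lift_mem_kummerOutside (hK : ∀ w : InfinitePlace K, w.IsComplex)
    (hSp : ∀ w : HeightOneSpectrum (𝓞 K), ((p : ℕ) : 𝓞 K) ∈ w.asIdeal → w = v ∨ w = vbar) (e : ℕ)
    (T : W.galH1Torsion ((p ^ e : ℕ) : ℤ) →+ W.galH1Primary p)
    (hT : (W.primaryH1ToH1 p).comp T = W.torsionH1ToH1 ((p ^ e : ℕ) : ℤ))
    (c : subgroupH1 (⊤ : Subgroup (absoluteGaloisGroup K)) (W.geomPrimaryTorsion p)) (hc : c ∈ bottomSelmer p W vbar)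
    (y : W.galH1Torsion ((p ^ e : ℕ) : ℤ)) (hy : T y = toGalH1 p W c) :
    y ∈ kummerOutside W (p ^ e) {Sum.inr v} := by
  -- the Selmer local condition of `y` at a `K`-field `F` follows from that of `toGalH1 c = T y`
  have key : ∀ (F : Type) [Field F] [Algebra K F], toGalH1 p W c ∈ W.selmerLocalKerPrimary F p →
      y ∈ W.selmerLocalKer F ((p ^ e : ℕ) : ℤ) := by
    intro F _ _ h
    rw [WeierstrassCurve.selmerLocalKerPrimary_eq_comap, AddSubgroup.mem_comap, ← hy] at h
    rw [WeierstrassCurve.selmerLocalKer_eq_comap, AddSubgroup.mem_comap, ← hT]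
    exact h
  refine (mem_kummerOutside_iff W (p ^ e) {Sum.inr v} y).mpr fun w hw ↦ ?_
  rw [Finset.mem_singleton] at hw
  have hsel : y ∈ W.selmerLocalKer (Place.Completion w) ((p ^ e : ℕ) : ℤ) := by
    rcases w with σ | w
    · exact key _ (mem_selmerLocalKerPrimary_completion_of_isComplex W (hK σ) _)
    · exact key _ (toGalH1_mem_selmerLocalKerPrimary_of_ne W vbar v hSp c hc fun h ↦ hw (by rw [h]))
  -- `selmerLocalKer = res⁻¹ 𝓛_w` (tree `comap_res_kummerLocalConditionAt`)
  exact AddSubgroup.mem_comap.mp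
    ((SetLike.ext_iff.mp (W.comap_res_kummerLocalConditionAt ((p ^ e : ℕ) : ℤ) (Place.Completion w)) y).mpr hsel)

/-- **(L4), containment: the image of `Sel_Gr[p^e]` in `H¹(K_v, E)` lies in the image of `H¹_{𝓛,⊤ at v}(K, E[p^e])`** under
`loc_v ∘ (H¹(K, E[p^e]) → H¹(K, E))` (through the Kummer lift (L1) and (L2)). [cite: GreenbergLNM1716, §5 p. 114]
[cite: MilneADT2006, I §6 (6.14)] -/
theorem map_bottomSelmer_inf_torsionBy_le [W.IsElliptic] (hK : ∀ w : InfinitePlace K, w.IsComplex)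
    (hSp : ∀ w : HeightOneSpectrum (𝓞 K), ((p : ℕ) : 𝓞 K) ∈ w.asIdeal → w = v ∨ w = vbar) (e : ℕ) :
    (bottomSelmer p W vbar ⊓ AddSubgroup.torsionBy _ ((p ^ e : ℕ) : ℤ)).map
        ((locE p W (v.adicCompletion K)).comp (toGalH1Hom p W)) ≤
      (kummerOutside W (p ^ e) {Sum.inr v}).map
        ((W.localRestrictionHom (v.adicCompletion K)).comp (W.torsionH1ToH1 ((p ^ e : ℕ) : ℤ))) := by
  obtain ⟨T, hT, hsurj⟩ := Literature.Barriers.BirchSwinnertonDyer.exists_torsionToPrimaryHom W p e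
    (WeierstrassCurve.zsmul_geomPoints_surjective_holds W)
  rintro _ ⟨c, hc, rfl⟩
  obtain ⟨hcB, hcT⟩ := AddSubgroup.mem_inf.mp hc
  have hkill : p ^ e • toGalH1Hom p W c = 0 := by
    rw [← map_nsmul, AddSubgroup.torsionBy.nsmul_iff.mp hcT, map_zero]
  obtain ⟨y, hy⟩ := hsurj _ hkill
  rw [toGalH1Hom_apply] at hy
  refine ⟨y, lift_mem_kummerOutside W vbar v hK hSp e T hT c hcB y hy, ?_⟩
  rw [AddMonoidHom.comp_apply, AddMonoidHom.comp_apply, toGalH1Hom_apply, ← hy, locE_eq_localRestrictionHom_comp,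
    AddMonoidHom.comp_apply, ← AddMonoidHom.comp_apply (W.primaryH1ToH1 p) T y, hT]

/-- **`#(𝓞_v / p^k 𝓞_v) = p^k` at a place `v ∣ p` with `e(v|p) f(v|p) = 1`** (induction on `k` through
`#(R/(ab)) = #(R/(a))·#(R/(b))`). [cite: MilneADT2006, Ch. I, Lemma 3.3] [cite: NeukirchANT1999, Ch. II §4] -/
theorem natCard_adicCompletionIntegers_quot_span_pow_of_deg_one (hpv : ((p : ℕ) : 𝓞 K) ∈ v.asIdeal)
    (hef : v.asIdeal.ramificationIdx ℤ * v.asIdeal.inertiaDeg ℤ = 1) (k : ℕ) :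
    Nat.card (v.adicCompletionIntegers K ⧸ Ideal.span {((p ^ k : ℕ) : v.adicCompletionIntegers K)}) = p ^ k := by
  have hp : p.Prime := Fact.out
  have hcardp : Nat.card (v.adicCompletionIntegers K ⧸ Ideal.span {(p : v.adicCompletionIntegers K)}) = p := by
    rw [Literature.NumberTheory.IwasawaTheory.Greenberg2006.natCard_adicCompletionIntegers_quotient_natCast_of_mem K v p hpv,
      hef, pow_one]
  induction k with
  | zero =>
    simp only [pow_zero, Nat.cast_one, Ideal.span_singleton_one]
    haveI : Subsingleton (v.adicCompletionIntegers K ⧸ (⊤ : Ideal _)) := Ideal.Quotient.subsingleton_iff.mpr rfl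
    exact Nat.card_of_subsingleton (0 : _)
  | succ k ih =>
    have ha : ((p ^ k : ℕ) : v.adicCompletionIntegers K) ≠ 0 := LocalPoints.natCast_ne_zero v (pow_ne_zero k hp.ne_zero)
    rw [show ((p ^ (k + 1) : ℕ) : v.adicCompletionIntegers K) =
        ((p ^ k : ℕ) : v.adicCompletionIntegers K) * ((p : ℕ) : v.adicCompletionIntegers K) by push_cast; ring,
      natCard_quotient_span_singleton_mul' ha, ih, hcardp, pow_succ]

/-- **(L3)+(L4)+(L5): THE LEVELWISE IMAGE BOUND in rank one at a split `p`.** For ANY elliptic curve `E` over a quadratic `K`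
with complex infinite places, `p = v v̄` split and rank `E(K) = 1`: the image of `Sel_Gr(K, E[p^∞])[p^k]` in `H¹(K_v, E)` has
at most `C` elements, uniformly in `k`. [cite: JetchevSkinnerWan2017, Prop. 3.2.1] [cite: MilneADT2006, I Thm. 4.10]
[cite: SilvermanAEC2009, Prop. VII.6.3, X.§4] [cite: arXiv:1405.7294, §2.3 Lemma 4 (p. 8)] -/
theorem exists_image_card_le_of_mordellWeilRank_eq_one [W.IsElliptic]
    (h2 : Module.finrank ℚ K = 2) (hK : ∀ w : InfinitePlace K, w.IsComplex)
    (hpv : ((p : ℕ) : 𝓞 K) ∈ v.asIdeal) (hpvbar : ((p : ℕ) : 𝓞 K) ∈ vbar.asIdeal) (hne : vbar ≠ v)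
    (hrank : W.mordellWeilRank = 1) :
    ∃ C : ℕ, ∀ k : ℕ, Nat.card ((bottomSelmer p W vbar ⊓ AddSubgroup.torsionBy _ ((p ^ k : ℕ) : ℤ)).map
      ((locE p W (v.adicCompletion K)).comp (toGalH1Hom p W))) ≤ C := by
  have hp : p.Prime := Fact.out
  have hSp : ∀ w : HeightOneSpectrum (𝓞 K), ((p : ℕ) : 𝓞 K) ∈ w.asIdeal → w = v ∨ w = vbar :=
    fun w hw ↦ eq_or_eq_of_natCast_mem_of_ne h2 hpv hpvbar hne hw
  -- degree one at `v`: `K_v ≅ ℚ_p`, a functional `λ : E(K_v) → ℤ_p` vanishing exactly on torsion, `#(𝓞_v/p^k) = p^k`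
  haveI : Algebra.IsQuadraticExtension ℚ K := ⟨h2⟩
  obtain ⟨⟨he, hf⟩, -⟩ := LocalField.ramificationIdx_eq_one_and_inertiaDeg_eq_one_of_ne p v vbar hne.symm hpv hpvbar
  obtain ⟨lam, hlam⟩ := exists_addMonoidHom_padicInt_apply_eq_zero_iff_adicCompletion W p v hpv he hf
  have hef : v.asIdeal.ramificationIdx ℤ * v.asIdeal.inertiaDeg ℤ = 1 :=
    (ncard_primesOver_eq_two_and_deg_one_of_ne h2 hpv hpvbar hne).2 hpv
  -- `#E(K_v)[n] ≤ B` (Silverman VII.6.3) and the uniform relaxed-vs-Selmer index bound (Poitou–Tate + Euler characteristic + λ)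
  obtain ⟨B, hB, hBle⟩ := exists_natCard_ker_nsmul_adicCompletion_le W v
  obtain ⟨a, ha⟩ := exists_relIndex_selmerGroup_kummerOutside_mul_pow_le W v p lam hlam hrank
  refine ⟨B * p ^ a, fun k ↦ ?_⟩
  cases k with
  | zero =>
    -- `Sel_Gr[1] = 0`
    have hbot : bottomSelmer p W vbar ⊓ AddSubgroup.torsionBy _ ((p ^ 0 : ℕ) : ℤ) = ⊥ := by
      rw [eq_bot_iff]
      intro x hx
      have h1 := AddSubgroup.torsionBy.nsmul_iff.mp (AddSubgroup.mem_inf.mp hx).2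
      rw [pow_zero, one_nsmul] at h1
      rw [h1]
      exact AddSubgroup.zero_mem _
    rw [hbot, AddSubgroup.map_bot, AddSubgroup.card_bot]
    exact Nat.one_le_iff_ne_zero.mpr (mul_ne_zero hB.ne' (pow_ne_zero a hp.ne_zero))
  | succ k =>
    haveI : NeZero (p ^ (k + 1)) := ⟨pow_ne_zero _ hp.ne_zero⟩
    obtain ⟨hidx0, hle⟩ := ha k (p ^ (k + 1)) rfl
    set Ψ : W.galH1Torsion ((p ^ (k + 1) : ℕ) : ℤ) →+ W.localH1 (v.adicCompletion K) :=
      (W.localRestrictionHom (v.adicCompletion K)).comp (W.torsionH1ToH1 ((p ^ (k + 1) : ℕ) : ℤ)) with hΨ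
    -- `Sel^{(p^{k+1})} ⊆ ker Ψ` (the Selmer local condition at `v`)
    have hSelker : W.selmerGroup ((p ^ (k + 1) : ℕ) : ℤ) ≤ Ψ.ker := fun c hc ↦ by
      have hcv := ((W.mem_selmerGroup_iff _ c).mp hc).1 v
      rw [WeierstrassCurve.selmerLocalKer_eq_comap, AddSubgroup.mem_comap, WeierstrassCurve.localRestrictionKer_eq_ker]
        at hcv
      exact hcv
    -- `#Ψ(H¹_{𝓛,⊤ at v}) ∣ [H¹_{𝓛,⊤ at v} : Sel]`
    have hcardKO : Nat.card ((kummerOutside W (p ^ (k + 1)) {Sum.inr v}).map Ψ) ∣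
        (W.selmerGroup ((p ^ (k + 1) : ℕ) : ℤ)).relIndex (kummerOutside W (p ^ (k + 1)) {Sum.inr v}) := by
      rw [← AddSubgroup.relIndex_ker]
      exact AddSubgroup.relIndex_dvd_of_le_left (kummerOutside W (p ^ (k + 1)) {Sum.inr v}) hSelker
    haveI hfinKO : Finite ((kummerOutside W (p ^ (k + 1)) {Sum.inr v}).map Ψ) :=
      Nat.finite_of_card_ne_zero fun h0 ↦ hidx0 (Nat.eq_zero_of_zero_dvd (h0 ▸ hcardKO))
    have hker := hBle (p ^ (k + 1)) (pow_ne_zero _ hp.ne_zero)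
    have hpow : p ^ (k + 1) ≤ p ^ (k + 1 - a) * p ^ a := by
      rw [← pow_add]
      exact Nat.pow_le_pow_right hp.pos le_tsub_add
    calc Nat.card ((bottomSelmer p W vbar ⊓ AddSubgroup.torsionBy _ ((p ^ (k + 1) : ℕ) : ℤ)).map
            ((locE p W (v.adicCompletion K)).comp (toGalH1Hom p W)))
        ≤ Nat.card ((kummerOutside W (p ^ (k + 1)) {Sum.inr v}).map Ψ) :=
          AddSubgroup.card_le_of_le (map_bottomSelmer_inf_torsionBy_le W vbar v hK hSp (k + 1))
      _ ≤ (W.selmerGroup ((p ^ (k + 1) : ℕ) : ℤ)).relIndex (kummerOutside W (p ^ (k + 1)) {Sum.inr v}) :=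
          Nat.le_of_dvd (Nat.pos_of_ne_zero hidx0) hcardKO
      _ ≤ B * p ^ a := by
          refine Nat.le_of_mul_le_mul_right ?_ (pow_pos hp.pos (k + 1 - a))
          calc (W.selmerGroup ((p ^ (k + 1) : ℕ) : ℤ)).relIndex (kummerOutside W (p ^ (k + 1)) {Sum.inr v}) *
                  p ^ (k + 1 - a)
              ≤ Nat.card (nsmulAddMonoidHom (p ^ (k + 1)) :
                    (W.baseChange (v.adicCompletion K)).toAffine.Point →+ _).ker *
                  Nat.card (v.adicCompletionIntegers K ⧸
                    Ideal.span {((p ^ (k + 1) : ℕ) : v.adicCompletionIntegers K)}) := hle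
            _ ≤ B * (p ^ (k + 1 - a) * p ^ a) := by
                rw [natCard_adicCompletionIntegers_quot_span_pow_of_deg_one v hpv hef]
                exact Nat.mul_le_mul hker hpow
            _ = B * p ^ a * p ^ (k + 1 - a) := by ring

/-- **(B′-iv) PROVED in rank one at a split `p`**: the Kummer-at-`v` classes have finite index in `Sel_Gr(K, E[p^∞])`, for ANY
elliptic curve over a quadratic `K` with complex infinite places, `p = v v̄` split, rank `E(K) = 1`.
[cite: MilneADT2006, I Thm. 4.10] [cite: arXiv:1405.7294, §2.3 Lemma 4 (p. 8)] [cite: JetchevSkinnerWan2017, Prop. 3.2.1] -/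
theorem bottomKummerFiniteIndexAt_of_mordellWeilRank_eq_one [W.IsElliptic]
    (h2 : Module.finrank ℚ K = 2) (hK : ∀ w : InfinitePlace K, w.IsComplex)
    (hpv : ((p : ℕ) : 𝓞 K) ∈ v.asIdeal) (hpvbar : ((p : ℕ) : 𝓞 K) ∈ vbar.asIdeal) (hne : vbar ≠ v)
    (hrank : W.mordellWeilRank = 1) : BottomKummerFiniteIndexAt p W vbar v := by
  obtain ⟨C, hC⟩ := exists_image_card_le_of_mordellWeilRank_eq_one W vbar v h2 hK hpv hpvbar hne hrank
  exact bottomKummerFiniteIndexAt_of_image_card_le W vbar v C hC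

/-- **(B′) PROVED in rank one at a split `p`, granted `Ш(E/K)[p^∞]` finite**: `Sel_Gr(K, E[p^∞]) = bottomSelmer` is finite for
ANY elliptic curve over a quadratic `K` with complex infinite places, `p = v v̄` split, rank `E(K) = 1`, `Ш(E/K)[p^∞]` finite
(Skinner 2020 §2.3 Lemma 4's shape, here a theorem of the tree's descent + duality library). [cite: arXiv:1405.7294, §2.2 Lemma 2,
§2.3 Lemma 4 (p. 8)] [cite: MilneADT2006, I Thm. 4.10] [cite: Kolyvagin1990, Thm. A] -/
theorem bottomSelmer_finite_of_mordellWeilRank_eq_one [W.IsElliptic]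
    (h2 : Module.finrank ℚ K = 2) (hK : ∀ w : InfinitePlace K, w.IsComplex)
    (hpv : ((p : ℕ) : 𝓞 K) ∈ v.asIdeal) (hpvbar : ((p : ℕ) : 𝓞 K) ∈ vbar.asIdeal) (hne : vbar ≠ v)
    (hrank : W.mordellWeilRank = 1) [Finite (AddCommGroup.primaryComponent W.sha p)] :
    (SetLike.coe (bottomSelmer p W vbar)).Finite :=
  bottomSelmer_finite_of_kummerFiniteIndex_of_mordellWeilRank_eq_one W vbar v h2 hK hpv hpvbar hne hrank
    (bottomKummerFiniteIndexAt_of_mordellWeilRank_eq_one W vbar v h2 hK hpv hpvbar hne hrank)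

/-- **Door 4's `hfix` from (A3″) alone in analytic rank one** (20728's setting + the Heegner-point facts' conclusion
`rank E(K) = 1 ∧ Ш(E/K)` finite): the levelwise input of v1.10 is discharged. No summit statement is proved.
[cite: arXiv:2409.01350, Part II Prop. 3.1 (p. 78)] [cite: Gross1991, Thm. 1.3] [cite: Kolyvagin1990, Thm. A] -/
theorem hfixBound_of_fixedPointExponent_of_HGZ (W₀ : WeierstrassCurve ℚ) [W₀.IsElliptic]
    (hp2 : p ≠ 2) (hρ : W₀.HasSurjectiveModNGaloisRep p) (hK : IsImaginaryQuadratic K)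
    (hpv : ((p : ℕ) : 𝓞 K) ∈ v.asIdeal) (hpvbar : ((p : ℕ) : 𝓞 K) ∈ vbar.asIdeal) (hne : vbar ≠ v)
    (hγ : ZpExtension.IsTopGeneratorPair κ₁ κ₂ γ₁ γ₂)
    (h3 : InertiaTowerFixedPointExponent (W₀.baseChange K) κ₁ κ₂ vbar)
    (hGZK : (W₀.baseChange K).mordellWeilRank = 1 ∧ (W₀.baseChange K).ShaFinite) :
    ∃ k : ℕ, HfixBound (W₀.baseChange K) κ₁ κ₂ vbar γ₁ γ₂ k := by
  haveI : (W₀.baseChange K).IsElliptic := by rw [WeierstrassCurve.baseChange]; infer_instance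
  haveI := hK.2
  exact hfixBound_of_fixedPointExponent_of_kummerFiniteIndex κ₁ κ₂ vbar γ₁ γ₂ v W₀ hp2 hρ hK hpv hpvbar hne hγ h3 hGZK
    (bottomKummerFiniteIndexAt_of_mordellWeilRank_eq_one (W₀.baseChange K) vbar v hK.1 IsTotallyComplex.isComplex
      hpv hpvbar hne hGZK.1)

/-- **Door (7-bot)'s `hfix` PROVED at a split SUPERSINGULAR `p` of analytic rank one over `K`**: for `E/ℚ` with `p ≠ 2` of good
supersingular reduction (`p ∣ a_p`), surjective mod-`p` representation, `K` imaginary quadratic with `p = v v̄` split, a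
topological generator pair of the `ℤ_p²`-extension, and `rank E(K) = 1 ∧ Ш(E/K)` finite (the conclusion of the Heegner-point facts
Gross–Zagier–Kolyvagin in 20728's range): `∃ k, HfixBound (E.baseChange K) κ₁ κ₂ v̄ γ₁ γ₂ k`. Every arithmetic input of this supply
line at supersingular `p` is now a theorem of the tree; at ordinary `p` (A3″)_ord remains. No summit statement is proved.
[cite: Serre1972, §1.11 Prop. 12 c)] [cite: MilneADT2006, I Thm. 4.10] [cite: Gross1991, Thm. 1.3] [cite: Kolyvagin1990, Thm. A]
[cite: arXiv:2409.01350, Part II Prop. 3.1, Cor. 3.2 (p. 78)] -/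
theorem hfixBound_supersingular_of_HGZ (W₀ : WeierstrassCurve ℚ) [W₀.IsElliptic]
    [W₀.IsGloballyMinimal] (hp2 : p ≠ 2) (hgood : W₀.HasGoodReductionAtPrime p) (hss : (p : ℤ) ∣ W₀.frobeniusTrace p)
    (hρ : W₀.HasSurjectiveModNGaloisRep p) (hK : IsImaginaryQuadratic K)
    (hpv : ((p : ℕ) : 𝓞 K) ∈ v.asIdeal) (hpvbar : ((p : ℕ) : 𝓞 K) ∈ vbar.asIdeal) (hne : vbar ≠ v)
    (hγ : ZpExtension.IsTopGeneratorPair κ₁ κ₂ γ₁ γ₂)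
    (hGZK : (W₀.baseChange K).mordellWeilRank = 1 ∧ (W₀.baseChange K).ShaFinite) :
    ∃ k : ℕ, HfixBound (W₀.baseChange K) κ₁ κ₂ vbar γ₁ γ₂ k :=
  hfixBound_of_fixedPointExponent_of_HGZ κ₁ κ₂ vbar γ₁ γ₂ v W₀ hp2 hρ hK hpv hpvbar hne hγ
    (inertiaTowerFixedPointExponent_baseChange_of_dvd_frobeniusTrace κ₁ κ₂ vbar W₀ hp2 hgood hss hK hpv hpvbar hne) hGZK

end LevelwiseImage

/-! ## (A3″)_ord decomposed (v1.12): Serre's ordinary line at `v̄`, the tower twist, and the typed local non-splitness input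

KatoLine.md §1j. At a good ORDINARY split prime, `I_v̄` acts on `E[p^∞]` through `(ε κ⁻¹ *; 0 κ)` and on `E[p]` through the Borel
`(ω̄ *; 0 1)`; the fixed module of `pairKer κ₁ κ₂ ⊓ I_v̄` has finite exponent iff `E[p^∞]|_{G_{K_v̄}}` is NON-SPLIT — true for non-CM
`E` (Serre 1968 IV-A.2 via Tate 1967 Thm. 4 and the Serre–Tate canonical lift; (CG) for `k = 2`, `ℚ(f) = ℚ`, arXiv:1807.02499 p. 3),
false for CM curves (excluded in 20728 by `Surj`). This section PROVES the group theory and ISOLATES the print input: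
`OrdinaryLineAt W v̄ X` (a non-zero `p`-torsion subgroup on which `I_v̄` acts by scalars, one of them `≢ 1`; Serre 1972 §1.11 Prop. 11
and Cor.) EXISTS for base changes from `ℚ` (`exists_ordinaryLineAt_baseChange`: the tree's `MatarNekovar2019.exists_ordinaryLine` at
`𝔔 = 𝔓_{v̄} ∩ \bar ℤ_ℚ`, transported along `E(ℚ̄) ≃ E_K(K̄)` and `res(I_v̄) = I_𝔔`); the TOWER TWIST `exists_mem_pairKer_inf_inertia_smul_eq`
(some `s = τ^{p−1}σ⁻¹ ∈ pairKer ⊓ I_v̄` acts on `X` by a scalar `≢ 1`; `ZpExtension.exists_pow_mul_inv_mem_pairKer_of_coprime`,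
`N = p − 1`, Fermat), so `towerInertiaFixed` (which is `D_v̄`-stable) meets `X` trivially; `NoStableComplementAt W v̄ X` — THE PRINT
INPUT (every `D_v̄`-stable subgroup of `E[p^∞]` meeting `X` trivially is finite; NOT proved), `OrdinaryNonsplit p W v̄`; and
`inertiaTowerFixedPointExponent_of_ordinaryLineAt : OrdinaryLineAt X → NoStableComplementAt X → (A3″)` (PROVED) with the doors
`inertiaTowerFixedPointExponent_ordinary_of_nonsplit`, `hfixBound_ordinary_of_nonsplit_of_HGZ`, `hfixBound_of_nonsplit_of_HGZ` (ALL of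
20728's range from HGZ + `OrdinaryNonsplit` at ordinary `p` only). No summit statement is proved. [cite: Serre1972, §1.11 Prop. 11 and Cor.]
[cite: Serre1968, IV-A.2] [cite: Tate1967, Thm. 4] [cite: arXiv:1807.02499, p. 3] [cite: GreenbergLNM1716, §4 Prop. 4.8 (p. 109)]
[cite: Washington1997, §13.1] -/

section OrdinaryResidue

open scoped Classical

/-- In an abelian group, a non-zero element killed by the prime `p` is killed only by multiples of `p` (Bezout).
[folklore] -/
private theorem dvd_of_zsmul_eq_zero {A : Type*} [AddCommGroup A] {x : A} (hpx : (p : ℤ) • x = 0) (hx : x ≠ 0)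
    {m : ℤ} (hm : m • x = 0) : (p : ℤ) ∣ m := by
  have hp : p.Prime := Fact.out
  have hpi : Prime (p : ℤ) := Nat.prime_iff_prime_int.mp hp
  by_contra hnd
  obtain ⟨u, w, huw⟩ := (hpi.coprime_iff_not_dvd.mpr hnd).symm
  apply hx
  calc x = (u * m + w * p) • x := by rw [huw, one_smul]
    _ = 0 := by rw [add_smul, mul_smul, hm, smul_zero, mul_smul, hpx, smul_zero, add_zero]

/-- The subgroup of `E[p^∞]` fixed pointwise by `Gal(K̄/K̃_∞) ∩ I_v̄ = pairKer κ₁ κ₂ ⊓ I_v̄` — the module whose exponent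
(A3″) `InertiaTowerFixedPointExponent` bounds. [cite: GreenbergLNM1716, §4 Prop. 4.8 (p. 109)] -/
def towerInertiaFixed : AddSubgroup (W.geomPrimaryTorsion p) where
  carrier := {m | ∀ t ∈ ZpExtension.pairKer κ₁ κ₂ ⊓ GreenbergSelmer.inertia vbar, t • m = m}
  add_mem' {a b} ha hb := fun t ht ↦ by rw [smul_add, ha t ht, hb t ht]
  zero_mem' := fun t _ ↦ smul_zero t
  neg_mem' {a} ha := fun t ht ↦ by rw [smul_neg, ha t ht]

/-- Membership in `towerInertiaFixed`. [folklore] -/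
theorem mem_towerInertiaFixed_iff {m : W.geomPrimaryTorsion p} :
    m ∈ towerInertiaFixed W κ₁ κ₂ vbar ↔ ∀ t ∈ ZpExtension.pairKer κ₁ κ₂ ⊓ GreenbergSelmer.inertia vbar, t • m = m :=
  Iff.rfl

/-- `towerInertiaFixed` is stable under the decomposition group `D_v̄`: `pairKer κ₁ κ₂ ⊴ Γ_K` and `D_v̄` normalises `I_v̄`
(`conj_mem_inertia_of_mem_decomp`), so `t • (d • m) = d • ((d⁻¹ t d) • m) = d • m`. [cite: SerreLocalFields1979, I §7 Prop. 20] -/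
theorem smul_mem_towerInertiaFixed {d : absoluteGaloisGroup K} (hd : d ∈ GreenbergSelmer.decomp vbar)
    {m : W.geomPrimaryTorsion p} (hm : m ∈ towerInertiaFixed W κ₁ κ₂ vbar) :
    d • m ∈ towerInertiaFixed W κ₁ κ₂ vbar := by
  intro t ht
  have hpk : d⁻¹ * t * d ∈ ZpExtension.pairKer κ₁ κ₂ := by
    have h1 := (ZpExtension.mem_pairKer_iff.mp ht.1)
    rw [ZpExtension.mem_pairKer_iff]
    constructor
    · rw [map_mul, map_mul, map_inv, h1.1, mul_one, inv_mul_cancel]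
    · rw [map_mul, map_mul, map_inv, h1.2, mul_one, inv_mul_cancel]
  have hconj : d⁻¹ * t * d ∈ ZpExtension.pairKer κ₁ κ₂ ⊓ GreenbergSelmer.inertia vbar :=
    ⟨hpk, conj_mem_inertia_of_mem_decomp hd ht.2⟩
  rw [smul_smul, show t * d = d * (d⁻¹ * t * d) by group, mul_smul, hm _ hconj]

/-- **Serre's ordinary line at `v̄`, typed on the tree's objects.** `X ≤ E[p^∞]` is a NON-ZERO subgroup killed by `p` on
which every element of the inertia group `I_v̄` acts by a scalar, and some element by a scalar `a ≢ 1 (mod p)`. For `E` good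
ordinary at `v̄ ∣ p` with `e(K_v̄ ∣ ℚ_p) = 1 < p − 1` this is the line `X = E[p] ∩ Ê` of the kernel of reduction: `I_v̄` acts on
it through `χ_X = ω̄`, which maps `I_v̄` onto `𝔽_p^×` (Serre 1972 §1.11 Prop. 11 and Cor.); PROVED below for base changes from
`ℚ` at a split `p` (`exists_ordinaryLineAt_baseChange`). [cite: Serre1972, §1.11 Prop. 11 and Cor.] -/
def OrdinaryLineAt (X : AddSubgroup (W.geomPrimaryTorsion p)) : Prop :=
  X ≠ ⊥ ∧ (∀ x ∈ X, p • x = 0) ∧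
    (∀ t ∈ GreenbergSelmer.inertia vbar, ∃ c : ℤ, ∀ x ∈ X, t • x = c • x) ∧
    ∃ σ ∈ GreenbergSelmer.inertia vbar, ∃ a : ℤ, ¬ (p : ℤ) ∣ a - 1 ∧ ∀ x ∈ X, σ • x = a • x

/-- **The local non-splitness input, typed (NOT proved here).** Every `D_v̄`-stable subgroup of `E[p^∞]` meeting `X` trivially is
finite. For `X` the ordinary line: `E[p^∞]|_{D_v̄}` has no `D_v̄`-stable complement to `Ê[p^∞] ⊇ X` (such an `L` has cyclic `L[p]`, so is
finite or a divisible line with `Ê[p^∞] ⊕ L = E[p^∞]`), i.e. `T_pE|_{G_{ℚ_p}}` is NON-SPLIT — true iff `E` is non-CM (Serre 1968 IV-A.2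
via Tate 1967 Thm. 4; since v1.14 the Literature named fact `serre1968_locallyNonsplit_of_not_hasCM`, transported here in section
`SerreForm`). [cite: Serre1968, IV-A.2] [cite: Tate1967, Thm. 4] [cite: arXiv:1807.02499, p. 3] -/
def NoStableComplementAt (X : AddSubgroup (W.geomPrimaryTorsion p)) : Prop :=
  ∀ L : AddSubgroup (W.geomPrimaryTorsion p),
    (∀ d ∈ GreenbergSelmer.decomp vbar, ∀ m ∈ L, d • m ∈ L) → L ⊓ X = ⊥ → (L : Set (W.geomPrimaryTorsion p)).Finite

variable (p) in
/-- **`E[p^∞]|_{D_v̄}` is ordinary-non-split at `v̄`** (the one print input of (A3″)_ord, typed): every ordinary line at `v̄`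
has no stable complement. For a good ordinary non-CM `E` with `K_v̄ = ℚ_p` this is Serre 1968 IV-A.2 (with Tate 1967 Thm. 4);
it FAILS for CM curves (then (A3″) is false). [cite: Serre1968, IV-A.2] [cite: Tate1967, Thm. 4] -/
def OrdinaryNonsplit : Prop :=
  ∀ X : AddSubgroup (W.geomPrimaryTorsion p), OrdinaryLineAt W vbar X → NoStableComplementAt W vbar X

omit [Fact p.Prime] [NumberField K] in
/-- Powers act on a scalar line by powers of the scalar. [folklore] -/
private theorem pow_smul_eq_pow_zsmul_of_forall {X : AddSubgroup (W.geomPrimaryTorsion p)} {τ : absoluteGaloisGroup K}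
    {c : ℤ} (hc : ∀ x ∈ X, τ • x = c • x) (n : ℕ) : ∀ x ∈ X, (τ ^ n) • x = (c ^ n) • x := by
  induction n with
  | zero => intro x _; rw [pow_zero, pow_zero, one_smul, one_smul]
  | succ n ih =>
    intro x hx
    rw [pow_succ, mul_smul, hc x hx, ih _ (X.zsmul_mem hx c), pow_succ, mul_smul]

/-- **The tower twist (PROVED).** If `X` is an ordinary line at `v̄`, some element `s` of `pairKer κ₁ κ₂ ⊓ I_v̄ =
Gal(K̄/K̃_∞) ∩ I_v̄` acts on `X` by a scalar `≢ 1 (mod p)`: with `σ ∈ I_v̄` acting by `a ≢ 1` and `N = p − 1` (prime to `p`),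
Cantor's intersection argument in the compact `Γ_K` (`ZpExtension.exists_pow_mul_inv_mem_pairKer_of_coprime`, `I_v̄` closed) gives
`τ ∈ I_v̄` with `s = τ^{p−1} σ⁻¹ ∈ pairKer`; `τ` acts on `X` by some `c` with `p ∤ c`, so `s` acts by `c' c^{p−1} ≡ a⁻¹ ≢ 1`
(Fermat). [cite: Washington1997, §13.1] [cite: Serre1972, §1.11 Prop. 11 and Cor.] -/
theorem exists_mem_pairKer_inf_inertia_smul_eq {X : AddSubgroup (W.geomPrimaryTorsion p)} (hX : OrdinaryLineAt W vbar X) :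
    ∃ s ∈ ZpExtension.pairKer κ₁ κ₂ ⊓ GreenbergSelmer.inertia vbar, ∃ b : ℤ, ¬ (p : ℤ) ∣ b - 1 ∧
      ∀ x ∈ X, s • x = b • x := by
  have hp : p.Prime := Fact.out
  have hpi : Prime (p : ℤ) := Nat.prime_iff_prime_int.mp hp
  obtain ⟨hX0, hXp, hscal, σ, hσI, a, ha1, hσa⟩ := hX
  have hcop : (p - 1).Coprime p := by
    rw [Nat.coprime_self_sub_left hp.one_le]
    exact Nat.coprime_one_left p
  obtain ⟨τ, hτI, hs⟩ := ZpExtension.exists_pow_mul_inv_mem_pairKer_of_coprime κ₁ κ₂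
    (InertiaFixedPoint.isClosed_inertia vbar) hcop hσI
  have hsI : τ ^ (p - 1) * σ⁻¹ ∈ GreenbergSelmer.inertia vbar :=
    Subgroup.mul_mem _ (Subgroup.pow_mem _ hτI _) (Subgroup.inv_mem _ hσI)
  obtain ⟨c, hc⟩ := hscal τ hτI
  obtain ⟨c', hc'⟩ := hscal σ⁻¹ (Subgroup.inv_mem _ hσI)
  refine ⟨τ ^ (p - 1) * σ⁻¹, ⟨hs, hsI⟩, c' * c ^ (p - 1), ?_, fun x hx ↦ ?_⟩
  · -- a non-zero `x₁ ∈ X`: `p ∤ c`, Fermat `p ∣ c^{p-1} - 1`, and `p ∣ a c' - 1`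
    obtain ⟨⟨x₁, hx₁X⟩, hx₁⟩ := AddSubgroup.ne_bot_iff_exists_ne_zero.mp hX0
    have hx₁0 : x₁ ≠ 0 := fun h ↦ hx₁ (Subtype.ext h)
    have hpx₁ : (p : ℤ) • x₁ = 0 := by rw [natCast_zsmul]; exact hXp x₁ hx₁X
    have hcnd : ¬ (p : ℤ) ∣ c := by
      rintro ⟨q, hq⟩
      have h := hc x₁ hx₁X
      rw [hq, mul_comm, mul_smul, hpx₁, smul_zero] at h
      exact hx₁0 (by rw [← inv_smul_smul τ x₁, h, smul_zero])
    have h1 : (p : ℤ) ∣ c ^ (p - 1) - 1 := Int.prime_dvd_pow_sub_one hp (hpi.coprime_iff_not_dvd.mpr hcnd).symm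
    have h2 : (p : ℤ) ∣ a * c' - 1 := by
      refine dvd_of_zsmul_eq_zero hpx₁ hx₁0 ?_
      have h := hc' (σ • x₁) (by rw [hσa x₁ hx₁X]; exact X.zsmul_mem hx₁X a)
      rw [inv_smul_smul, hσa x₁ hx₁X, smul_comm, ← mul_smul] at h
      rw [sub_smul, one_smul, ← h, sub_self]
    intro h3
    apply ha1
    have e : a - 1 = (c ^ (p - 1) - 1) - (a * (c' * c ^ (p - 1) - 1) - c ^ (p - 1) * (a * c' - 1)) := by ring
    rw [e]
    exact dvd_sub h1 (dvd_sub (dvd_mul_of_dvd_right h3 a) (dvd_mul_of_dvd_right h2 _))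
  · rw [mul_smul, hc' x hx, smul_comm, pow_smul_eq_pow_zsmul_of_forall W hc (p - 1) x hx, ← mul_smul]

/-- **The fixed module of `pairKer ⊓ I_v̄` meets an ordinary line trivially (PROVED).** A point of `X` fixed by the twist `s`
(`s x = b x`, `p ∤ b − 1`, `p x = 0`) is `0` by Bezout. [cite: Serre1972, §1.11 Prop. 11 and Cor.] [cite: Washington1997, §13.1] -/
theorem towerInertiaFixed_inf_eq_bot_of_ordinaryLineAt {X : AddSubgroup (W.geomPrimaryTorsion p)}
    (hX : OrdinaryLineAt W vbar X) : towerInertiaFixed W κ₁ κ₂ vbar ⊓ X = ⊥ := by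
  obtain ⟨s, hs, b, hb1, hsb⟩ := exists_mem_pairKer_inf_inertia_smul_eq W κ₁ κ₂ vbar hX
  refine (AddSubgroup.eq_bot_iff_forall _).mpr fun x hx ↦ ?_
  by_contra hx0
  have hpx : (p : ℤ) • x = 0 := by rw [natCast_zsmul]; exact hX.2.1 x hx.2
  refine hb1 (dvd_of_zsmul_eq_zero hpx hx0 ?_)
  rw [sub_smul, one_smul, ← hsb x hx.2, hx.1 s hs, sub_self]

/-- **(A3″)_ord from the two local inputs (PROVED): `OrdinaryLineAt X → NoStableComplementAt X → (A3″)`.** The fixed module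
`M = E[p^∞]^{pairKer ⊓ I_v̄}` is `D_v̄`-stable (`smul_mem_towerInertiaFixed`) and meets the ordinary line trivially
(`towerInertiaFixed_inf_eq_bot_of_ordinaryLineAt`), so it is FINITE by the non-splitness input, hence killed by `p^c` with
`c` the largest exponent occurring. [cite: GreenbergLNM1716, §4 Prop. 4.8 (p. 109)] [cite: Serre1968, IV-A.2]
[cite: Serre1972, §1.11 Prop. 11 and Cor.] -/
theorem inertiaTowerFixedPointExponent_of_ordinaryLineAt {X : AddSubgroup (W.geomPrimaryTorsion p)}
    (hX : OrdinaryLineAt W vbar X) (hN : NoStableComplementAt W vbar X) :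
    InertiaTowerFixedPointExponent W κ₁ κ₂ vbar := by
  have hfin : (towerInertiaFixed W κ₁ κ₂ vbar : Set (W.geomPrimaryTorsion p)).Finite :=
    hN _ (fun d hd m hm ↦ smul_mem_towerInertiaFixed W κ₁ κ₂ vbar hd hm)
      (towerInertiaFixed_inf_eq_bot_of_ordinaryLineAt W κ₁ κ₂ vbar hX)
  haveI : Finite (towerInertiaFixed W κ₁ κ₂ vbar) := hfin.to_subtype
  have hexp : ∀ m : towerInertiaFixed W κ₁ κ₂ vbar, ∃ n : ℕ, p ^ n • (m : W.geomPrimaryTorsion p) = 0 := by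
    intro m
    obtain ⟨n, hn⟩ := (m : W.geomPrimaryTorsion p).2
    exact ⟨n, Subtype.ext (by rw [AddSubmonoidClass.coe_nsmul, hn, ZeroMemClass.coe_zero])⟩
  choose f hf using hexp
  obtain ⟨c, hc⟩ := Finite.exists_le f
  refine ⟨c, fun m hm ↦ ?_⟩
  obtain ⟨d, hd⟩ := Nat.exists_eq_add_of_le (hc ⟨m, hm⟩)
  rw [hd, pow_add, mul_comm, mul_smul, hf ⟨m, hm⟩, smul_zero]

omit [Fact p.Prime] in
/-- A place of `K` containing `p` lies above the place `(p)` of `ℚ`. [folklore] -/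
private theorem natCast_mem_under_rat' {w : HeightOneSpectrum (𝓞 K)} (hpw : ((p : ℕ) : 𝓞 K) ∈ w.asIdeal) :
    (p : 𝓞 ℚ) ∈ (w.under (𝓞 ℚ)).asIdeal := by
  rw [HeightOneSpectrum.under_asIdeal, Ideal.under_def, Ideal.mem_comap, map_natCast]
  exact hpw

/-- **Serre's ordinary line EXISTS at `v̄` for base changes from `ℚ` at a split prime (PROVED).** `E/ℚ` globally minimal with good
ORDINARY reduction at `p ≠ 2` (`p ∤ a_p`), `K` imaginary quadratic with `p = v v̄` split, `v ≠ v̄`: there is an ordinary line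
`X ≤ E_K[p^∞]` at `v̄` — the transport of the tree's `MatarNekovar2019.exists_ordinaryLine` (Serre 1972 Prop. 11 over `ℚ` at the
contraction `𝔔` of the prime of `\bar ℤ_K` cut out by `v̄`) along `E(ℚ̄) ≃ E_K(K̄)` and `res(I_v̄) = I_𝔔` (`p` completely split), with
`σ` acting by `a = 2`. [cite: Serre1972, §1.11 Prop. 11 and Cor.] [cite: NeukirchANT1999, Ch. I §9 (9.3)–(9.6)]
[cite: SilvermanAEC2009, VIII.§1] -/
theorem exists_ordinaryLineAt_baseChange (W₀ : WeierstrassCurve ℚ) [W₀.IsElliptic] [W₀.IsGloballyMinimal]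
    (hp2 : p ≠ 2) (hgood : W₀.HasGoodReductionAtPrime p) (hord : ¬ (p : ℤ) ∣ W₀.frobeniusTrace p)
    (hK : IsImaginaryQuadratic K) {v : HeightOneSpectrum (𝓞 K)} (hpv : ((p : ℕ) : 𝓞 K) ∈ v.asIdeal)
    (hpvbar : ((p : ℕ) : 𝓞 K) ∈ vbar.asIdeal) (hne : vbar ≠ v) :
    ∃ X : AddSubgroup ((W₀.baseChange K).geomPrimaryTorsion p), OrdinaryLineAt (W₀.baseChange K) vbar X := by
  have hp : p.Prime := Fact.out
  haveI : (W₀.baseChange K).IsElliptic := by rw [WeierstrassCurve.baseChange]; infer_instance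
  haveI : Algebra.IsQuadraticExtension ℚ K := ⟨hK.1⟩
  haveI : IsGalois ℚ K := inferInstance
  -- the place `u = (p)` of `ℚ` below `v̄`, the prime `𝔓_K` of `\bar ℤ_K` cut out by `v̄`, its contraction `𝔔`
  set u : HeightOneSpectrum (𝓞 ℚ) := vbar.under (𝓞 ℚ) with hudef
  have hu : (Rat.HeightOneSpectrum.primesEquiv u : ℕ) = p :=
    LocalField.primesEquiv_eq_of_natCast_mem p u (natCast_mem_under_rat' hpvbar)
  set 𝔓K : Ideal (absIntegers (𝓞 K) K) := adicCompletionPrime K vbar with h𝔓Kdef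
  have hwu : vbar.asIdeal.under (𝓞 ℚ) = u.asIdeal := (HeightOneSpectrum.under_asIdeal (𝓞 ℚ) vbar).symm
  have h𝔔 : 𝔓K.comap (absIntegersMap ℚ K) ∈ u.primesAbove :=
    comap_absIntegersMap_mem_primesAbove hwu (adicCompletionPrime_mem_primesAbove K vbar)
  -- `res(I_v̄) = I_𝔔` since `p` splits completely in `K`
  have hsplit : ((u.asIdeal).primesOver (𝓞 K)).ncard = Module.finrank ℚ K :=
    ZpExtension.ncard_primesOver_under_eq_finrank_of_ne hK.1 hpvbar hpv hne.symm
  have hD : (𝔓K.comap (absIntegersMap ℚ K)).decompositionSubgroup (absoluteGaloisGroup ℚ) ≤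
      (absGaloisRestrict ℚ K).toMonoidHom.range :=
    SorensenPatching.decompositionSubgroup_le_range_of_ncard_primesOver_eq hsplit h𝔔
  have hI : GreenbergSelmer.inertia vbar = 𝔓K.inertia (absoluteGaloisGroup K) :=
    (inertia_adicCompletionPrime_eq_map_absInertia K vbar).symm
  have hres : (GreenbergSelmer.inertia vbar).map (absGaloisRestrict ℚ K).toMonoidHom =
      (𝔓K.comap (absIntegersMap ℚ K)).inertia (absoluteGaloisGroup ℚ) := by
    rw [hI, InertiaFixedPoint.map_absGaloisRestrict_inertia_eq 𝔓K hD]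
  -- Serre's ordinary line over `ℚ` at `𝔔`, and the equivariant identification `e : E(ℚ̄) ≃ E_K(K̄)`
  obtain ⟨v₀, hv₀, hline, hchar⟩ := MatarNekovar2019.exists_ordinaryLine hgood hord hu h𝔔
  obtain ⟨e, he⟩ := W₀.exists_addEquiv_geomPoints_baseChange K
  have hpv₀ : (p : ℤ) • (v₀ : W₀.geomPoints) = 0 := (Submodule.mem_torsionBy_iff _ _).mp v₀.2
  have hx₀mem : e (v₀ : W₀.geomPoints) ∈ (W₀.baseChange K).geomPrimaryTorsion p := by
    refine ⟨1, ?_⟩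
    rw [pow_one, ← natCast_zsmul, ← map_zsmul, hpv₀, map_zero]
  set x₀ : (W₀.baseChange K).geomPrimaryTorsion p := ⟨e (v₀ : W₀.geomPoints), hx₀mem⟩ with hx₀def
  -- the Galois action on `x₀` read through `e`
  have hact : ∀ t : absoluteGaloisGroup K,
      ((t • x₀ : (W₀.baseChange K).geomPrimaryTorsion p) : (W₀.baseChange K).geomPoints) =
        e ((absGaloisRestrict ℚ K t • v₀ : W₀.geomTorsion (p : ℤ)) : W₀.geomPoints) := by
    intro t
    rw [primaryComponent.coe_smul, AddSubgroup.torsionBy.coe_smul, he]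
  -- an integer `n` acting on `v₀` acts the same way on `x₀`
  have hscalar : ∀ (t : absoluteGaloisGroup K) (n : ℤ), absGaloisRestrict ℚ K t • v₀ = n • v₀ → t • x₀ = n • x₀ := by
    intro t n h
    apply Subtype.ext
    rw [hact t, h, AddSubgroupClass.coe_zsmul, map_zsmul, AddSubgroupClass.coe_zsmul]
  have hx₀0 : x₀ ≠ 0 := by
    intro h0
    apply hv₀
    have h1 : e (v₀ : W₀.geomPoints) = 0 := congrArg Subtype.val h0
    exact Subtype.ext ((AddEquiv.map_eq_zero_iff e).mp h1)
  have hpx₀ : p • x₀ = 0 := by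
    apply Subtype.ext
    rw [AddSubmonoidClass.coe_nsmul, ZeroMemClass.coe_zero, ← natCast_zsmul]
    change (p : ℤ) • e (v₀ : W₀.geomPoints) = 0
    rw [← map_zsmul, hpv₀, map_zero]
  refine ⟨AddSubgroup.zmultiples x₀, ?_, ?_, ?_, ?_⟩
  · -- `X ≠ ⊥`
    intro hbot
    exact hx₀0 ((AddSubgroup.eq_bot_iff_forall _).mp hbot x₀ (AddSubgroup.mem_zmultiples x₀))
  · -- killed by `p`
    intro x hx
    obtain ⟨k, rfl⟩ := AddSubgroup.mem_zmultiples_iff.mp hx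
    rw [smul_comm, hpx₀, smul_zero]
  · -- every `t ∈ I_v̄` acts by a scalar: `res t ∈ I_𝔔` acts on `v₀` by `n + 1`
    intro t ht
    have hrt : (absGaloisRestrict ℚ K).toMonoidHom t ∈ (𝔓K.comap (absIntegersMap ℚ K)).inertia (absoluteGaloisGroup ℚ) :=
      hres ▸ Subgroup.mem_map_of_mem _ ht
    obtain ⟨n, hn⟩ := hline _ hrt v₀
    have hn' : absGaloisRestrict ℚ K t • v₀ = (n + 1) • v₀ := by
      rw [add_zsmul, one_zsmul, ← hn]
      exact (sub_add_cancel _ _).symm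
    refine ⟨n + 1, fun x hx ↦ ?_⟩
    obtain ⟨k, rfl⟩ := AddSubgroup.mem_zmultiples_iff.mp hx
    rw [smul_comm, hscalar t (n + 1) hn', smul_comm]
  · -- some `σ ∈ I_v̄` acts by `2 ≢ 1`: lift Serre's `τ ∈ I_𝔔` with `τ v₀ = 2 v₀` through `res(I_v̄) = I_𝔔`
    have h2 : ¬ (p : ℤ) ∣ 2 := fun h ↦ hp2
      ((Nat.prime_dvd_prime_iff_eq hp Nat.prime_two).mp (by exact_mod_cast h))
    obtain ⟨τ, hτ, hτ2⟩ := hchar 2 h2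
    rw [← hres] at hτ
    obtain ⟨σ, hσI, hστ⟩ := Subgroup.mem_map.mp hτ
    have hστ' : absGaloisRestrict ℚ K σ = τ := hστ
    refine ⟨σ, hσI, 2, ?_, fun x hx ↦ ?_⟩
    · rw [show (2 : ℤ) - 1 = ((1 : ℕ) : ℤ) by norm_num, Int.natCast_dvd_natCast, Nat.dvd_one]
      exact hp.ne_one
    · obtain ⟨k, rfl⟩ := AddSubgroup.mem_zmultiples_iff.mp hx
      rw [smul_comm, hscalar σ 2 (by rw [hστ', hτ2]), smul_comm]

/-- **(A3″) at a split ORDINARY prime from the typed non-splitness input (PROVED modulo that input).** For `E/ℚ` globally minimal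
with good ordinary reduction at `p ≠ 2`, `K` imaginary quadratic with `p = v v̄` split, and `OrdinaryNonsplit p (E_K) v̄`:
`InertiaTowerFixedPointExponent (E_K) κ₁ κ₂ v̄`. [cite: Serre1972, §1.11 Prop. 11 and Cor.] [cite: Serre1968, IV-A.2]
[cite: GreenbergLNM1716, §4 Prop. 4.8 (p. 109)] -/
theorem inertiaTowerFixedPointExponent_ordinary_of_nonsplit (W₀ : WeierstrassCurve ℚ) [W₀.IsElliptic]
    [W₀.IsGloballyMinimal] (hp2 : p ≠ 2) (hgood : W₀.HasGoodReductionAtPrime p)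
    (hord : ¬ (p : ℤ) ∣ W₀.frobeniusTrace p) (hK : IsImaginaryQuadratic K)
    {v : HeightOneSpectrum (𝓞 K)} (hpv : ((p : ℕ) : 𝓞 K) ∈ v.asIdeal) (hpvbar : ((p : ℕ) : 𝓞 K) ∈ vbar.asIdeal)
    (hne : vbar ≠ v) (hns : OrdinaryNonsplit p (W₀.baseChange K) vbar) :
    InertiaTowerFixedPointExponent (W₀.baseChange K) κ₁ κ₂ vbar := by
  obtain ⟨X, hX⟩ := exists_ordinaryLineAt_baseChange vbar W₀ hp2 hgood hord hK hpv hpvbar hne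
  exact inertiaTowerFixedPointExponent_of_ordinaryLineAt (W₀.baseChange K) κ₁ κ₂ vbar hX (hns X hX)

/-- **Door (7-bot)'s `hfix` at a split ORDINARY `p` of analytic rank one over `K`, from the typed non-splitness input.** For `E/ℚ`
with `p ≠ 2` of good ordinary reduction, surjective mod-`p` representation, `K` imaginary quadratic with `p = v v̄` split, a
topological generator pair, `OrdinaryNonsplit p (E_K) v̄` (Serre 1968 IV-A.2 for non-CM `E`) and `rank E(K) = 1 ∧ Ш(E/K)` finite
(HGZ): `∃ k, HfixBound (E_K) κ₁ κ₂ v̄ γ₁ γ₂ k`. No summit statement is proved. [cite: Serre1968, IV-A.2]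
[cite: Serre1972, §1.11 Prop. 11 and Cor.] [cite: MilneADT2006, I Thm. 4.10] [cite: Gross1991, Thm. 1.3] [cite: Kolyvagin1990, Thm. A] -/
theorem hfixBound_ordinary_of_nonsplit_of_HGZ (W₀ : WeierstrassCurve ℚ) [W₀.IsElliptic] [W₀.IsGloballyMinimal]
    (hp2 : p ≠ 2) (hgood : W₀.HasGoodReductionAtPrime p) (hord : ¬ (p : ℤ) ∣ W₀.frobeniusTrace p)
    (hρ : W₀.HasSurjectiveModNGaloisRep p) (hK : IsImaginaryQuadratic K)
    {v : HeightOneSpectrum (𝓞 K)} (hpv : ((p : ℕ) : 𝓞 K) ∈ v.asIdeal) (hpvbar : ((p : ℕ) : 𝓞 K) ∈ vbar.asIdeal)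
    (hne : vbar ≠ v) (hγ : ZpExtension.IsTopGeneratorPair κ₁ κ₂ γ₁ γ₂)
    (hns : OrdinaryNonsplit p (W₀.baseChange K) vbar)
    (hGZK : (W₀.baseChange K).mordellWeilRank = 1 ∧ (W₀.baseChange K).ShaFinite) :
    ∃ k : ℕ, HfixBound (W₀.baseChange K) κ₁ κ₂ vbar γ₁ γ₂ k :=
  hfixBound_of_fixedPointExponent_of_HGZ κ₁ κ₂ vbar γ₁ γ₂ v W₀ hp2 hρ hK hpv hpvbar hne hγ
    (inertiaTowerFixedPointExponent_ordinary_of_nonsplit κ₁ κ₂ vbar W₀ hp2 hgood hord hK hpv hpvbar hne hns) hGZK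

/-- **Door (7-bot)'s `hfix` on ALL of 20728's range from ONE typed local input (the v1.12 assembly).** `E/ℚ` globally minimal, good at
`p ≠ 2`, `Surj`, `K` imaginary quadratic with `p = v v̄` split, a generator pair, `rank E(K) = 1 ∧ Ш(E/K)` finite, and — ONLY when `p` is
ordinary — `OrdinaryNonsplit p (E_K) v̄`: then `∃ k, HfixBound (E_K) κ₁ κ₂ v̄ γ₁ γ₂ k` (`hfixBound_supersingular_of_HGZ` /
`hfixBound_ordinary_of_nonsplit_of_HGZ`). No summit statement is proved. [cite: Serre1972, §1.11 Prop. 11–12] [cite: Serre1968, IV-A.2]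
[cite: MilneADT2006, I Thm. 4.10] [cite: Gross1991, Thm. 1.3] [cite: Kolyvagin1990, Thm. A] -/
theorem hfixBound_of_nonsplit_of_HGZ (W₀ : WeierstrassCurve ℚ) [W₀.IsElliptic] [W₀.IsGloballyMinimal]
    (hp2 : p ≠ 2) (hgood : W₀.HasGoodReductionAtPrime p) (hρ : W₀.HasSurjectiveModNGaloisRep p)
    (hK : IsImaginaryQuadratic K) {v : HeightOneSpectrum (𝓞 K)} (hpv : ((p : ℕ) : 𝓞 K) ∈ v.asIdeal)
    (hpvbar : ((p : ℕ) : 𝓞 K) ∈ vbar.asIdeal) (hne : vbar ≠ v) (hγ : ZpExtension.IsTopGeneratorPair κ₁ κ₂ γ₁ γ₂)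
    (hns : ¬ (p : ℤ) ∣ W₀.frobeniusTrace p → OrdinaryNonsplit p (W₀.baseChange K) vbar)
    (hGZK : (W₀.baseChange K).mordellWeilRank = 1 ∧ (W₀.baseChange K).ShaFinite) :
    ∃ k : ℕ, HfixBound (W₀.baseChange K) κ₁ κ₂ vbar γ₁ γ₂ k := by
  by_cases hss : (p : ℤ) ∣ W₀.frobeniusTrace p
  · exact hfixBound_supersingular_of_HGZ κ₁ κ₂ vbar γ₁ γ₂ v W₀ hp2 hgood hss hρ hK hpv hpvbar hne hγ hGZK
  · exact hfixBound_ordinary_of_nonsplit_of_HGZ κ₁ κ₂ vbar γ₁ γ₂ W₀ hp2 hgood hss hρ hK hpv hpvbar hne hγ (hns hss) hGZK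

/-- **Door (7-bot)'s `hfix` at a split SUPERSINGULAR `p` on 20728's analytic-rank-one sub-range, with the FACT LEDGER in the signature**
(critic V#26b's price, typed): `rank E(K) = 1 ∧ Ш(E/K)` finite is reached from `ord_{s=1} L(E/K, s) = 1` through the tree's
`mordellWeilRank_eq_one_of_analyticRankEK_eq_one`, i.e. through the NAMED FACTS `h₁ = analyticRankEK_eq_one_iff_LDerivEK_ne_zero`
(Gross–Zagier 1986 I.§7) and `h₂ = mordellWeilRank_eq_one_of_LDerivEK_ne_zero` (Gross–Zagier 1986 Thm. I.6.3 + Kolyvagin 1990 Thm. A +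
Heegner-point existence; Gross 1991 (1.1), Thm. 1.3), under the Heegner hypothesis for `N = N_E`. 20728 carries no analytic-rank binder
(in analytic rank `≥ 3` input (7) stays open). No summit statement is proved. [cite: GrossZagier1986, I.§7 and Thm. I.6.3]
[cite: Kolyvagin1990, Thm. A] [cite: Gross1991, (1.1) and Thm. 1.3] [cite: Serre1972, §1.11 Prop. 12 c)] -/
theorem hfixBound_supersingular_of_analyticRankEK_eq_one (W₀ : WeierstrassCurve ℚ) [W₀.IsElliptic] [W₀.IsGloballyMinimal]
    {N : ℕ} [NeZero N] (h₁ : analyticRankEK_eq_one_iff_LDerivEK_ne_zero W₀ N K)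
    (h₂ : mordellWeilRank_eq_one_of_LDerivEK_ne_zero W₀ K) (hN : W₀.conductorNorm ℤ = N)
    (hH : SatisfiesHeegnerHypothesis N K) (hr : analyticRankEK W₀ K = 1)
    (hp2 : p ≠ 2) (hgood : W₀.HasGoodReductionAtPrime p) (hss : (p : ℤ) ∣ W₀.frobeniusTrace p)
    (hρ : W₀.HasSurjectiveModNGaloisRep p) (hK : IsImaginaryQuadratic K)
    {v : HeightOneSpectrum (𝓞 K)} (hpv : ((p : ℕ) : 𝓞 K) ∈ v.asIdeal) (hpvbar : ((p : ℕ) : 𝓞 K) ∈ vbar.asIdeal)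
    (hne : vbar ≠ v) (hγ : ZpExtension.IsTopGeneratorPair κ₁ κ₂ γ₁ γ₂) :
    ∃ k : ℕ, HfixBound (W₀.baseChange K) κ₁ κ₂ vbar γ₁ γ₂ k :=
  hfixBound_supersingular_of_HGZ κ₁ κ₂ vbar γ₁ γ₂ v W₀ hp2 hgood hss hρ hK hpv hpvbar hne hγ
    (mordellWeilRank_eq_one_of_analyticRankEK_eq_one W₀ N K h₁ h₂ hK hN hH hr)

/-- **Door (7-bot)'s `hfix` on 20728's analytic-rank-one sub-range at EVERY split good `p ≠ 2`, fact ledger in the signature** (v1.12 assembly +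
V#26b price): named facts `h₁`, `h₂` (GZ86 I.§7; GZ86 I.6.3 + Kolyvagin 90 + Heegner-point existence), the Heegner hypothesis, `analyticRankEK E K = 1`,
20728's split-prime / `Surj` / generator-pair binders, and — ONLY at ordinary `p` — the typed local input `OrdinaryNonsplit p (E_K) v̄` (Serre 1968
IV-A.2 for non-CM `E`). No summit statement is proved. [cite: GrossZagier1986, I.§7 and Thm. I.6.3] [cite: Kolyvagin1990, Thm. A]
[cite: Gross1991, (1.1) and Thm. 1.3] [cite: Serre1968, IV-A.2] [cite: Serre1972, §1.11 Prop. 11–12] -/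
theorem hfixBound_of_nonsplit_of_analyticRankEK_eq_one (W₀ : WeierstrassCurve ℚ) [W₀.IsElliptic] [W₀.IsGloballyMinimal]
    {N : ℕ} [NeZero N] (h₁ : analyticRankEK_eq_one_iff_LDerivEK_ne_zero W₀ N K)
    (h₂ : mordellWeilRank_eq_one_of_LDerivEK_ne_zero W₀ K) (hN : W₀.conductorNorm ℤ = N)
    (hH : SatisfiesHeegnerHypothesis N K) (hr : analyticRankEK W₀ K = 1)
    (hp2 : p ≠ 2) (hgood : W₀.HasGoodReductionAtPrime p) (hρ : W₀.HasSurjectiveModNGaloisRep p)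
    (hK : IsImaginaryQuadratic K) {v : HeightOneSpectrum (𝓞 K)} (hpv : ((p : ℕ) : 𝓞 K) ∈ v.asIdeal)
    (hpvbar : ((p : ℕ) : 𝓞 K) ∈ vbar.asIdeal) (hne : vbar ≠ v) (hγ : ZpExtension.IsTopGeneratorPair κ₁ κ₂ γ₁ γ₂)
    (hns : ¬ (p : ℤ) ∣ W₀.frobeniusTrace p → OrdinaryNonsplit p (W₀.baseChange K) vbar) :
    ∃ k : ℕ, HfixBound (W₀.baseChange K) κ₁ κ₂ vbar γ₁ γ₂ k :=
  hfixBound_of_nonsplit_of_HGZ κ₁ κ₂ vbar γ₁ γ₂ W₀ hp2 hgood hρ hK hpv hpvbar hne hγ hns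
    (mordellWeilRank_eq_one_of_analyticRankEK_eq_one W₀ N K h₁ h₂ hK hN hH hr)

end OrdinaryResidue

section SerreForm

/-! ## (v1.13) The ordinary residue in SERRE'S FORM over `ℚ` (KatoLine.md §1k)

The typed input `OrdinaryNonsplit p (E_K) v̄` of v1.12 speaks about `E_K` and the place `v̄` of `K`; Serre's theorem speaks about
`E/ℚ` and ONE prime `𝔔` of `ℚ̄` above `p`: for non-CM `E` with good ordinary reduction, every infinite `D_𝔔`-stable subgroup of
`E(ℚ̄)[p^∞]` meets the kernel-of-reduction line (`T_pE|_{D_𝔔}` NON-SPLIT; Serre 1968 IV-A.2 via Tate 1967 Thm. 4 and the Serre–Tate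
canonical lift). This section (i) states that `ℚ`-level local statement `SerreNonsplitAt p E 𝔔` (the two clauses of v1.12 with
`𝔔.inertia Γ_ℚ` / `𝔔.decompositionSubgroup Γ_ℚ`), (ii) PROVES the transport `SerreNonsplitAt ⟹ OrdinaryNonsplit p (E_K) v̄` for `K`
imaginary quadratic with `p = v v̄` split (`res(D_v̄) = D_𝔔`, `res(I_v̄) = I_𝔔`; pull-back along the `Γ_K`-equivariant
`E(ℚ̄)[p^∞] ≃ E_K(K̄)[p^∞]`), (iii) writes the NAMED-FACT SHAPE `Serre1968OrdinaryNonsplit : Prop` (hypothesis `¬ HasCM`; NOT proved —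
the def a typer moves into `Literature/`), (iv) composes door (7-bot): `hfixBound_of_serre_of_HGZ`,
`hfixBound_of_serre_of_analyticRankEK_eq_one`, with `¬ HasCM` from `Surj` by the tree theorem
`WeierstrassCurve.not_hasSurjectiveModNGaloisRep_of_hasCM` (every odd `p`). No summit statement is proved. [cite: Serre1968, IV-A.2]
[cite: Tate1967, Thm. 4] [cite: Serre1972, §1.11 Prop. 11 and Cor.; §4.5] [cite: NeukirchANT1999, Ch. I §9 (9.1)–(9.6)] -/

/-- **A `ℚ`-level ordinary line at a prime `𝔔` of `\bar ℤ_ℚ`**: a non-zero subgroup `X₀ ≤ E(ℚ̄)[p^∞]` killed by `p` on which every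
element of the inertia group `I_𝔔 ≤ Γ_ℚ` acts by an integer scalar, some element by a scalar `≢ 1 (mod p)` (Serre 1972 §1.11 Prop. 11
and Cor.: the kernel-of-reduction line, character `ω` onto `𝔽_pˣ`). The `ℚ`-level twin of `OrdinaryLineAt`.
[cite: Serre1972, §1.11 Prop. 11 and Cor.] -/
def OrdinaryLineAbs (W₀ : WeierstrassCurve ℚ) (𝔔 : Ideal (absIntegers (𝓞 ℚ) ℚ))
    (X₀ : AddSubgroup (W₀.geomPrimaryTorsion p)) : Prop :=
  X₀ ≠ ⊥ ∧ (∀ x ∈ X₀, p • x = 0) ∧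
    (∀ t ∈ 𝔔.inertia (absoluteGaloisGroup ℚ), ∃ c : ℤ, ∀ x ∈ X₀, t • x = c • x) ∧
    ∃ σ ∈ 𝔔.inertia (absoluteGaloisGroup ℚ), ∃ a : ℤ, ¬ (p : ℤ) ∣ a - 1 ∧ ∀ x ∈ X₀, σ • x = a • x

/-- **No `D_𝔔`-stable complement (the `ℚ`-level print input).** Every subgroup `L₀ ≤ E(ℚ̄)[p^∞]` stable under the decomposition
group `D_𝔔 ≤ Γ_ℚ` and meeting `X₀` trivially is FINITE. For `X₀` the ordinary line of a non-CM good-ordinary `E/ℚ` this is Serre 1968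
IV-A.2 (`T_pE|_{D_𝔔}` non-split). The `ℚ`-level twin of `NoStableComplementAt`. [cite: Serre1968, IV-A.2] [cite: Tate1967, Thm. 4] -/
def NoStableComplementAbs (W₀ : WeierstrassCurve ℚ) (𝔔 : Ideal (absIntegers (𝓞 ℚ) ℚ))
    (X₀ : AddSubgroup (W₀.geomPrimaryTorsion p)) : Prop :=
  ∀ L₀ : AddSubgroup (W₀.geomPrimaryTorsion p),
    (∀ d ∈ 𝔔.decompositionSubgroup (absoluteGaloisGroup ℚ), ∀ m ∈ L₀, d • m ∈ L₀) →
      L₀ ⊓ X₀ = ⊥ → (L₀ : Set (W₀.geomPrimaryTorsion p)).Finite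

variable (p) in
/-- **Serre's local non-splitness at `𝔔`, typed**: every `ℚ`-level ordinary line at `𝔔` has no `D_𝔔`-stable infinite complement.
TRUE for non-CM `E/ℚ` with good ordinary reduction at the prime below `𝔔` (Serre 1968 IV-A.2); FALSE for CM curves. NOT proved here.
[cite: Serre1968, IV-A.2] [cite: Tate1967, Thm. 4] -/
def SerreNonsplitAt (W₀ : WeierstrassCurve ℚ) (𝔔 : Ideal (absIntegers (𝓞 ℚ) ℚ)) : Prop :=
  ∀ X₀ : AddSubgroup (W₀.geomPrimaryTorsion p), OrdinaryLineAbs W₀ 𝔔 X₀ → NoStableComplementAbs W₀ 𝔔 X₀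

omit [Fact p.Prime] in
/-- **NAMED-FACT SHAPE (NOT proved; NOT yet a Literature fact): Serre 1968 IV-A.2.** For every elliptic curve `E/ℚ` WITHOUT complex
multiplication and every prime `ℓ` of good ORDINARY reduction, at every prime `𝔔` of `\bar ℤ_ℚ` above `ℓ`: `SerreNonsplitAt ℓ E 𝔔` —
`T_ℓE|_{D_𝔔}` is a NON-SPLIT extension of the unramified character by `ε κ⁻¹` (a splitting makes `E/ℤ_ℓ` the Serre–Tate canonical
lift of its reduction, hence CM: Tate 1967 Thm. 4 + Serre–Tate; the `k = 2`, `ℚ(f) = ℚ` case of Greenberg's local-splitting question).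
The statement a typer should move into `Literature/` with its cite tags; here only a HYPOTHESIS of the doors below.
[cite: Serre1968, IV-A.2] [cite: Tate1967, Thm. 4] [cite: arXiv:1807.02499, p. 3] -/
def Serre1968OrdinaryNonsplit : Prop :=
  ∀ (W₀ : WeierstrassCurve ℚ) [W₀.IsElliptic] [W₀.IsGloballyMinimal], ¬ W₀.HasCM →
    ∀ (ℓ : ℕ) [Fact ℓ.Prime], W₀.HasGoodReductionAtPrime ℓ → ¬ (ℓ : ℤ) ∣ W₀.frobeniusTrace ℓ →
      ∀ u : HeightOneSpectrum (𝓞 ℚ), (Rat.HeightOneSpectrum.primesEquiv u : ℕ) = ℓ →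
        ∀ 𝔔 ∈ u.primesAbove, SerreNonsplitAt ℓ W₀ 𝔔

/-- **TRANSPORT (PROVED): Serre's `ℚ`-level non-splitness at the primes over `p` ⟹ `OrdinaryNonsplit p (E_K) v̄`** (`E/ℚ`, `K`
imaginary quadratic, `p = v v̄` split, `v̄ ≠ v`). With `𝔔 = 𝔓_{v̄} ∩ \bar ℤ_ℚ` (`𝔓_{v̄} = adicCompletionPrime K v̄`): `p` completely
split gives `D_𝔔 ≤ res(Γ_K)` (`SorensenPatching.decompositionSubgroup_le_range_of_ncard_primesOver_eq`), hence `res(D_v̄) = D_𝔔`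
(`comap_decompositionSubgroup_comap_absIntegersMap`, `decompositionSubgroup_adicCompletionPrime_eq_range`) and `res(I_v̄) = I_𝔔`
(`InertiaFixedPoint.map_absGaloisRestrict_inertia_eq`); pull `X`, `L` back along the `Γ_K`-equivariant bijection `φ : E(ℚ̄)[p^∞] →
E_K(K̄)[p^∞]` (`exists_addEquiv_geomPoints_baseChange`): `φ⁻¹X` is a `ℚ`-level ordinary line at `𝔔`, `φ⁻¹L` is `D_𝔔`-stable and meets
it trivially, hence finite, and `L = φ(φ⁻¹L)`. [cite: NeukirchANT1999, Ch. I §9 (9.1)–(9.6)] [cite: Serre1968, IV-A.2] -/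
theorem ordinaryNonsplit_baseChange_of_serreNonsplitAt (W₀ : WeierstrassCurve ℚ) [W₀.IsElliptic]
    (hK : IsImaginaryQuadratic K) {v : HeightOneSpectrum (𝓞 K)} (hpv : ((p : ℕ) : 𝓞 K) ∈ v.asIdeal)
    (hpvbar : ((p : ℕ) : 𝓞 K) ∈ vbar.asIdeal) (hne : vbar ≠ v)
    (h : ∀ u : HeightOneSpectrum (𝓞 ℚ), (Rat.HeightOneSpectrum.primesEquiv u : ℕ) = p →
      ∀ 𝔔 ∈ u.primesAbove, SerreNonsplitAt p W₀ 𝔔) :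
    OrdinaryNonsplit p (W₀.baseChange K) vbar := by
  classical
  haveI : (W₀.baseChange K).IsElliptic := by rw [WeierstrassCurve.baseChange]; infer_instance
  haveI : Algebra.IsQuadraticExtension ℚ K := ⟨hK.1⟩
  haveI : IsGalois ℚ K := inferInstance
  -- the place `u = (p)` of `ℚ` below `v̄`, the prime `𝔓_K` of `\bar ℤ_K` cut out by `v̄`, its contraction `𝔔`
  set u : HeightOneSpectrum (𝓞 ℚ) := vbar.under (𝓞 ℚ) with hudef
  have hu : (Rat.HeightOneSpectrum.primesEquiv u : ℕ) = p :=
    LocalField.primesEquiv_eq_of_natCast_mem p u (natCast_mem_under_rat' hpvbar)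
  set 𝔓K : Ideal (absIntegers (𝓞 K) K) := adicCompletionPrime K vbar with h𝔓Kdef
  set 𝔔 : Ideal (absIntegers (𝓞 ℚ) ℚ) := 𝔓K.comap (absIntegersMap ℚ K) with h𝔔def
  have hwu : vbar.asIdeal.under (𝓞 ℚ) = u.asIdeal := (HeightOneSpectrum.under_asIdeal (𝓞 ℚ) vbar).symm
  have h𝔔 : 𝔔 ∈ u.primesAbove :=
    comap_absIntegersMap_mem_primesAbove hwu (adicCompletionPrime_mem_primesAbove K vbar)
  -- `res(D_v̄) = D_𝔔` and `res(I_v̄) = I_𝔔` since `p` splits completely in `K`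
  have hsplit : ((u.asIdeal).primesOver (𝓞 K)).ncard = Module.finrank ℚ K :=
    ZpExtension.ncard_primesOver_under_eq_finrank_of_ne hK.1 hpvbar hpv hne.symm
  have hD : 𝔔.decompositionSubgroup (absoluteGaloisGroup ℚ) ≤ (absGaloisRestrict ℚ K).toMonoidHom.range :=
    SorensenPatching.decompositionSubgroup_le_range_of_ncard_primesOver_eq hsplit h𝔔
  have hI : GreenbergSelmer.inertia vbar = 𝔓K.inertia (absoluteGaloisGroup K) :=
    (inertia_adicCompletionPrime_eq_map_absInertia K vbar).symm
  have hres : (GreenbergSelmer.inertia vbar).map (absGaloisRestrict ℚ K).toMonoidHom =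
      𝔔.inertia (absoluteGaloisGroup ℚ) := by
    rw [hI, h𝔔def, InertiaFixedPoint.map_absGaloisRestrict_inertia_eq 𝔓K hD]
  have hDK : GreenbergSelmer.decomp vbar = 𝔓K.decompositionSubgroup (absoluteGaloisGroup K) :=
    (decompositionSubgroup_adicCompletionPrime_eq_range K vbar).symm
  -- every `d₀ ∈ D_𝔔` is `res d` for some `d ∈ D_v̄`
  have hlift : ∀ d₀ ∈ 𝔔.decompositionSubgroup (absoluteGaloisGroup ℚ),
      ∃ d ∈ GreenbergSelmer.decomp vbar, absGaloisRestrict ℚ K d = d₀ := by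
    intro d₀ hd₀
    obtain ⟨d, hd⟩ := hD hd₀
    have hd' : absGaloisRestrict ℚ K d = d₀ := hd
    refine ⟨d, ?_, hd'⟩
    rw [hDK, ← comap_decompositionSubgroup_comap_absIntegersMap ℚ K 𝔓K, Subgroup.mem_comap]
    change absGaloisRestrict ℚ K d ∈ 𝔔.decompositionSubgroup (absoluteGaloisGroup ℚ)
    rw [hd']
    exact hd₀
  -- the `Γ_K`-equivariant bijection `φ : E(ℚ̄)[p^∞] → E_K(K̄)[p^∞]`
  obtain ⟨e, he⟩ := W₀.exists_addEquiv_geomPoints_baseChange K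
  have hmem : ∀ x : W₀.geomPrimaryTorsion p, e (x : W₀.geomPoints) ∈ (W₀.baseChange K).geomPrimaryTorsion p := by
    intro x
    obtain ⟨k, hk⟩ := x.2
    exact ⟨k, by rw [← map_nsmul, hk, map_zero]⟩
  let φ : W₀.geomPrimaryTorsion p →+ (W₀.baseChange K).geomPrimaryTorsion p :=
    { toFun := fun x ↦ ⟨e (x : W₀.geomPoints), hmem x⟩
      map_zero' := Subtype.ext (by simp)
      map_add' := fun x y ↦ Subtype.ext (by simp) }
  have hφval : ∀ x : W₀.geomPrimaryTorsion p,
      ((φ x : (W₀.baseChange K).geomPrimaryTorsion p) : (W₀.baseChange K).geomPoints) = e (x : W₀.geomPoints) :=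
    fun _ ↦ rfl
  have hφinj : Function.Injective φ := by
    intro x y hxy
    have h1 : e (x : W₀.geomPoints) = e (y : W₀.geomPoints) := by
      rw [← hφval x, ← hφval y, hxy]
    exact Subtype.ext (e.injective h1)
  have hφsurj : Function.Surjective φ := by
    intro y
    have hy : e.symm (y : (W₀.baseChange K).geomPoints) ∈ W₀.geomPrimaryTorsion p := by
      obtain ⟨k, hk⟩ := y.2
      exact ⟨k, by rw [← map_nsmul, hk, map_zero]⟩
    refine ⟨⟨e.symm (y : (W₀.baseChange K).geomPoints), hy⟩, Subtype.ext ?_⟩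
    rw [hφval]
    exact e.apply_symm_apply _
  have hφsmul : ∀ (t : absoluteGaloisGroup K) (x : W₀.geomPrimaryTorsion p),
      φ (absGaloisRestrict ℚ K t • x) = t • φ x := by
    intro t x
    apply Subtype.ext
    rw [hφval, primaryComponent.coe_smul, he, primaryComponent.coe_smul, hφval]
  have hφzero : ∀ x : W₀.geomPrimaryTorsion p, φ x = 0 → x = 0 := fun x hx ↦ hφinj (by rw [hx, map_zero])
  -- the statement
  intro X hX L hLst hLX
  obtain ⟨hXne, hXp, hXsc, σ, hσI, a, ha, hσa⟩ := hX
  -- pull back `X` and `L`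
  set X₀ : AddSubgroup (W₀.geomPrimaryTorsion p) := X.comap φ with hX₀def
  set L₀ : AddSubgroup (W₀.geomPrimaryTorsion p) := L.comap φ with hL₀def
  have hX₀ : OrdinaryLineAbs W₀ 𝔔 X₀ := by
    refine ⟨?_, ?_, ?_, ?_⟩
    · -- `X₀ ≠ ⊥`
      obtain ⟨⟨x, hxX⟩, hx0⟩ := (AddSubgroup.ne_bot_iff_exists_ne_zero).mp hXne
      obtain ⟨x₀, hx₀⟩ := hφsurj x
      have hx₀X : x₀ ∈ X₀ := by
        rw [hX₀def, AddSubgroup.mem_comap, hx₀]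
        exact hxX
      intro hbot
      have h0 : x₀ = 0 := (AddSubgroup.eq_bot_iff_forall _).mp hbot x₀ hx₀X
      apply hx0
      apply Subtype.ext
      change x = 0
      rw [← hx₀, h0, map_zero]
    · -- killed by `p`
      intro x hx
      apply hφzero
      rw [map_nsmul, hXp _ (AddSubgroup.mem_comap.mp hx), ]
    · -- every `t₀ ∈ I_𝔔` acts by a scalar
      intro t₀ ht₀
      rw [← hres] at ht₀
      obtain ⟨t, htI, htt₀⟩ := Subgroup.mem_map.mp ht₀
      have htt₀' : absGaloisRestrict ℚ K t = t₀ := htt₀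
      obtain ⟨c, hc⟩ := hXsc t htI
      refine ⟨c, fun x hx ↦ hφinj ?_⟩
      rw [← htt₀', hφsmul, hc _ (AddSubgroup.mem_comap.mp hx), map_zsmul]
    · -- `res σ ∈ I_𝔔` acts by `a ≢ 1`
      have hσ₀ : (absGaloisRestrict ℚ K).toMonoidHom σ ∈ 𝔔.inertia (absoluteGaloisGroup ℚ) :=
        hres ▸ Subgroup.mem_map_of_mem _ hσI
      refine ⟨absGaloisRestrict ℚ K σ, hσ₀, a, ha, fun x hx ↦ hφinj ?_⟩
      rw [hφsmul, hσa _ (AddSubgroup.mem_comap.mp hx), map_zsmul]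
  have hL₀st : ∀ d₀ ∈ 𝔔.decompositionSubgroup (absoluteGaloisGroup ℚ), ∀ m ∈ L₀, d₀ • m ∈ L₀ := by
    intro d₀ hd₀ m hm
    obtain ⟨d, hd, hdd₀⟩ := hlift d₀ hd₀
    rw [hL₀def, AddSubgroup.mem_comap, ← hdd₀, hφsmul]
    exact hLst d hd _ (AddSubgroup.mem_comap.mp hm)
  have hL₀X₀ : L₀ ⊓ X₀ = ⊥ := by
    rw [AddSubgroup.eq_bot_iff_forall]
    intro x hx
    apply hφzero
    have hφx : φ x ∈ L ⊓ X :=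
      AddSubgroup.mem_inf.mpr ⟨AddSubgroup.mem_comap.mp (AddSubgroup.mem_inf.mp hx).1,
        AddSubgroup.mem_comap.mp (AddSubgroup.mem_inf.mp hx).2⟩
    rw [hLX] at hφx
    exact (AddSubgroup.mem_bot).mp hφx
  have hfin : (L₀ : Set (W₀.geomPrimaryTorsion p)).Finite := h u hu 𝔔 h𝔔 X₀ hX₀ L₀ hL₀st hL₀X₀
  have hLeq : L = L₀.map φ := (AddSubgroup.map_comap_eq_self_of_surjective hφsurj L).symm
  rw [hLeq, AddSubgroup.coe_map]
  exact hfin.image _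

/-- **`OrdinaryNonsplit` for base changes from the named-fact shape (PROVED modulo `Serre1968OrdinaryNonsplit`).** For `E/ℚ`
non-CM with good ordinary reduction at `p`, `K` imaginary quadratic with `p = v v̄` split: `OrdinaryNonsplit p (E_K) v̄`.
[cite: Serre1968, IV-A.2] [cite: NeukirchANT1999, Ch. I §9 (9.1)–(9.6)] -/
theorem ordinaryNonsplit_baseChange_of_serre (hS : Serre1968OrdinaryNonsplit) (W₀ : WeierstrassCurve ℚ) [W₀.IsElliptic]
    [W₀.IsGloballyMinimal] (hCM : ¬ W₀.HasCM) (hgood : W₀.HasGoodReductionAtPrime p) (hord : ¬ (p : ℤ) ∣ W₀.frobeniusTrace p)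
    (hK : IsImaginaryQuadratic K) {v : HeightOneSpectrum (𝓞 K)} (hpv : ((p : ℕ) : 𝓞 K) ∈ v.asIdeal)
    (hpvbar : ((p : ℕ) : 𝓞 K) ∈ vbar.asIdeal) (hne : vbar ≠ v) :
    OrdinaryNonsplit p (W₀.baseChange K) vbar :=
  ordinaryNonsplit_baseChange_of_serreNonsplitAt vbar W₀ hK hpv hpvbar hne
    (fun u hu 𝔔 h𝔔 ↦ hS W₀ hCM p hgood hord u hu 𝔔 h𝔔)

/-- **Door (7-bot)'s `hfix` on ALL of 20728's range from the HGZ conclusion and the ONE named-fact shape `Serre1968OrdinaryNonsplit`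
(PROVED modulo that shape).** For `E/ℚ` globally minimal with good reduction at `p ≠ 2`, surjective mod-`p` representation (hence
non-CM: `WeierstrassCurve.not_hasSurjectiveModNGaloisRep_of_hasCM`, Zywina 2015 Prop. 1.14 / Serre 1972 §4.5, a tree THEOREM), `K`
imaginary quadratic with `p = v v̄` split, a topological generator pair, and `rank E(K) = 1 ∧ Ш(E/K)` finite: `∃ k, HfixBound (E_K) κ₁ κ₂
v̄ γ₁ γ₂ k`. Serre's fact is used only when `p` is ordinary. No summit statement is proved. [cite: Serre1968, IV-A.2]
[cite: Zywina2015, Prop. 1.14] [cite: Serre1972, §1.11, §4.5] [cite: MilneADT2006, I Thm. 4.10] [cite: Kolyvagin1990, Thm. A] -/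
theorem hfixBound_of_serre_of_HGZ (hS : Serre1968OrdinaryNonsplit) (W₀ : WeierstrassCurve ℚ) [W₀.IsElliptic]
    [W₀.IsGloballyMinimal] (hp2 : p ≠ 2) (hgood : W₀.HasGoodReductionAtPrime p) (hρ : W₀.HasSurjectiveModNGaloisRep p)
    (hK : IsImaginaryQuadratic K) {v : HeightOneSpectrum (𝓞 K)} (hpv : ((p : ℕ) : 𝓞 K) ∈ v.asIdeal)
    (hpvbar : ((p : ℕ) : 𝓞 K) ∈ vbar.asIdeal) (hne : vbar ≠ v) (hγ : ZpExtension.IsTopGeneratorPair κ₁ κ₂ γ₁ γ₂)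
    (hGZK : (W₀.baseChange K).mordellWeilRank = 1 ∧ (W₀.baseChange K).ShaFinite) :
    ∃ k : ℕ, HfixBound (W₀.baseChange K) κ₁ κ₂ vbar γ₁ γ₂ k :=
  have hCM : ¬ W₀.HasCM := fun hcm ↦
    W₀.not_hasSurjectiveModNGaloisRep_of_hasCM hcm (Fact.out : p.Prime) hp2 hρ
  hfixBound_of_nonsplit_of_HGZ κ₁ κ₂ vbar γ₁ γ₂ W₀ hp2 hgood hρ hK hpv hpvbar hne hγ
    (fun hord ↦ ordinaryNonsplit_baseChange_of_serre vbar hS W₀ hCM hgood hord hK hpv hpvbar hne) hGZK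

/-- **Door (7-bot)'s `hfix` on ALL of 20728's range in analytic rank one over `K`, with the COMPLETE FACT LEDGER in the signature**:
the Heegner-point named facts `h₁ = analyticRankEK_eq_one_iff_LDerivEK_ne_zero` (Gross–Zagier 1986 I.§7), `h₂ =
mordellWeilRank_eq_one_of_LDerivEK_ne_zero` (Gross–Zagier 1986 Thm. I.6.3 + Kolyvagin 1990 + Heegner-point existence) and the local
named-fact shape `Serre1968OrdinaryNonsplit` (Serre 1968 IV-A.2, used at ordinary `p` only); everything else is a binder of 20728 or a
theorem of the tree. No summit statement is proved. [cite: GrossZagier1986, I.§7, Thm. I.6.3] [cite: Kolyvagin1990, Thm. A]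
[cite: Gross1991, (1.1), Thm. 1.3] [cite: Serre1968, IV-A.2] [cite: Zywina2015, Prop. 1.14] -/
theorem hfixBound_of_serre_of_analyticRankEK_eq_one (hS : Serre1968OrdinaryNonsplit) (W₀ : WeierstrassCurve ℚ) [W₀.IsElliptic]
    [W₀.IsGloballyMinimal] {N : ℕ} [NeZero N] (h₁ : analyticRankEK_eq_one_iff_LDerivEK_ne_zero W₀ N K)
    (h₂ : mordellWeilRank_eq_one_of_LDerivEK_ne_zero W₀ K) (hN : W₀.conductorNorm ℤ = N)
    (hH : SatisfiesHeegnerHypothesis N K) (hr : analyticRankEK W₀ K = 1)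
    (hp2 : p ≠ 2) (hgood : W₀.HasGoodReductionAtPrime p) (hρ : W₀.HasSurjectiveModNGaloisRep p)
    (hK : IsImaginaryQuadratic K) {v : HeightOneSpectrum (𝓞 K)} (hpv : ((p : ℕ) : 𝓞 K) ∈ v.asIdeal)
    (hpvbar : ((p : ℕ) : 𝓞 K) ∈ vbar.asIdeal) (hne : vbar ≠ v) (hγ : ZpExtension.IsTopGeneratorPair κ₁ κ₂ γ₁ γ₂) :
    ∃ k : ℕ, HfixBound (W₀.baseChange K) κ₁ κ₂ vbar γ₁ γ₂ k :=
  hfixBound_of_serre_of_HGZ κ₁ κ₂ vbar γ₁ γ₂ hS W₀ hp2 hgood hρ hK hpv hpvbar hne hγ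
    (mordellWeilRank_eq_one_of_analyticRankEK_eq_one W₀ N K h₁ h₂ hK hN hH hr)

/-- **The named-fact shape IS the Literature named fact** `serre1968_locallyNonsplit_of_not_hasCM`
(`Literature/NumberTheory/EllipticCurves/Serre1968OrdinaryLocalNonsplit.lean`, v1.14; the bodies of `Serre1968.IsOrdinaryLineAt` /
`HasNoStableComplementAt` / `LocallyNonsplitAt` are those of `OrdinaryLineAbs` / `NoStableComplementAbs` / `SerreNonsplitAt`, so the
proof is the identity). [cite: Serre1968, IV-A.2] -/
theorem serre1968OrdinaryNonsplit_of_literature (h : serre1968_locallyNonsplit_of_not_hasCM) : Serre1968OrdinaryNonsplit :=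
  fun W₀ _ _ hCM ℓ _ hg ho u hu 𝔔 h𝔔 X₀ hX ↦ h W₀ hCM ℓ hg ho u hu 𝔔 h𝔔 X₀ hX

/-- **Door (7-bot)'s `hfix` against the LITERATURE fact ledger (v1.14)**: `(hS : serre1968_locallyNonsplit_of_not_hasCM)` (Serre 1968
IV-A.2), `(h₁ : analyticRankEK_eq_one_iff_LDerivEK_ne_zero E N K)`, `(h₂ : mordellWeilRank_eq_one_of_LDerivEK_ne_zero E K)` (Heegner
points) — three Literature NAMED FACTS — plus 20728's binders and `analyticRankEK E K = 1` give `∃ k, HfixBound (E_K) κ₁ κ₂ v̄ γ₁ γ₂ k` on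
ALL residue types. Nothing else is assumed; no summit statement is proved. [cite: Serre1968, IV-A.2] [cite: GrossZagier1986, I.§7, Thm. I.6.3]
[cite: Kolyvagin1990, Thm. A] -/
theorem hfixBound_of_literature_of_analyticRankEK_eq_one (hS : serre1968_locallyNonsplit_of_not_hasCM)
    (W₀ : WeierstrassCurve ℚ) [W₀.IsElliptic] [W₀.IsGloballyMinimal] {N : ℕ} [NeZero N]
    (h₁ : analyticRankEK_eq_one_iff_LDerivEK_ne_zero W₀ N K) (h₂ : mordellWeilRank_eq_one_of_LDerivEK_ne_zero W₀ K)
    (hN : W₀.conductorNorm ℤ = N) (hH : SatisfiesHeegnerHypothesis N K) (hr : analyticRankEK W₀ K = 1)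
    (hp2 : p ≠ 2) (hgood : W₀.HasGoodReductionAtPrime p) (hρ : W₀.HasSurjectiveModNGaloisRep p)
    (hK : IsImaginaryQuadratic K) {v : HeightOneSpectrum (𝓞 K)} (hpv : ((p : ℕ) : 𝓞 K) ∈ v.asIdeal)
    (hpvbar : ((p : ℕ) : 𝓞 K) ∈ vbar.asIdeal) (hne : vbar ≠ v) (hγ : ZpExtension.IsTopGeneratorPair κ₁ κ₂ γ₁ γ₂) :
    ∃ k : ℕ, HfixBound (W₀.baseChange K) κ₁ κ₂ vbar γ₁ γ₂ k :=
  hfixBound_of_serre_of_analyticRankEK_eq_one κ₁ κ₂ vbar γ₁ γ₂ (serre1968OrdinaryNonsplit_of_literature hS) W₀ h₁ h₂ hN hH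
    hr hp2 hgood hρ hK hpv hpvbar hne hγ

end SerreForm








end Summit.BirchSwinnertonDyer.BirchSwinnertonDyer.Cruxes.TwoVariableEulerSystemDivisibility.KatoLineSupply

end
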